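import Literature.MathematicalPhysics.QuantumFieldTheory.Balaban1983to89.B3Op116KernelRegularTorus

/-!
# Bałaban, *(Higgs)₂,₃ quantum fields in a finite volume III. Renormalization* [B3] — the kernel of the operator (1.16) p. 414 at a
regular background ON THE TORUS `Ω = T_ε`, `n = n′ = 1`: THE DECAY HALF — «the Hölder norms … of this kernel … are exponentially
decaying with the distance of the arguments» — for the VALUE of the kernel, PROVED uniformly in `k` from the (2.10) bounds of
`G_k(T,B)`, `G_k(T,A+B)` and the [13] Cor. 2.3 pairings (sibling leaf of `B3Op116KernelRegularTorus`, whose v1.3 proved the uniform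
bound `kernel116_one_one_unif_le` without the decay factor; that file is at the gate's size limit)

statement-level skeleton of published theorems with citation tags; proofs where landed; nothing here is a claim about the Yang–Mills mass gap

T. Bałaban, Commun. Math. Phys. **88** (1983) 411–445 [cite: Balaban1983Higgs3]; part I, Commun. Math. Phys. **85** (1982) 603–636
[cite: Balaban1982Higgs1]; [13] = T. Bałaban, *Regularity and decay of lattice Green's functions*, Commun. Math. Phys. **89** (1983)
571–597 [cite: Balaban1983RegularityDecay].  PDFs held: `paper:balaban1983-higgs-2-3-quantum-fields-finite-volume` (journal page =
PDF page + 410; p. 414 = `p0004.txt`, p. 424 = `p0014.txt`, p. 426 = `p0016.txt`), `paper:balaban1982-cmp85-higgs23-i`.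

CITATION HEADER (lean-in-tree rule).  Cell `lit-balaban` (HOME `run/shared/lean/pub/lit-balaban/`), reader/typer seat **r14** gen 20
(unit `lit-balaban-r14`); TAKING lines HOME/STATUS 2026-08-23T00:45:37Z (the (1.16) analytic-half programme; owner r15 no objection)
and 2026-08-23T05:06:30Z (this leaf); design `lit-balaban-r14/DESIGN-B3-116-analytic.md` §4.3 («MILESTONE ORDER (gen 20): (2) DECAY»).
SKELETON row **B3.Eq1.16 (analytic half)** (fold owner r15); decl of record `B3Sect2StatementsPart2.ScaledKernels.Ineq25At` (r15),
clause (ii); consumer p40's FILE 5(b) `B3Ineq25Op116Smooth.ineq25At_op116_smooth_torus_of_bounds` (binder `hV`).  USED BY NAME,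
never restated: r14 g19's `B3Op116KernelRegularTorus.{col, dcol, col_le, dcol_le, dcol_le_add_split, majorant_shift_le(′),
majorant_mono, majorant_comm, top_bump_le_majorant_succ, mesh_sq_mul_inv_pow_eq, chainConst, bond_chain3_le', sum_block_exp_le,
blockavg_scale_algebra, block_avg_col_le_majorant, block_avg_mono, norm_mapE_avgSrc_le_block, sum_site_le_sum_bond_src, mK, adjD, gM,
sqrt_bondInner_DGDt_le, abs_bondInner_DGDt_le, sum_norm_sq_eq_inv_mul_bondInner, sum_bond_tgt_eq, norm_G_cb_le_col, row_col_majorant,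
row_dcol_majorant, inner_value_row_le, inner_deriv_row_le, value_chains_eq, deriv_chains_eq, outer_row_le, sum_mul_sum_blockK_comm}`,
r14's `B3Op116ScaleChains.{sq_col_weighted_le, sum_mesh_rpow_le, rate_eq}`, `B3Op116SourceForm.{op116_one_one_apply, avgSrc, srcV,
covDerivAt}`, p40's `B3Op116Pieces.norm_mulM_apply_le`, r14 g14's `B1Ineq18RegularRegion.gammaReg_pos`, the typer's
`HiggsCovariancePos.sum_site_dir`, `B1Ineq234LevelZero.{tdist_comm, tdist_triangle_real, tdist_shift_le_one}`,
`B3Ineq210RegularTorus.covDeriv_add''`, `B1.{aSeq_pos, aSeq_le}`, Mathlib's `Real.sum_mul_le_sqrt_mul_sqrt`.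

## What is printed

[B3] p. 414 [PDF 4] (verbatim): *"for n, n′ sufficiently large, a kernel of the operator (1.16) is a sufficiently regular function of
both variables. More exactly the Hölder norms of the covariant derivatives of this kernel, the norms defined for example in the
inequalities (I.2.24) and (I.2.25) of Proposition I.2.1, are exponentially decaying with the distance of the arguments and are uniformly
bounded by O(1)(e(L^kε)^{1−α})^{n+n′}, where α > 0 but can be arbitrarily small. This estimate follows easily from the properties of the
propagators G_k(Ω, A) proved in the next paper."*  (2.5) p. 424: *"‖h(…(1.16))h′‖_{1,α} ≤ O((e(L^kε)p(L^kε))^{n+n′})e^{−δ₀dist(supp h,supp h′)}"*.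
(2.10) p. 426: *"|G^η_{(j)}(Ω, B̃; x, x′)| ≤ O(1)(L^jη)^{−d+2}e^{−δ₁(L^jη)^{−1}|x−x′|}"*.

## What this file proves, and how (the print's «exponentially decaying with the distance of the arguments»)

The value of the kernel of (1.16) at `n = n′ = 1` is `r(x) = (G_k(T,B)V_kG_k(T,A+B)V_kG_k(T,B)e_{(x′,i′)})(x)`; THEOREM A of
`B3Op116SourceForm` writes `V_k = −Σ_b[D^*M + M^*D + M^*M] − a_k(L^kε)^{−2}·avg`, so `r` is a sum of sixteen source pairings.  v1.3 of
the base file bounded them uniformly in `k`; the chain terms already carried `e^{−(δ₁/4)|x−x′|/L^k}`, but the four AVERAGING pairings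
and the NINTH (`M^*D∘D^*M`, `L²`) term were bounded by row sums / Cauchy–Schwarz WITHOUT decay.  Here:
§1 ONE CURRENCY: every (2.10) majorant is weakened to `k+1` scales and rate `δ₁/2` (`weaken`, `col_le_weak`, `dcol_le_weak`), the
currency in which the block-averaged columns are majorants (`block_avg_col_le_majorant`).  §2/§6 the five chain shapes re-run in it
(`chainT1w…T5w_le`: `bond_chain3_le'` at `(k+1, δ₁/2)`, decay `e^{−(δ₁/8)(L^{k+1}ε)^{−1}ε|x−x′|}`).  §3 `block_avg_le_of_majorant` (a
`k`-block average of any function below a value majorant is ONE top-scale bump WITH its decay — abstract form of `block_avg_col_le`),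
`block_row_le`/`block_row_majorant` (the smeared ROW of the outer averaging source), `blk`, and the AVERAGING CHAINS `chainAVw_le`
(`R ∘ κ_{A+B}(b₊,b′₋) ∘ Blk(b′₋)`, exponents `(p,2,2)`) / `chainADw_le` (`R ∘ κ^D_{B,A+B}(b,b′₋) ∘ Blk`, split `D_B = D_{A+B} − M`).
§4 `norm_G_avgSrc_le_blk`, `norm_covDeriv_G_avgSrc_le_blk` (the inner averaging source pointwise against `Blk`, sites → bonds),
**`avg_value_row_le`**, **`avg_deriv_row_le`** (outer row against the inner averaging source, WITH decay).  §5 THE NINTH TERM WITH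
DECAY **`ninth_term_decay_le`**: `Σ_bκ_B(x,b₊)‖(D^ε_BG_k(T,A+B)D^{ε*}_Bg)(b)‖ ≤ ε^{−d}|e|s·W·(2K + K_θe^{2θ})·e^{−(θ/3)|x−x′|/L^k}` for
every `0 ≤ θ ≤ δ₁/4` with `(4d+4a)θ ≤ γ₀` — NEAR/FAR SPLIT in thirds of `|x−x′|`: the charges `g = g_near + g_far` around `x′` and the
outer column near/far around `x`; the far pieces are exponentially small in `ℓ²` (`weighted_sq_col_tgt_le`, `weighted_sq_col_row_le`
from r14's `sq_col_weighted_le`; `far_row_sq_le`, `far_charge_sq_le`) against the uniform `L²` bound (`sum_norm_sq_DGDt_le`,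
Cauchy–Schwarz), and the near–near piece is a PAIRING WITH SEPARATED SUPPORTS (`near_pairing_le`: linearisation
`Σ_bκ‖Z(b)‖ = ε^{−d}⟨h,Z⟩` with the unit-vector field `h = κZ/‖Z‖`, `abs_bondInner_DGDt_le` at separation `|x−x′|/3 − 2`, `sep_of_near`).
§6 **`termII_decay_le`**, **`termI_decay_le`**; §7 **`termIV_decay_le`** (block-sum exchange, the smeared row IS a majorant of the
common currency, so TERM II applies to it) and **`kernel116_one_one_decay_explicit`**:
`‖r(x)‖ ≤ |e|s·I(θ) + |e|s·II(1,ε^dC) + (|e|s)²·II(2,eε^dC) + a(L^kε)^{−2}m(2+m)·II(2,eK_bε^dC)` with `termId`, `termIId` explicit and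
EVERY term carrying `e^{−(δ₁/8)(L^{k+1}ε)^{−1}ε|x−x′|}` or `e^{−(θ/3)|x−x′|/L^k}`.
§8 (v1.1) THE COLLAPSE TO THE CONSUMER'S SHAPE **`kernel116_one_one_decay_le`**: with `δ′ = rate116 P a δ₁ = min{δ₁/(8L), γ₀/(12d+12a)}`
(`rate116_pos`; `θ = 3δ′` is admissible, `three_rate116_le`) and `t = L^kε|e|s ≤ 1`,
`(ε^d)^{−1}Σ_{i′}‖(G_k(T,B)V_kG_k(T,A+B)V_kG_k(T,B)e_{(x′,i′)})(x)‖ ≤ C_V·t²·(L^kε)²((L^kε)^d)^{−1}·e^{−δ′|x−x′|/L^k}` with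
`C_V = cv116 P N a δ₁ C` an explicit polynomial in the displayed constants, free of `k`, of the volume and of `ε` — pure bookkeeping:
`expW_le_dec` (every chain rate dominates `δ′`), `exp9_eq`, `mesh_succ_rpow` (`(L^{k+1}ε)^{n−d} = L^{n−d}(L^kε)^n((L^kε)^d)^{−1}`),
**`mono_collapse`** (one monomial `pre·chainW`, `pre·(L^kε)^n ≤ Q·t^e(L^kε)²`, `e ≥ 2`), `alpha_mul_sq_le` (`a(L^kε)^{−2}m(2+m)(L^kε)² ≤
a·d(2+d)·t`), `Kbad_le`/`Kth_le` (`t`-free majorants `Kbadp`, `Kthp`), `ninth_collapse`, `termId_collapse`, `termIId_one/two/avg_collapse`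
(coefficients `coef9`, `coefI`, `coefII1`, `coefII2`, `coefII4`).
§9 (v1.2) THE TORUS FORM WITH THE (2.10) INPUTS DISCHARGED **`kernel116_one_one_decay_torus`**: `∃K₀min ∀K₀ ≥ K₀min ∃(t₀, δ′ > 0, C_V ≥ 0)`
— free of the volume, of `k`, of `ε` — `∀` tori of parameters `(d, L)` (`1 ≤ d ≤ 3`, `L ≥ 2`, `K₀ ∣ M`), `1 ≤ k ≤ K`, `L^kε ≤ 1`, fields with
`B`, `A + B` (I.2.23)-regular and `L^kδ|e| ≤ t₀`, `sup|A| ≤ s`, `t ≤ 1`: the same bound — (2.10) for `G_k(T,B)`, `G_k(T,A+B)` from r15/p33's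
`B3Ineq210RegularRegion.ineq210_regularRegion_univ_small`, rate cut to `min δ₁ 1` by `ineq210_rate_mono`, constants transported along
`P.d = d`, `P.L = L` by `cv116_congr`/`rate116_congr`; `cv116_nonneg`.

## Honest scope

This leaf PROVES the exponential decay in `|x − x′|` of every one of the sixteen source pairings of the `n = n′ = 1` kernel on the
torus, with explicit `k`-uniform constants (`d ≤ 3`; `θ` free in the stated range), AND (v1.1, §8) its collapse to p40's binder
shape `C_V·t²·(L^kε)²((L^kε)^d)^{−1}·e^{−δ′|x−x′|/L^k}` under `t = L^kε|e|s ≤ 1` (`kernel116_one_one_decay_le`; `t²` is print's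
`(e(L^kε)p(L^kε))^{n+n′}` at `n + n′ = 2`), AND (v1.2, §9) the torus form with (2.10) discharged.  It does NOT (b) treat `n + n′ ≥ 3`,
the derivative/Hölder/mixed clauses (p35, FILE 4) or
regions `Ω ⊊ T_ε`, (c) state r15's `Ineq25At` (p40, FILE 5), (d) optimise `C_V` or `δ′` (any positive `k`-, volume-, `ε`-free pair serves
the consumer).
The printed RATE `O(1)(e(L^kε)^{1−α})^{n+n′}` for large `n, n′` is NOT claimed (honest rate caveat of the base file).  The (2.10)
input enters §1–§8 as the HYPOTHESIS `Ineq210 δ₁ C` on r15's carrier and is DISCHARGED on the torus in §9 by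
`ineq210_regularRegion_univ_small` (not re-proved here); the field hypotheses ((I.2.23)-regularity of `B` and `A + B`, `sup|A| ≤ s`,
`t ≤ 1`) remain, as in print (regular backgrounds).
No `def … : Prop`, no new named fact (`blk`, `Kbad`, `Kth`, `Wsq`, `chainW`, `Kblk`, `termIId`, `termId` are concrete real-valued
definitions; so are v1.1's `rate116`, `cc0`, `Kbadp`, `Kthp`, `coef9`, `A0`, `coefI`, `coefII1`, `coefII2`, `coefII4`, `cv116`; v1.2 adds
theorems only); axioms standard.  Value = located engine of a by-reference step of B3, NOT summit progress.
-/

noncomputable section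

open scoped BigOperators InnerProductSpace

namespace Literature.MathematicalPhysics.QuantumFieldTheory.Balaban1983to89.B3Op116KernelRegularTorusDecay

open HiggsLattice (ChargeData ScalarField siteInner covDeriv bondInner)
open HiggsCovariance (propagatorK E)
open B1Eq230FluctCov (Ix cb)
open B1Ineq234Concrete (nCol)
open B3Ineq210RegularRegion (regRegionKernels Interior interior_univ)
open B3Op116Pieces (mulM)
open HiggsAveraging (blockIter)
open HiggsCovariancePos (sum_site_dir shiftEquiv)
open B3Op116KernelRegularTorus
open B1Ineq18RegularRegion (gammaReg_pos)

variable {P : HiggsLattice.Params} {N : ℕ}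

/-! ## §1 The common currency `(k+1, δ₁/2)`: every (2.10) majorant weakened to one more scale and half the rate -/

section Currency

variable {C : ChargeData N} {msq a : ℝ} {k K₀ : ℕ} {hL1 : 1 < P.L} {δ₁ Cst : ℝ} {X : HiggsLattice.VecField P 0}

/-- **Weakening to the common currency**: a (2.10) majorant with `k` scales and rate `δ₁ ≥ 0` is below the one with `k + 1` scales and
rate `δ₁/2` (`majorant_mono`). [cite: Balaban1983Higgs3, (2.10) p.426] -/
theorem weaken {c e : ℝ} (hc : 0 ≤ c) (hδ₁ : 0 ≤ δ₁) (u v : HiggsLattice.Site P 0) :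
    ∑ j ∈ Finset.range k, c * P.mesh j ^ e * Real.exp (-(δ₁ * (P.mesh j)⁻¹ * (P.mesh 0 * (HiggsLattice.Site.tdist u v : ℝ))))
      ≤ ∑ j ∈ Finset.range (k + 1), c * P.mesh j ^ e *
          Real.exp (-(δ₁ / 2 * (P.mesh j)⁻¹ * (P.mesh 0 * (HiggsLattice.Site.tdist u v : ℝ)))) :=
  majorant_mono hc (by linarith) (Nat.le_succ k) u v

/-- The column of `G_k(T_ε,X)` in the common currency: `κ_X(u,v) ≤ Σ_{j<k+1} ε^dC(L^jε)^{2−d}e^{−(δ₁/2)(L^jε)^{−1}ε|u−v|}`.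
[cite: Balaban1983Higgs3, (2.6) p.424, (2.10) p.426] -/
theorem col_le_weak (h210 : (regRegionKernels hL1 C Finset.univ X msq a k K₀).Ineq210 δ₁ Cst) (hmsq : 0 < msq) (ha : 0 < a)
    (hk : 1 ≤ k) (hkK : k ≤ P.K) (hδ₁ : 0 ≤ δ₁) (hCst : 0 ≤ Cst) (u v : HiggsLattice.Site P 0) :
    col C msq a k X u v ≤ ∑ j ∈ Finset.range (k + 1), (P.mesh 0 ^ P.d * Cst) * P.mesh j ^ ((2 : ℝ) - (P.d : ℝ)) *
        Real.exp (-(δ₁ / 2 * (P.mesh j)⁻¹ * (P.mesh 0 * (HiggsLattice.Site.tdist u v : ℝ)))) :=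
  (col_le h210 hmsq ha hk hkK u v).trans (weaken (mul_nonneg (pow_nonneg (P.mesh_pos 0).le _) hCst) hδ₁ u v)

/-- The differentiated column in the common currency: `κ^D_{X,X}(b,v) ≤ Σ_{j<k+1} ε^dC(L^jε)^{1−d}e^{−(δ₁/2)(L^jε)^{−1}ε|b₋−v|}`.
[cite: Balaban1983Higgs3, (2.6) p.424, (2.10) p.426] -/
theorem dcol_le_weak (h210 : (regRegionKernels hL1 C Finset.univ X msq a k K₀).Ineq210 δ₁ Cst) (hmsq : 0 < msq) (ha : 0 < a)
    (hk : 1 ≤ k) (hkK : k ≤ P.K) (hδ₁ : 0 ≤ δ₁) (hCst : 0 ≤ Cst) (b : HiggsLattice.PBond P 0) (v : HiggsLattice.Site P 0) :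
    dcol C msq a k X X b v ≤ ∑ j ∈ Finset.range (k + 1), (P.mesh 0 ^ P.d * Cst) * P.mesh j ^ ((1 : ℝ) - (P.d : ℝ)) *
        Real.exp (-(δ₁ / 2 * (P.mesh j)⁻¹ * (P.mesh 0 * (HiggsLattice.Site.tdist b.src v : ℝ)))) :=
  (dcol_le h210 hmsq ha hk hkK b v).trans (weaken (mul_nonneg (pow_nonneg (P.mesh_pos 0).le _) hCst) hδ₁ b.src v)

end Currency

/-! ## §2 The bond–bond chains of the inner VALUE row against an outer row in the common currency (shapes T3, T4, T5) -/

section ChainsWeak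

variable {C : ChargeData N} {A B : HiggsLattice.VecField P 0} {msq a : ℝ} {k K₀ : ℕ} {hL1 : 1 < P.L} {δ₁ Cst : ℝ}

/-- splitting a middle kernel bounded by a sum of two. [folklore] -/
private theorem sum2_split_le (R K : HiggsLattice.PBond P 0 → ℝ) (F G H : HiggsLattice.PBond P 0 → HiggsLattice.PBond P 0 → ℝ)
    (s : ℝ) (hR0 : ∀ b, 0 ≤ R b) (hK0 : ∀ b', 0 ≤ K b') (hF : ∀ b b', F b b' ≤ G b b' + s * H b b') :
    ∑ b : HiggsLattice.PBond P 0, ∑ b' : HiggsLattice.PBond P 0, R b * F b b' * K b'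
      ≤ (∑ b : HiggsLattice.PBond P 0, ∑ b' : HiggsLattice.PBond P 0, R b * G b b' * K b')
        + s * ∑ b : HiggsLattice.PBond P 0, ∑ b' : HiggsLattice.PBond P 0, R b * H b b' * K b' := by
  rw [Finset.mul_sum, ← Finset.sum_add_distrib]
  refine Finset.sum_le_sum fun b _ => ?_
  rw [Finset.mul_sum, ← Finset.sum_add_distrib]
  refine Finset.sum_le_sum fun b' _ => ?_
  have h := mul_le_mul_of_nonneg_left (hF b b') (hR0 b)
  have h2 := mul_le_mul_of_nonneg_right h (hK0 b')
  refine h2.trans (le_of_eq ?_)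
  ring

variable (hδ₁ : 0 < δ₁) (hδ₁1 : δ₁ ≤ 1) (hCst : 0 ≤ Cst)
  (h210B : (regRegionKernels hL1 C Finset.univ B msq a k K₀).Ineq210 δ₁ Cst)
  (h210AB : (regRegionKernels hL1 C Finset.univ (A + B) msq a k K₀).Ineq210 δ₁ Cst)
  (hmsq : 0 < msq) (ha : 0 < a) (hk : 1 ≤ k) (hkK : k ≤ P.K) (i₀ : Ix N) (x x' : HiggsLattice.Site P 0)
  {p cR : ℝ} (hp : 0 < p) (hcR : 0 ≤ cR) (R : HiggsLattice.PBond P 0 → ℝ) (hR0 : ∀ b, 0 ≤ R b)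
  (hR : ∀ b, R b ≤ ∑ j ∈ Finset.range (k + 1), cR * P.mesh j ^ (p - (P.d : ℝ)) *
      Real.exp (-(δ₁ / 2 * (P.mesh j)⁻¹ * (P.mesh 0 * (HiggsLattice.Site.tdist x b.src : ℝ)))))
include hδ₁ hδ₁1 hCst h210B h210AB hmsq ha hk hkK i₀ hp hcR hR0 hR

/-- **Shape T5 in the common currency** — outer row (exponent `p`, `k+1` scales, rate `δ₁/2`) ∘ `κ_{A+B}(b₊,b′₊)` ∘ `κ_B(b′₊,x′)`,
exponents `(p,2,2)`, `p + 4 > d`; decay `e^{−(δ₁/8)(L^{k+1}ε)^{−1}ε|x−x′|}`. [cite: Balaban1983Higgs3, (1.16) p.414, (2.10) p.426] -/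
theorem chainT5w_le (hsum : (P.d : ℝ) < p + 2 + 2) :
    ∑ b : HiggsLattice.PBond P 0, ∑ b' : HiggsLattice.PBond P 0,
        R b * col C msq a k (A + B) b.tgt b'.tgt * col C msq a k B b'.tgt x'
      ≤ chainConst P N (δ₁ / 2) p 2 2 *
          (cR * (Real.exp 1 * (Real.exp 1 * (P.mesh 0 ^ P.d * Cst))) * (Real.exp 1 * (P.mesh 0 ^ P.d * Cst))) *
          P.mesh (k + 1) ^ (p + 2 + 2 - (P.d : ℝ)) *
          Real.exp (-(δ₁ / 2 / 4 * (P.mesh (k + 1))⁻¹ * (P.mesh 0 * (HiggsLattice.Site.tdist x x' : ℝ)))) := by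
  have hc : 0 ≤ P.mesh 0 ^ P.d * Cst := mul_nonneg (pow_nonneg (P.mesh_pos 0).le _) hCst
  have hc1 : 0 ≤ Real.exp 1 * (P.mesh 0 ^ P.d * Cst) := mul_nonneg (Real.exp_nonneg _) hc
  have hc11 : 0 ≤ Real.exp 1 * (Real.exp 1 * (P.mesh 0 ^ P.d * Cst)) := mul_nonneg (Real.exp_nonneg _) hc1
  refine bond_chain3_le' (k := k + 1) hL1 (half_pos hδ₁) (by linarith) hp (by norm_num) (by norm_num) hsum hcR
    hc11 hc1 i₀ x x' _ _ _ hR0 (fun b b' => col_nonneg _ _ _)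
    (fun b' => col_nonneg _ _ _) hR (fun b b' => ?_) (fun b' => ?_)
  · refine (col_le h210AB hmsq ha hk hkK b.tgt b'.tgt).trans ?_
    refine ((majorant_shift_le hδ₁ hδ₁1 hc _ b'.src b'.dir).trans (majorant_shift_le' hδ₁ hδ₁1 hc1 b.src b'.src b.dir)).trans ?_
    exact weaken hc11 hδ₁.le _ _
  · exact ((col_le h210B hmsq ha hk hkK b'.tgt x').trans (majorant_shift_le' hδ₁ hδ₁1 hc b'.src x' b'.dir)).trans
      (weaken hc1 hδ₁.le _ _)

/-- **Shape T3 in the common currency** — outer row ∘ `κ_{A+B}(b₊,b′₊)` ∘ `κ^D_{B,B}(b′,x′)`, exponents `(p,2,1)`, `p + 3 > d`.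
[cite: Balaban1983Higgs3, (1.16) p.414, (2.10) p.426] -/
theorem chainT3w_le (hsum : (P.d : ℝ) < p + 2 + 1) :
    ∑ b : HiggsLattice.PBond P 0, ∑ b' : HiggsLattice.PBond P 0,
        R b * col C msq a k (A + B) b.tgt b'.tgt * dcol C msq a k B B b' x'
      ≤ chainConst P N (δ₁ / 2) p 2 1 *
          (cR * (Real.exp 1 * (Real.exp 1 * (P.mesh 0 ^ P.d * Cst))) * (P.mesh 0 ^ P.d * Cst)) *
          P.mesh (k + 1) ^ (p + 2 + 1 - (P.d : ℝ)) *
          Real.exp (-(δ₁ / 2 / 4 * (P.mesh (k + 1))⁻¹ * (P.mesh 0 * (HiggsLattice.Site.tdist x x' : ℝ)))) := by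
  have hc : 0 ≤ P.mesh 0 ^ P.d * Cst := mul_nonneg (pow_nonneg (P.mesh_pos 0).le _) hCst
  have hc1 : 0 ≤ Real.exp 1 * (P.mesh 0 ^ P.d * Cst) := mul_nonneg (Real.exp_nonneg _) hc
  have hc11 : 0 ≤ Real.exp 1 * (Real.exp 1 * (P.mesh 0 ^ P.d * Cst)) := mul_nonneg (Real.exp_nonneg _) hc1
  refine bond_chain3_le' (k := k + 1) hL1 (half_pos hδ₁) (by linarith) hp (by norm_num) (by norm_num) hsum hcR
    hc11 hc i₀ x x' _ _ _ hR0 (fun b b' => col_nonneg _ _ _)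
    (fun b' => dcol_nonneg _ _ _ _) hR (fun b b' => ?_) (fun b' => ?_)
  · refine (col_le h210AB hmsq ha hk hkK b.tgt b'.tgt).trans ?_
    refine ((majorant_shift_le hδ₁ hδ₁1 hc _ b'.src b'.dir).trans (majorant_shift_le' hδ₁ hδ₁1 hc1 b.src b'.src b.dir)).trans ?_
    exact weaken hc11 hδ₁.le _ _
  · exact dcol_le_weak h210B hmsq ha hk hkK hδ₁.le hCst b' x'

variable {s : ℝ} (hA : ∀ b : HiggsLattice.PBond P 0, |A b| ≤ s)
include hA

/-- **Shape T4 in the common currency** — outer row ∘ `κ^D_{B,A+B}(b′,b₊)` ∘ `κ_B(b′₊,x′)` with the split `D_B = D_{A+B} − M`: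
`≤ [(p,1,2)] + |e|s·[(p,2,2)]`, `p + 3 > d`. [cite: Balaban1983Higgs3, (1.16) p.414, (2.10) p.426] [cite: Balaban1982Higgs1, (3.14) p.614] -/
theorem chainT4w_le (hsum : (P.d : ℝ) < p + 1 + 2) :
    ∑ b : HiggsLattice.PBond P 0, ∑ b' : HiggsLattice.PBond P 0,
        R b * dcol C msq a k B (A + B) b' b.tgt * col C msq a k B b'.tgt x'
      ≤ chainConst P N (δ₁ / 2) p 1 2 *
            (cR * (Real.exp 1 * (P.mesh 0 ^ P.d * Cst)) * (Real.exp 1 * (P.mesh 0 ^ P.d * Cst))) *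
            P.mesh (k + 1) ^ (p + 1 + 2 - (P.d : ℝ)) *
            Real.exp (-(δ₁ / 2 / 4 * (P.mesh (k + 1))⁻¹ * (P.mesh 0 * (HiggsLattice.Site.tdist x x' : ℝ))))
        + |C.e| * s * (chainConst P N (δ₁ / 2) p 2 2 *
            (cR * (Real.exp 1 * (Real.exp 1 * (P.mesh 0 ^ P.d * Cst))) * (Real.exp 1 * (P.mesh 0 ^ P.d * Cst))) *
            P.mesh (k + 1) ^ (p + 2 + 2 - (P.d : ℝ)) *
            Real.exp (-(δ₁ / 2 / 4 * (P.mesh (k + 1))⁻¹ * (P.mesh 0 * (HiggsLattice.Site.tdist x x' : ℝ))))) := by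
  have hc : 0 ≤ P.mesh 0 ^ P.d * Cst := mul_nonneg (pow_nonneg (P.mesh_pos 0).le _) hCst
  have hc1 : 0 ≤ Real.exp 1 * (P.mesh 0 ^ P.d * Cst) := mul_nonneg (Real.exp_nonneg _) hc
  have hc11 : 0 ≤ Real.exp 1 * (Real.exp 1 * (P.mesh 0 ^ P.d * Cst)) := mul_nonneg (Real.exp_nonneg _) hc1
  refine (sum2_split_le R (fun b' => col C msq a k B b'.tgt x') _ (fun b b' => dcol C msq a k (A + B) (A + B) b' b.tgt)
    (fun b b' => col C msq a k (A + B) b'.tgt b.tgt) (|C.e| * s) hR0 (fun b' => col_nonneg _ _ _)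
    (fun b b' => dcol_le_add_split A B (hA b') b.tgt)).trans ?_
  have hes : 0 ≤ |C.e| * s := mul_nonneg (abs_nonneg _) ((abs_nonneg _).trans (hA ⟨x, ⟨0, P.hd⟩⟩))
  refine add_le_add ?_ (mul_le_mul_of_nonneg_left ?_ hes)
  · refine bond_chain3_le' (k := k + 1) hL1 (half_pos hδ₁) (by linarith) hp (by norm_num) (by norm_num) hsum hcR hc1 hc1
      i₀ x x' _ _ _ hR0 (fun b b' => dcol_nonneg _ _ _ _) (fun b' => col_nonneg _ _ _) hR (fun b b' => ?_) (fun b' => ?_)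
    · refine (dcol_le h210AB hmsq ha hk hkK b' b.tgt).trans ?_
      rw [majorant_comm]
      exact (majorant_shift_le' hδ₁ hδ₁1 hc b.src b'.src b.dir).trans (weaken hc1 hδ₁.le _ _)
    · exact ((col_le h210B hmsq ha hk hkK b'.tgt x').trans (majorant_shift_le' hδ₁ hδ₁1 hc b'.src x' b'.dir)).trans
        (weaken hc1 hδ₁.le _ _)
  · refine bond_chain3_le' (k := k + 1) hL1 (half_pos hδ₁) (by linarith) hp (by norm_num) (by norm_num) (by linarith) hcR
      hc11 hc1 i₀ x x' _ _ _ hR0 (fun b b' => col_nonneg _ _ _)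
      (fun b' => col_nonneg _ _ _) hR (fun b b' => ?_) (fun b' => ?_)
    · refine (col_le h210AB hmsq ha hk hkK b'.tgt b.tgt).trans ?_
      rw [majorant_comm]
      exact ((majorant_shift_le hδ₁ hδ₁1 hc _ b'.src b'.dir).trans (majorant_shift_le' hδ₁ hδ₁1 hc1 b.src b'.src b.dir)).trans
        (weaken hc11 hδ₁.le _ _)
    · exact ((col_le h210B hmsq ha hk hkK b'.tgt x').trans (majorant_shift_le' hδ₁ hδ₁1 hc b'.src x' b'.dir)).trans
        (weaken hc1 hδ₁.le _ _)

end ChainsWeak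

/-! ## §3 Block averages of majorised functions; the averaging-source chains in the common currency -/

section BlockAvg

variable {k : ℕ}

/-- **A `k`-block average of a function below a (2.10) value majorant is a single top-scale bump** (`k ≤ K`, `0 < δ₁ ≤ 1`, `c ≥ 0`):
`f(y) ≤ Σ_{j<k} c(L^jε)^{2−d}e^{−δ₁(L^jε)^{−1}ε|y−x′|}` for all `y` gives
`L^{−kd}Σ_{y∈B^k(z̄)} f(y) ≤ [e^{δ₁/2}N(8d/δ₁)^d/(L²−1)]·c·(L^kε)²((L^kε)^d)^{−1}·e^{−(δ₁/2)(L^kε)^{−1}ε|z−x′|}` (the abstract form of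
`block_avg_col_le`: `sum_block_exp_le`, `blockavg_scale_algebra`, `sum_mesh_rpow_le`). [cite: Balaban1982Higgs1, (1.20) p.607] [cite: Balaban1983Higgs3, (2.10) p.426] -/
theorem block_avg_le_of_majorant (hL1 : 1 < P.L) (hkK : k ≤ P.K) {δ₁ c : ℝ} (hδ₁ : 0 < δ₁) (hδ₁1 : δ₁ ≤ 1) (hc : 0 ≤ c)
    (i₀ : Ix N) (x' : HiggsLattice.Site P 0) (f : HiggsLattice.Site P 0 → ℝ)
    (hf : ∀ y, f y ≤ ∑ j ∈ Finset.range k, c * P.mesh j ^ ((2 : ℝ) - (P.d : ℝ)) *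
      Real.exp (-(δ₁ * (P.mesh j)⁻¹ * (P.mesh 0 * (HiggsLattice.Site.tdist y x' : ℝ)))))
    (z : HiggsLattice.Site P 0) :
    ((P.L : ℝ) ^ (k * P.d))⁻¹ * ∑ y ∈ HiggsAveraging.blockK k (blockIter k z), f y
      ≤ (Real.exp (δ₁ / 2) * ((nCol N : ℝ) * (4 * P.d / (δ₁ / 2)) ^ P.d) / ((P.L : ℝ) ^ (2 : ℝ) - 1)) * c *
          (P.mesh k ^ (2 : ℝ) * (P.mesh k ^ P.d)⁻¹) *
          Real.exp (-(δ₁ / 2 * (P.mesh k)⁻¹ * (P.mesh 0 * (HiggsLattice.Site.tdist z x' : ℝ)))) := by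
  have hLk0 : (0 : ℝ) < ((P.L : ℝ) ^ (k * P.d))⁻¹ := by have := P.hL; positivity
  set E : ℝ := Real.exp (-(δ₁ / 2 * (P.mesh k)⁻¹ * (P.mesh 0 * (HiggsLattice.Site.tdist z x' : ℝ)))) with hE
  set Kb : ℝ := Real.exp (δ₁ / 2) * ((nCol N : ℝ) * (4 * P.d / (δ₁ / 2)) ^ P.d) with hKb
  have hKb0 : 0 ≤ Kb := by
    have : 0 ≤ (4 * (P.d : ℝ) / (δ₁ / 2)) ^ P.d := pow_nonneg (by positivity) _
    rw [hKb]; positivity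
  have step1 : ∑ y ∈ HiggsAveraging.blockK k (blockIter k z), f y
      ≤ ∑ j ∈ Finset.range k, c * P.mesh j ^ ((2 : ℝ) - (P.d : ℝ)) *
          ∑ y ∈ HiggsAveraging.blockK k (blockIter k z),
            Real.exp (-(δ₁ / (P.L : ℝ) ^ j * (HiggsLattice.Site.tdist y x' : ℝ))) := by
    calc ∑ y ∈ HiggsAveraging.blockK k (blockIter k z), f y
        ≤ ∑ y ∈ HiggsAveraging.blockK k (blockIter k z), ∑ j ∈ Finset.range k,
            c * P.mesh j ^ ((2 : ℝ) - (P.d : ℝ)) *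
              Real.exp (-(δ₁ / (P.L : ℝ) ^ j * (HiggsLattice.Site.tdist y x' : ℝ))) := by
          refine Finset.sum_le_sum fun y _ => (hf y).trans (le_of_eq ?_)
          simp only [B3Op116ScaleChains.rate_eq]
      _ = _ := by rw [Finset.sum_comm]; simp_rw [Finset.mul_sum]
  have step2 : ∀ j ∈ Finset.range k,
      c * P.mesh j ^ ((2 : ℝ) - (P.d : ℝ)) *
          ∑ y ∈ HiggsAveraging.blockK k (blockIter k z), Real.exp (-(δ₁ / (P.L : ℝ) ^ j * (HiggsLattice.Site.tdist y x' : ℝ)))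
        ≤ c * Kb * E * (P.mesh j ^ ((2 : ℝ) - (P.d : ℝ)) * ((P.L : ℝ) ^ j) ^ P.d) := by
    intro j hj
    have hjk : j ≤ k := (Finset.mem_range.1 hj).le
    have hb := sum_block_exp_le (N := N) hkK hδ₁ hδ₁1 hjk z x' i₀
    have hE' : Real.exp (-(δ₁ / 2 / (P.L : ℝ) ^ k * (HiggsLattice.Site.tdist z x' : ℝ))) = E := by
      rw [hE, ← B3Op116ScaleChains.rate_eq]
    rw [hE'] at hb
    have hℓ : 0 ≤ c * P.mesh j ^ ((2 : ℝ) - (P.d : ℝ)) := mul_nonneg hc (Real.rpow_nonneg (P.mesh_pos j).le _)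
    refine (mul_le_mul_of_nonneg_left hb hℓ).trans (le_of_eq ?_)
    rw [hKb]; ring
  have step3 : ∑ j ∈ Finset.range k, P.mesh j ^ ((2 : ℝ) - (P.d : ℝ)) * ((P.L : ℝ) ^ j) ^ P.d * ((P.L : ℝ) ^ (k * P.d))⁻¹
      ≤ P.mesh k ^ (2 : ℝ) / ((P.L : ℝ) ^ (2 : ℝ) - 1) * (P.mesh k ^ P.d)⁻¹ := by
    simp_rw [blockavg_scale_algebra]
    rw [← Finset.sum_mul]
    exact mul_le_mul_of_nonneg_right (B3Op116ScaleChains.sum_mesh_rpow_le (by norm_num) hL1 k)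
      (inv_nonneg.mpr (pow_nonneg (P.mesh_pos k).le _))
  calc ((P.L : ℝ) ^ (k * P.d))⁻¹ * ∑ y ∈ HiggsAveraging.blockK k (blockIter k z), f y
      ≤ ((P.L : ℝ) ^ (k * P.d))⁻¹ * ∑ j ∈ Finset.range k, c * Kb * E * (P.mesh j ^ ((2 : ℝ) - (P.d : ℝ)) * ((P.L : ℝ) ^ j) ^ P.d) :=
        mul_le_mul_of_nonneg_left (step1.trans (Finset.sum_le_sum step2)) hLk0.le
    _ = c * Kb * E * ∑ j ∈ Finset.range k, P.mesh j ^ ((2 : ℝ) - (P.d : ℝ)) * ((P.L : ℝ) ^ j) ^ P.d * ((P.L : ℝ) ^ (k * P.d))⁻¹ := by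
        rw [Finset.mul_sum, Finset.mul_sum]
        exact Finset.sum_congr rfl fun j _ => by ring
    _ ≤ c * Kb * E * (P.mesh k ^ (2 : ℝ) / ((P.L : ℝ) ^ (2 : ℝ) - 1) * (P.mesh k ^ P.d)⁻¹) :=
        mul_le_mul_of_nonneg_left step3 (by positivity)
    _ = _ := by rw [hKb]; ring

variable {C : ChargeData N} {msq a : ℝ} {K₀ : ℕ} {hL1 : 1 < P.L} {δ₁ Cst : ℝ} {X : HiggsLattice.VecField P 0}

/-- **The smeared ROW is a top-scale bump too**: `L^{−kd}Σ_{y∈B^k(ū)} κ_X(x,y) ≤ [e^{δ₁/2}N(8d/δ₁)^d/(L²−1)]·ε^dC·(L^kε)²((L^kε)^d)^{−1}·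
e^{−(δ₁/2)(L^kε)^{−1}ε|u−x|}` (the block sum in the SECOND slot of `κ`; what the outer averaging source of (1.16) sees after the block-sum
exchange). [cite: Balaban1982Higgs1, (1.20) p.607] [cite: Balaban1983Higgs3, (2.10) p.426] -/
theorem block_row_le (h210 : (regRegionKernels hL1 C Finset.univ X msq a k K₀).Ineq210 δ₁ Cst) (hmsq : 0 < msq) (ha : 0 < a)
    (hk : 1 ≤ k) (hkK : k ≤ P.K) (hδ₁ : 0 < δ₁) (hδ₁1 : δ₁ ≤ 1) (hCst : 0 ≤ Cst) (i₀ : Ix N)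
    (x u : HiggsLattice.Site P 0) :
    ((P.L : ℝ) ^ (k * P.d))⁻¹ * ∑ y ∈ HiggsAveraging.blockK k (blockIter k u), col C msq a k X x y
      ≤ (Real.exp (δ₁ / 2) * ((nCol N : ℝ) * (4 * P.d / (δ₁ / 2)) ^ P.d) / ((P.L : ℝ) ^ (2 : ℝ) - 1)) *
          (P.mesh 0 ^ P.d * Cst) * (P.mesh k ^ (2 : ℝ) * (P.mesh k ^ P.d)⁻¹) *
          Real.exp (-(δ₁ / 2 * (P.mesh k)⁻¹ * (P.mesh 0 * (HiggsLattice.Site.tdist u x : ℝ)))) := by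
  have hc : 0 ≤ P.mesh 0 ^ P.d * Cst := mul_nonneg (pow_nonneg (P.mesh_pos 0).le _) hCst
  refine block_avg_le_of_majorant (N := N) hL1 hkK hδ₁ hδ₁1 hc i₀ x (fun y => col C msq a k X x y) (fun y => ?_) u
  refine (col_le h210 hmsq ha hk hkK x y).trans (le_of_eq ?_)
  simp_rw [B1Ineq234LevelZero.tdist_comm x y]

/-- **The smeared row read at a bond head, as a majorant of the common currency**: for `R(b) := L^{−kd}Σ_{y∈B^k(b̄₊)}κ_X(x,y)`,
`R(b) ≤ Σ_{j<k+1} e·K_b·ε^dC·(L^jε)^{2−d}e^{−(δ₁/2)(L^jε)^{−1}ε|x−b₋|}` (top bump ⊂ the `k+1`-scale sum, `top_bump_le_majorant_succ`; the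
head costs `e`, `majorant_shift_le`). [cite: Balaban1983Higgs3, (1.16) p.414, (2.10) p.426] -/
theorem block_row_majorant (h210 : (regRegionKernels hL1 C Finset.univ X msq a k K₀).Ineq210 δ₁ Cst) (hmsq : 0 < msq) (ha : 0 < a)
    (hk : 1 ≤ k) (hkK : k ≤ P.K) (hδ₁ : 0 < δ₁) (hδ₁1 : δ₁ ≤ 1) (hCst : 0 ≤ Cst) (i₀ : Ix N)
    (x : HiggsLattice.Site P 0) (b : HiggsLattice.PBond P 0) :
    ((P.L : ℝ) ^ (k * P.d))⁻¹ * ∑ y ∈ HiggsAveraging.blockK k (blockIter k b.tgt), col C msq a k X x y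
      ≤ ∑ j ∈ Finset.range (k + 1),
          (Real.exp 1 * ((Real.exp (δ₁ / 2) * ((nCol N : ℝ) * (4 * P.d / (δ₁ / 2)) ^ P.d) / ((P.L : ℝ) ^ (2 : ℝ) - 1)) *
            (P.mesh 0 ^ P.d * Cst))) * P.mesh j ^ ((2 : ℝ) - (P.d : ℝ)) *
          Real.exp (-(δ₁ / 2 * (P.mesh j)⁻¹ * (P.mesh 0 * (HiggsLattice.Site.tdist x b.src : ℝ)))) := by
  have hL1' : (1 : ℝ) < (P.L : ℝ) := by exact_mod_cast hL1
  have hc : 0 ≤ P.mesh 0 ^ P.d * Cst := mul_nonneg (pow_nonneg (P.mesh_pos 0).le _) hCst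
  have hKb : 0 ≤ (Real.exp (δ₁ / 2) * ((nCol N : ℝ) * (4 * P.d / (δ₁ / 2)) ^ P.d) / ((P.L : ℝ) ^ (2 : ℝ) - 1)) *
      (P.mesh 0 ^ P.d * Cst) := by
    have h1 : 0 < (P.L : ℝ) ^ (2 : ℝ) - 1 := by
      have : (1 : ℝ) < (P.L : ℝ) ^ (2 : ℝ) := Real.one_lt_rpow hL1' (by norm_num)
      linarith
    have h2 : 0 ≤ (4 * (P.d : ℝ) / (δ₁ / 2)) ^ P.d := pow_nonneg (by positivity) _
    positivity
  -- the top bump at |b₊ − x| = |x − b₊|, inside the (k+1)-scale sum, then the shift b₊ → b₋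
  have h1 := block_row_le h210 hmsq ha hk hkK hδ₁ hδ₁1 hCst i₀ x b.tgt
  rw [B1Ineq234LevelZero.tdist_comm b.tgt x, mesh_sq_mul_inv_pow_eq] at h1
  have h2 := h1.trans (le_of_eq (by ring : _ = ((Real.exp (δ₁ / 2) * ((nCol N : ℝ) * (4 * P.d / (δ₁ / 2)) ^ P.d) /
      ((P.L : ℝ) ^ (2 : ℝ) - 1)) * (P.mesh 0 ^ P.d * Cst)) * P.mesh k ^ ((2 : ℝ) - (P.d : ℝ)) *
      Real.exp (-(δ₁ / 2 * (P.mesh k)⁻¹ * (P.mesh 0 * (HiggsLattice.Site.tdist x b.tgt : ℝ))))))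
  refine (h2.trans (top_bump_le_majorant_succ hKb x b.tgt)).trans ?_
  exact majorant_shift_le (half_pos hδ₁) (by linarith) hKb x b.src b.dir

end BlockAvg

section AvgChains

variable {C : ChargeData N} {A B : HiggsLattice.VecField P 0} {msq a : ℝ} {k K₀ : ℕ} {hL1 : 1 < P.L} {δ₁ Cst : ℝ}

/-- the block-averaged column of `G_k(T,B)` at `x′`: `Blk(z) = L^{−kd}Σ_{u∈B^k(z̄)}κ_B(u,x′)` — what the inner averaging source sees of
`w₀ = G_k(T,B)e_{(x′,i′)}`. [cite: Balaban1982Higgs1, (3.15) p.614] [cite: Balaban1983Higgs3, (1.16) p.414] -/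
def blk (C : ChargeData N) (B : HiggsLattice.VecField P 0) (msq a : ℝ) (k : ℕ) (x' z : HiggsLattice.Site P 0) : ℝ :=
  ((P.L : ℝ) ^ (k * P.d))⁻¹ * ∑ u ∈ HiggsAveraging.blockK k (blockIter k z), col C msq a k B u x'

/-- `Blk ≥ 0`. [cite: Balaban1983Higgs3, (2.10) p.426] -/
theorem blk_nonneg (x' z : HiggsLattice.Site P 0) : 0 ≤ blk C B msq a k x' z :=
  mul_nonneg (inv_nonneg.mpr (pow_nonneg (Nat.cast_nonneg _) _)) (Finset.sum_nonneg fun _ _ => col_nonneg _ _ _)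

variable (hδ₁ : 0 < δ₁) (hδ₁1 : δ₁ ≤ 1) (hCst : 0 ≤ Cst)
  (h210B : (regRegionKernels hL1 C Finset.univ B msq a k K₀).Ineq210 δ₁ Cst)
  (h210AB : (regRegionKernels hL1 C Finset.univ (A + B) msq a k K₀).Ineq210 δ₁ Cst)
  (hmsq : 0 < msq) (ha : 0 < a) (hk : 1 ≤ k) (hkK : k ≤ P.K) (i₀ : Ix N) (x x' : HiggsLattice.Site P 0)
  {p cR : ℝ} (hp : 0 < p) (hcR : 0 ≤ cR) (R : HiggsLattice.PBond P 0 → ℝ) (hR0 : ∀ b, 0 ≤ R b)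
  (hR : ∀ b, R b ≤ ∑ j ∈ Finset.range (k + 1), cR * P.mesh j ^ (p - (P.d : ℝ)) *
      Real.exp (-(δ₁ / 2 * (P.mesh j)⁻¹ * (P.mesh 0 * (HiggsLattice.Site.tdist x b.src : ℝ)))))
include hδ₁ hδ₁1 hCst h210B h210AB hmsq ha hk hkK i₀ hp hcR hR0 hR

/-- **The VALUE averaging chain** — outer row ∘ `κ_{A+B}(b₊,b′₋)` ∘ `Blk(b′₋)`, exponents `(p,2,2)` in the common currency
(`block_avg_col_le_majorant` for the third factor), `p + 4 > d`. [cite: Balaban1983Higgs3, (1.16) p.414, (2.10) p.426] [cite: Balaban1982Higgs1, (3.15) p.614] -/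
theorem chainAVw_le (hsum : (P.d : ℝ) < p + 2 + 2) :
    ∑ b : HiggsLattice.PBond P 0, ∑ b' : HiggsLattice.PBond P 0,
        R b * col C msq a k (A + B) b.tgt b'.src * blk C B msq a k x' b'.src
      ≤ chainConst P N (δ₁ / 2) p 2 2 *
          (cR * (Real.exp 1 * (P.mesh 0 ^ P.d * Cst)) *
            ((Real.exp (δ₁ / 2) * ((nCol N : ℝ) * (4 * P.d / (δ₁ / 2)) ^ P.d) / ((P.L : ℝ) ^ (2 : ℝ) - 1)) *
              (P.mesh 0 ^ P.d * Cst))) *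
          P.mesh (k + 1) ^ (p + 2 + 2 - (P.d : ℝ)) *
          Real.exp (-(δ₁ / 2 / 4 * (P.mesh (k + 1))⁻¹ * (P.mesh 0 * (HiggsLattice.Site.tdist x x' : ℝ)))) := by
  have hL1' : (1 : ℝ) < (P.L : ℝ) := by exact_mod_cast hL1
  have hc : 0 ≤ P.mesh 0 ^ P.d * Cst := mul_nonneg (pow_nonneg (P.mesh_pos 0).le _) hCst
  have hc1 : 0 ≤ Real.exp 1 * (P.mesh 0 ^ P.d * Cst) := mul_nonneg (Real.exp_nonneg _) hc
  have hKb : 0 ≤ (Real.exp (δ₁ / 2) * ((nCol N : ℝ) * (4 * P.d / (δ₁ / 2)) ^ P.d) / ((P.L : ℝ) ^ (2 : ℝ) - 1)) *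
      (P.mesh 0 ^ P.d * Cst) := by
    have h1 : 0 < (P.L : ℝ) ^ (2 : ℝ) - 1 := by
      have : (1 : ℝ) < (P.L : ℝ) ^ (2 : ℝ) := Real.one_lt_rpow hL1' (by norm_num)
      linarith
    have h2 : 0 ≤ (4 * (P.d : ℝ) / (δ₁ / 2)) ^ P.d := pow_nonneg (by positivity) _
    positivity
  refine bond_chain3_le' (k := k + 1) hL1 (half_pos hδ₁) (by linarith) hp (by norm_num) (by norm_num) hsum hcR hc1 hKb
    i₀ x x' _ _ _ hR0 (fun b b' => col_nonneg _ _ _) (fun b' => blk_nonneg _ _) hR (fun b b' => ?_) (fun b' => ?_)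
  · exact ((col_le h210AB hmsq ha hk hkK b.tgt b'.src).trans (majorant_shift_le' hδ₁ hδ₁1 hc b.src b'.src b.dir)).trans
      (weaken hc1 hδ₁.le _ _)
  · exact block_avg_col_le_majorant h210B hmsq ha hk hkK hδ₁ hδ₁1 hCst i₀ b'.src x'

variable {s : ℝ} (hA : ∀ b : HiggsLattice.PBond P 0, |A b| ≤ s)
include hA

/-- **The DERIVATIVE averaging chain** — outer row ∘ `κ^D_{B,A+B}(b,b′₋)` ∘ `Blk(b′₋)` with the split `D_B = D_{A+B} − M`:
`≤ [(p,1,2)] + |e|s·[(p,2,2)]`, `p + 3 > d`. [cite: Balaban1983Higgs3, (1.16) p.414, (2.10) p.426] [cite: Balaban1982Higgs1, (3.14)–(3.15) p.614] -/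
theorem chainADw_le (hsum : (P.d : ℝ) < p + 1 + 2) :
    ∑ b : HiggsLattice.PBond P 0, ∑ b' : HiggsLattice.PBond P 0,
        R b * dcol C msq a k B (A + B) b b'.src * blk C B msq a k x' b'.src
      ≤ chainConst P N (δ₁ / 2) p 1 2 *
            (cR * (P.mesh 0 ^ P.d * Cst) *
              ((Real.exp (δ₁ / 2) * ((nCol N : ℝ) * (4 * P.d / (δ₁ / 2)) ^ P.d) / ((P.L : ℝ) ^ (2 : ℝ) - 1)) *
                (P.mesh 0 ^ P.d * Cst))) *
            P.mesh (k + 1) ^ (p + 1 + 2 - (P.d : ℝ)) *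
            Real.exp (-(δ₁ / 2 / 4 * (P.mesh (k + 1))⁻¹ * (P.mesh 0 * (HiggsLattice.Site.tdist x x' : ℝ))))
        + |C.e| * s * (chainConst P N (δ₁ / 2) p 2 2 *
            (cR * (Real.exp 1 * (P.mesh 0 ^ P.d * Cst)) *
              ((Real.exp (δ₁ / 2) * ((nCol N : ℝ) * (4 * P.d / (δ₁ / 2)) ^ P.d) / ((P.L : ℝ) ^ (2 : ℝ) - 1)) *
                (P.mesh 0 ^ P.d * Cst))) *
            P.mesh (k + 1) ^ (p + 2 + 2 - (P.d : ℝ)) *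
            Real.exp (-(δ₁ / 2 / 4 * (P.mesh (k + 1))⁻¹ * (P.mesh 0 * (HiggsLattice.Site.tdist x x' : ℝ))))) := by
  have hL1' : (1 : ℝ) < (P.L : ℝ) := by exact_mod_cast hL1
  have hc : 0 ≤ P.mesh 0 ^ P.d * Cst := mul_nonneg (pow_nonneg (P.mesh_pos 0).le _) hCst
  have hc1 : 0 ≤ Real.exp 1 * (P.mesh 0 ^ P.d * Cst) := mul_nonneg (Real.exp_nonneg _) hc
  have hKb : 0 ≤ (Real.exp (δ₁ / 2) * ((nCol N : ℝ) * (4 * P.d / (δ₁ / 2)) ^ P.d) / ((P.L : ℝ) ^ (2 : ℝ) - 1)) *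
      (P.mesh 0 ^ P.d * Cst) := by
    have h1 : 0 < (P.L : ℝ) ^ (2 : ℝ) - 1 := by
      have : (1 : ℝ) < (P.L : ℝ) ^ (2 : ℝ) := Real.one_lt_rpow hL1' (by norm_num)
      linarith
    have h2 : 0 ≤ (4 * (P.d : ℝ) / (δ₁ / 2)) ^ P.d := pow_nonneg (by positivity) _
    positivity
  have hes : 0 ≤ |C.e| * s := mul_nonneg (abs_nonneg _) ((abs_nonneg _).trans (hA ⟨x, ⟨0, P.hd⟩⟩))
  refine (sum2_split_le R (fun b' => blk C B msq a k x' b'.src) _ (fun b b' => dcol C msq a k (A + B) (A + B) b b'.src)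
    (fun b b' => col C msq a k (A + B) b.tgt b'.src) (|C.e| * s) hR0 (fun b' => blk_nonneg _ _)
    (fun b b' => dcol_le_add_split A B (hA b) b'.src)).trans ?_
  refine add_le_add ?_ (mul_le_mul_of_nonneg_left (chainAVw_le hδ₁ hδ₁1 hCst h210B h210AB hmsq ha hk hkK i₀ x x' hp hcR R
    hR0 hR (by linarith)) hes)
  refine bond_chain3_le' (k := k + 1) hL1 (half_pos hδ₁) (by linarith) hp (by norm_num) (by norm_num) hsum hcR hc hKb
    i₀ x x' _ _ _ hR0 (fun b b' => dcol_nonneg _ _ _ _) (fun b' => blk_nonneg _ _) hR (fun b b' => ?_) (fun b' => ?_)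
  · exact dcol_le_weak h210AB hmsq ha hk hkK hδ₁.le hCst b b'.src
  · exact block_avg_col_le_majorant h210B hmsq ha hk hkK hδ₁ hδ₁1 hCst i₀ b'.src x'

end AvgChains

/-! ## §4 The inner averaging terms WITH DECAY: block averages of the columns as top bumps inside the chains -/

section AvgInner

variable {C : ChargeData N} {A B : HiggsLattice.VecField P 0} {msq a : ℝ} {k K₀ : ℕ} {hL1 : 1 < P.L} {δ₁ Cst : ℝ}

/-- the averaging amplitude of `norm_mapE_avgSrc_le_block` is `mK`. [cite: Balaban1982Higgs1, (3.15) p.614] -/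
theorem mK_eq (C : ChargeData N) (s : ℝ) (k : ℕ) :
    |C.e| * s * P.mesh 0 * (P.d * ((P.L : ℝ) ^ k - 1)) = mK P C s k := rfl

/-- `mK ≥ 0`. [cite: Balaban1982Higgs1, (3.15) p.614] -/
theorem mK_nonneg (C : ChargeData N) {s : ℝ} (hs : 0 ≤ s) (k : ℕ) : 0 ≤ mK P C s k := by
  have hL1k : (1 : ℝ) ≤ (P.L : ℝ) ^ k := one_le_pow₀ (by exact_mod_cast P.hL)
  have : (0 : ℝ) ≤ (P.L : ℝ) ^ k - 1 := by linarith
  have := P.mesh_pos 0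
  unfold mK; positivity

/-- **The inner averaging source through the VALUE row, pointwise, with decay kept**: for `w₀ = G_k(T,B)e_{(x′,i′)}`,
`‖(G_k(T,A+B)avgSrc w₀)(y)‖ ≤ m(2+m)·Σ_{b′} κ_{A+B}(y,b′₋)·Blk(b′₋)` (`norm_mapE_avgSrc_le_block`, `block_avg_mono`, sites → bonds).
[cite: Balaban1982Higgs1, (3.15)–(3.16) pp.614–615] [cite: Balaban1983Higgs3, (1.16) p.414] -/
theorem norm_G_avgSrc_le_blk (hkK : k ≤ P.K) {s : ℝ} (hs : 0 ≤ s) (hA : ∀ b : HiggsLattice.PBond P 0, |A b| ≤ s)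
    (x' y : HiggsLattice.Site P 0) (i' : Ix N) :
    ‖propagatorK C Finset.univ (A + B) msq a k
        (B3Op116SourceForm.avgSrc C A B k (propagatorK C Finset.univ B msq a k (cb P N 0 (x', i')))) y‖
      ≤ mK P C s k * (2 + mK P C s k) *
          ∑ b' : HiggsLattice.PBond P 0, col C msq a k (A + B) y b'.src * blk C B msq a k x' b'.src := by
  set w₀ := propagatorK C Finset.univ B msq a k (cb P N 0 (x', i')) with hw₀
  set G' : ScalarField P 0 N →ₗ[ℝ] ScalarField P 0 N := propagatorK C Finset.univ (A + B) msq a k with hG'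
  have hmm : 0 ≤ mK P C s k * (2 + mK P C s k) := by have := mK_nonneg (P := P) C hs k; positivity
  set T : ScalarField P 0 N →ₗ[ℝ] E N := (LinearMap.proj y : ScalarField P 0 N →ₗ[ℝ] E N) ∘ₗ G' with hT
  have hT' : ∀ φ : ScalarField P 0 N, T φ = (G' φ) y := fun φ => rfl
  have h := norm_mapE_avgSrc_le_block (C := C) (A := A) (B := B) (k := k) T hkK hs hA w₀
  rw [hT', mK_eq] at h
  refine h.trans ?_
  have hcol : ∀ z, ∑ i : Ix N, ‖T (cb P N 0 (z, i))‖ = col C msq a k (A + B) y z := fun z => by simp only [hT', hG']; rfl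
  simp only [hcol]
  -- block averages of ‖w₀‖ ≤ Blk, then sites → bonds
  have hblk : ∀ z, ((P.L : ℝ) ^ (k * P.d))⁻¹ * ∑ u ∈ HiggsAveraging.blockK k (blockIter k z), ‖w₀ u‖ ≤ blk C B msq a k x' z :=
    fun z => block_avg_mono w₀ (fun u => col C msq a k B u x') (fun u => norm_G_cb_le_col C msq a k B x' u i') _
  calc ∑ z : HiggsLattice.Site P 0, mK P C s k * (2 + mK P C s k) *
          (((P.L : ℝ) ^ (k * P.d))⁻¹ * ∑ u ∈ HiggsAveraging.blockK k (blockIter k z), ‖w₀ u‖) * col C msq a k (A + B) y z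
      ≤ ∑ z : HiggsLattice.Site P 0, mK P C s k * (2 + mK P C s k) * (col C msq a k (A + B) y z * blk C B msq a k x' z) := by
        refine Finset.sum_le_sum fun z _ => ?_
        have h1 := mul_le_mul_of_nonneg_left (hblk z) (mul_nonneg hmm (col_nonneg (C := C) (msq := msq) (a := a) (k := k) (A + B) y z))
        refine le_trans (le_of_eq (by ring)) (h1.trans (le_of_eq (by ring)))
    _ = mK P C s k * (2 + mK P C s k) * ∑ z : HiggsLattice.Site P 0, col C msq a k (A + B) y z * blk C B msq a k x' z := by
        rw [Finset.mul_sum]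
    _ ≤ _ := mul_le_mul_of_nonneg_left (sum_site_le_sum_bond_src (fun z => col C msq a k (A + B) y z * blk C B msq a k x' z)
          (fun z => mul_nonneg (col_nonneg _ _ _) (blk_nonneg _ _))) hmm

/-- **The inner averaging source through the DERIVATIVE row, pointwise, with decay kept**:
`‖(D^ε_BG_k(T,A+B)avgSrc w₀)(b)‖ ≤ m(2+m)·Σ_{b′} κ^D_{B,A+B}(b,b′₋)·Blk(b′₋)`. [cite: Balaban1982Higgs1, (3.15)–(3.16) pp.614–615] [cite: Balaban1983Higgs3, (1.16) p.414] -/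
theorem norm_covDeriv_G_avgSrc_le_blk (hkK : k ≤ P.K) {s : ℝ} (hs : 0 ≤ s) (hA : ∀ b : HiggsLattice.PBond P 0, |A b| ≤ s)
    (x' : HiggsLattice.Site P 0) (b : HiggsLattice.PBond P 0) (i' : Ix N) :
    ‖covDeriv C B (propagatorK C Finset.univ (A + B) msq a k
        (B3Op116SourceForm.avgSrc C A B k (propagatorK C Finset.univ B msq a k (cb P N 0 (x', i'))))) b‖
      ≤ mK P C s k * (2 + mK P C s k) *
          ∑ b' : HiggsLattice.PBond P 0, dcol C msq a k B (A + B) b b'.src * blk C B msq a k x' b'.src := by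
  set w₀ := propagatorK C Finset.univ B msq a k (cb P N 0 (x', i')) with hw₀
  set G' : ScalarField P 0 N →ₗ[ℝ] ScalarField P 0 N := propagatorK C Finset.univ (A + B) msq a k with hG'
  have hmm : 0 ≤ mK P C s k * (2 + mK P C s k) := by have := mK_nonneg (P := P) C hs k; positivity
  set T : ScalarField P 0 N →ₗ[ℝ] E N := B3Op116SourceForm.covDerivAt C B b ∘ₗ G' with hT
  have hT' : ∀ φ : ScalarField P 0 N, T φ = covDeriv C B (G' φ) b := fun φ => by
    simp [hT, B3Op116SourceForm.covDerivAt_apply]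
  have h := norm_mapE_avgSrc_le_block (C := C) (A := A) (B := B) (k := k) T hkK hs hA w₀
  rw [hT', mK_eq] at h
  refine h.trans ?_
  have hcol : ∀ z, ∑ i : Ix N, ‖T (cb P N 0 (z, i))‖ = dcol C msq a k B (A + B) b z := fun z => by
    simp only [hT', hG']; rfl
  simp only [hcol]
  have hblk : ∀ z, ((P.L : ℝ) ^ (k * P.d))⁻¹ * ∑ u ∈ HiggsAveraging.blockK k (blockIter k z), ‖w₀ u‖ ≤ blk C B msq a k x' z :=
    fun z => block_avg_mono w₀ (fun u => col C msq a k B u x') (fun u => norm_G_cb_le_col C msq a k B x' u i') _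
  calc ∑ z : HiggsLattice.Site P 0, mK P C s k * (2 + mK P C s k) *
          (((P.L : ℝ) ^ (k * P.d))⁻¹ * ∑ u ∈ HiggsAveraging.blockK k (blockIter k z), ‖w₀ u‖) * dcol C msq a k B (A + B) b z
      ≤ ∑ z : HiggsLattice.Site P 0, mK P C s k * (2 + mK P C s k) * (dcol C msq a k B (A + B) b z * blk C B msq a k x' z) := by
        refine Finset.sum_le_sum fun z _ => ?_
        have h1 := mul_le_mul_of_nonneg_left (hblk z)
          (mul_nonneg hmm (dcol_nonneg (C := C) (msq := msq) (a := a) (k := k) B (A + B) b z))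
        refine le_trans (le_of_eq (by ring)) (h1.trans (le_of_eq (by ring)))
    _ = mK P C s k * (2 + mK P C s k) * ∑ z : HiggsLattice.Site P 0, dcol C msq a k B (A + B) b z * blk C B msq a k x' z := by
        rw [Finset.mul_sum]
    _ ≤ _ := mul_le_mul_of_nonneg_left (sum_site_le_sum_bond_src (fun z => dcol C msq a k B (A + B) b z * blk C B msq a k x' z)
          (fun z => mul_nonneg (dcol_nonneg _ _ _ _) (blk_nonneg _ _))) hmm

variable (hδ₁ : 0 < δ₁) (hδ₁1 : δ₁ ≤ 1) (hCst : 0 ≤ Cst)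
  (h210B : (regRegionKernels hL1 C Finset.univ B msq a k K₀).Ineq210 δ₁ Cst)
  (h210AB : (regRegionKernels hL1 C Finset.univ (A + B) msq a k K₀).Ineq210 δ₁ Cst)
  (hmsq : 0 < msq) (ha : 0 < a) (hk : 1 ≤ k) (hkK : k ≤ P.K) (i₀ : Ix N) (x x' : HiggsLattice.Site P 0)
  {p cR : ℝ} (hp : 0 < p) (hcR : 0 ≤ cR) (R : HiggsLattice.PBond P 0 → ℝ) (hR0 : ∀ b, 0 ≤ R b)
  (hR : ∀ b, R b ≤ ∑ j ∈ Finset.range (k + 1), cR * P.mesh j ^ (p - (P.d : ℝ)) *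
      Real.exp (-(δ₁ / 2 * (P.mesh j)⁻¹ * (P.mesh 0 * (HiggsLattice.Site.tdist x b.src : ℝ)))))
  {s : ℝ} (hs : 0 ≤ s) (hA : ∀ b : HiggsLattice.PBond P 0, |A b| ≤ s) (i' : Ix N)
include hδ₁ hδ₁1 hCst h210B h210AB hmsq ha hk hkK i₀ hp hcR hR0 hR hs hA

/-- **An outer row against the inner VALUE averaging source, WITH DECAY**:
`Σ_b R(b)‖(G_k(T,A+B)avgSrc w₀)(b₊)‖ ≤ m(2+m)·chainConst·K·(L^{k+1}ε)^{p+4−d}e^{−(δ₁/8)(L^{k+1}ε)^{−1}ε|x−x′|}` (`chainAVw_le`).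
[cite: Balaban1983Higgs3, (1.16) p.414, (2.10) p.426] [cite: Balaban1982Higgs1, (3.15)–(3.16) pp.614–615] -/
theorem avg_value_row_le (hsum : (P.d : ℝ) < p + 2 + 2) :
    ∑ b : HiggsLattice.PBond P 0, R b *
        ‖propagatorK C Finset.univ (A + B) msq a k
          (B3Op116SourceForm.avgSrc C A B k (propagatorK C Finset.univ B msq a k (cb P N 0 (x', i')))) b.tgt‖
      ≤ mK P C s k * (2 + mK P C s k) * (chainConst P N (δ₁ / 2) p 2 2 *
          (cR * (Real.exp 1 * (P.mesh 0 ^ P.d * Cst)) *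
            ((Real.exp (δ₁ / 2) * ((nCol N : ℝ) * (4 * P.d / (δ₁ / 2)) ^ P.d) / ((P.L : ℝ) ^ (2 : ℝ) - 1)) *
              (P.mesh 0 ^ P.d * Cst))) *
          P.mesh (k + 1) ^ (p + 2 + 2 - (P.d : ℝ)) *
          Real.exp (-(δ₁ / 2 / 4 * (P.mesh (k + 1))⁻¹ * (P.mesh 0 * (HiggsLattice.Site.tdist x x' : ℝ))))) := by
  have hmm : 0 ≤ mK P C s k * (2 + mK P C s k) := by have := mK_nonneg (P := P) C hs k; positivity
  have hpt := fun b : HiggsLattice.PBond P 0 => mul_le_mul_of_nonneg_left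
    (norm_G_avgSrc_le_blk (C := C) (A := A) (B := B) (msq := msq) (a := a) hkK hs hA x' b.tgt i') (hR0 b)
  refine (Finset.sum_le_sum fun b _ => hpt b).trans ?_
  have e : ∑ b : HiggsLattice.PBond P 0, R b * (mK P C s k * (2 + mK P C s k) *
      ∑ b' : HiggsLattice.PBond P 0, col C msq a k (A + B) b.tgt b'.src * blk C B msq a k x' b'.src)
      = mK P C s k * (2 + mK P C s k) * ∑ b : HiggsLattice.PBond P 0, ∑ b' : HiggsLattice.PBond P 0,
          R b * col C msq a k (A + B) b.tgt b'.src * blk C B msq a k x' b'.src := by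
    rw [Finset.mul_sum]
    refine Finset.sum_congr rfl fun b _ => ?_
    rw [Finset.mul_sum, Finset.mul_sum, Finset.mul_sum]
    exact Finset.sum_congr rfl fun b' _ => by ring
  rw [e]
  exact mul_le_mul_of_nonneg_left (chainAVw_le hδ₁ hδ₁1 hCst h210B h210AB hmsq ha hk hkK i₀ x x' hp hcR R hR0 hR hsum) hmm

/-- **An outer row against the inner DERIVATIVE averaging source, WITH DECAY**:
`Σ_b R(b)‖(D^ε_BG_k(T,A+B)avgSrc w₀)(b)‖ ≤ m(2+m)·([(p,1,2)] + |e|s·[(p,2,2)])` (`chainADw_le`).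
[cite: Balaban1983Higgs3, (1.16) p.414, (2.10) p.426] [cite: Balaban1982Higgs1, (3.14)–(3.16) pp.614–615] -/
theorem avg_deriv_row_le (hsum : (P.d : ℝ) < p + 1 + 2) :
    ∑ b : HiggsLattice.PBond P 0, R b *
        ‖covDeriv C B (propagatorK C Finset.univ (A + B) msq a k
          (B3Op116SourceForm.avgSrc C A B k (propagatorK C Finset.univ B msq a k (cb P N 0 (x', i'))))) b‖
      ≤ mK P C s k * (2 + mK P C s k) * (chainConst P N (δ₁ / 2) p 1 2 *
            (cR * (P.mesh 0 ^ P.d * Cst) *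
              ((Real.exp (δ₁ / 2) * ((nCol N : ℝ) * (4 * P.d / (δ₁ / 2)) ^ P.d) / ((P.L : ℝ) ^ (2 : ℝ) - 1)) *
                (P.mesh 0 ^ P.d * Cst))) *
            P.mesh (k + 1) ^ (p + 1 + 2 - (P.d : ℝ)) *
            Real.exp (-(δ₁ / 2 / 4 * (P.mesh (k + 1))⁻¹ * (P.mesh 0 * (HiggsLattice.Site.tdist x x' : ℝ))))
        + |C.e| * s * (chainConst P N (δ₁ / 2) p 2 2 *
            (cR * (Real.exp 1 * (P.mesh 0 ^ P.d * Cst)) *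
              ((Real.exp (δ₁ / 2) * ((nCol N : ℝ) * (4 * P.d / (δ₁ / 2)) ^ P.d) / ((P.L : ℝ) ^ (2 : ℝ) - 1)) *
                (P.mesh 0 ^ P.d * Cst))) *
            P.mesh (k + 1) ^ (p + 2 + 2 - (P.d : ℝ)) *
            Real.exp (-(δ₁ / 2 / 4 * (P.mesh (k + 1))⁻¹ * (P.mesh 0 * (HiggsLattice.Site.tdist x x' : ℝ)))))) := by
  have hmm : 0 ≤ mK P C s k * (2 + mK P C s k) := by have := mK_nonneg (P := P) C hs k; positivity
  have hpt := fun b : HiggsLattice.PBond P 0 => mul_le_mul_of_nonneg_left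
    (norm_covDeriv_G_avgSrc_le_blk (C := C) (A := A) (B := B) (msq := msq) (a := a) hkK hs hA x' b i') (hR0 b)
  refine (Finset.sum_le_sum fun b _ => hpt b).trans ?_
  have e : ∑ b : HiggsLattice.PBond P 0, R b * (mK P C s k * (2 + mK P C s k) *
      ∑ b' : HiggsLattice.PBond P 0, dcol C msq a k B (A + B) b b'.src * blk C B msq a k x' b'.src)
      = mK P C s k * (2 + mK P C s k) * ∑ b : HiggsLattice.PBond P 0, ∑ b' : HiggsLattice.PBond P 0,
          R b * dcol C msq a k B (A + B) b b'.src * blk C B msq a k x' b'.src := by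
    rw [Finset.mul_sum]
    refine Finset.sum_congr rfl fun b _ => ?_
    rw [Finset.mul_sum, Finset.mul_sum, Finset.mul_sum]
    exact Finset.sum_congr rfl fun b' _ => by ring
  rw [e]
  exact mul_le_mul_of_nonneg_left
    (chainADw_le hδ₁ hδ₁1 hCst h210B h210AB hmsq ha hk hkK i₀ x x' hp hcR R hR0 hR hA hsum) hmm

end AvgInner

/-! ## §5 The ninth term WITH DECAY: near/far split of the two outer columns around `x` and `x′` -/

section NinthDecay

variable {C : ChargeData N} {A B : HiggsLattice.VecField P 0} {msq a : ℝ} {k K₀ : ℕ} {hL1 : 1 < P.L} {δ₁ Cst : ℝ}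

/-- the explicit adjoint covariant derivative is additive in the bond field. [cite: Balaban1982Higgs1, (1.7)–(1.8) p.605] -/
theorem adjD_add (C : ChargeData N) (Y : HiggsLattice.VecField P 0) (φ ψ : HiggsLattice.PBond P 0 → E N) :
    adjD C Y (φ + ψ) = adjD C Y φ + adjD C Y ψ := by
  funext x
  simp only [adjD, Pi.add_apply, map_add, ← smul_add, ← Finset.sum_add_distrib]
  congr 1
  refine Finset.sum_congr rfl fun ν _ => ?_
  abel

/-- **The weighted `ℓ²`-COLUMNS of `G_k(T,X)` read at bond heads** (`d ≤ 3`, `0 ≤ θ ≤ δ₁/4`): with the top-scale weight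
`e^{2θ|b₋−x′|/L^k}`, `Σ_b ε^d e^{2θ|b₋−x′|/L^k}κ_X(b₊,x′)² ≤ d·(e·ε^dC)²·N(16d/δ₁)^d(L^{(4−d)/2}−1)^{−2}(L^kε)^{4−d}` — r14's
`sq_col_weighted_le` at the rate `δ₁/2` (the head costs `e`, `majorant_shift_le'`), one copy per direction. [cite: Balaban1983Higgs3, (1.16) p.414, (2.10) p.426] -/
theorem weighted_sq_col_tgt_le {X : HiggsLattice.VecField P 0}
    (h210 : (regRegionKernels hL1 C Finset.univ X msq a k K₀).Ineq210 δ₁ Cst) (hmsq : 0 < msq) (ha : 0 < a)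
    (hk : 1 ≤ k) (hkK : k ≤ P.K) (hδ₁ : 0 < δ₁) (hδ₁1 : δ₁ ≤ 1) (hCst : 0 ≤ Cst) (hd3 : P.d ≤ 3) (i₀ : Ix N)
    {θ : ℝ} (hθ0 : 0 ≤ θ) (hθ : θ ≤ δ₁ / 4) (x' : HiggsLattice.Site P 0) :
    ∑ b : HiggsLattice.PBond P 0, P.mesh 0 ^ P.d *
        (Real.exp (2 * (θ / (P.L : ℝ) ^ k * (HiggsLattice.Site.tdist b.src x' : ℝ))) * col C msq a k X b.tgt x' ^ 2)
      ≤ (P.d : ℝ) * ((Real.exp 1 * (P.mesh 0 ^ P.d * Cst)) ^ 2 * ((nCol N : ℝ) * (4 * P.d / (δ₁ / 2 / 2)) ^ P.d) /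
          ((P.L : ℝ) ^ (((4 : ℝ) - (P.d : ℝ)) / 2) - 1) ^ 2 * P.mesh k ^ ((4 : ℝ) - (P.d : ℝ))) := by
  have hc : 0 ≤ P.mesh 0 ^ P.d * Cst := mul_nonneg (pow_nonneg (P.mesh_pos 0).le _) hCst
  have hc1 : 0 ≤ Real.exp 1 * (P.mesh 0 ^ P.d * Cst) := mul_nonneg (Real.exp_nonneg _) hc
  have hε : 0 ≤ P.mesh 0 ^ P.d := pow_nonneg (P.mesh_pos 0).le _
  set K : ℕ → HiggsLattice.Site P 0 → ℝ := fun j y =>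
    (Real.exp 1 * (P.mesh 0 ^ P.d * Cst)) * P.mesh j ^ ((2 : ℝ) - (P.d : ℝ)) *
      Real.exp (-(δ₁ / 2 * (P.mesh j)⁻¹ * (P.mesh 0 * (HiggsLattice.Site.tdist y x' : ℝ)))) with hKdef
  have hK0 : ∀ j y, 0 ≤ K j y := fun j y =>
    mul_nonneg (mul_nonneg hc1 (Real.rpow_nonneg (P.mesh_pos j).le _)) (Real.exp_nonneg _)
  have hKle : ∀ j, j < k → ∀ y, |K j y| ≤ (Real.exp 1 * (P.mesh 0 ^ P.d * Cst)) * P.mesh j ^ ((2 : ℝ) - (P.d : ℝ)) *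
      Real.exp (-(δ₁ / 2 * (P.mesh j)⁻¹ * (P.mesh 0 * (HiggsLattice.Site.tdist y x' : ℝ)))) :=
    fun j _ y => by rw [abs_of_nonneg (hK0 j y)]
  have hsq := B3Op116ScaleChains.sq_col_weighted_le (N := N) (k := k) hL1 hd3 hc1 (half_pos hδ₁) (by linarith) hθ0
    (by linarith) x' i₀ K hKle
  -- the shifted column below Σ_j |K j y|
  have hcol : ∀ (y : HiggsLattice.Site P 0) (μ : Fin P.d), col C msq a k X (y.shift μ) x' ≤ ∑ j ∈ Finset.range k, |K j y| := by
    intro y μ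
    refine ((col_le h210 hmsq ha hk hkK (y.shift μ) x').trans (majorant_shift_le' hδ₁ hδ₁1 hc y x' μ)).trans ?_
    refine (majorant_mono (δ := δ₁) (δ' := δ₁ / 2) hc1 (by linarith) le_rfl y x').trans (le_of_eq ?_)
    exact Finset.sum_congr rfl fun j _ => by rw [abs_of_nonneg (hK0 j y)]
  -- bonds = sites × directions
  have hb : ∑ b : HiggsLattice.PBond P 0, P.mesh 0 ^ P.d *
      (Real.exp (2 * (θ / (P.L : ℝ) ^ k * (HiggsLattice.Site.tdist b.src x' : ℝ))) * col C msq a k X b.tgt x' ^ 2)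
      = ∑ y : HiggsLattice.Site P 0, ∑ μ : Fin P.d, P.mesh 0 ^ P.d *
          (Real.exp (2 * (θ / (P.L : ℝ) ^ k * (HiggsLattice.Site.tdist y x' : ℝ))) * col C msq a k X (y.shift μ) x' ^ 2) := by
    rw [sum_site_dir (fun y μ => P.mesh 0 ^ P.d *
      (Real.exp (2 * (θ / (P.L : ℝ) ^ k * (HiggsLattice.Site.tdist y x' : ℝ))) * col C msq a k X (y.shift μ) x' ^ 2))]
    rfl
  rw [hb, Finset.sum_comm]
  have hμ : ∀ μ : Fin P.d, ∑ y : HiggsLattice.Site P 0, P.mesh 0 ^ P.d *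
      (Real.exp (2 * (θ / (P.L : ℝ) ^ k * (HiggsLattice.Site.tdist y x' : ℝ))) * col C msq a k X (y.shift μ) x' ^ 2)
      ≤ (Real.exp 1 * (P.mesh 0 ^ P.d * Cst)) ^ 2 * ((nCol N : ℝ) * (4 * P.d / (δ₁ / 2 / 2)) ^ P.d) /
          ((P.L : ℝ) ^ (((4 : ℝ) - (P.d : ℝ)) / 2) - 1) ^ 2 * P.mesh k ^ ((4 : ℝ) - (P.d : ℝ)) := by
    intro μ
    refine le_trans (Finset.sum_le_sum fun y _ => mul_le_mul_of_nonneg_left (mul_le_mul_of_nonneg_left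
      (pow_le_pow_left₀ (col_nonneg (C := C) (msq := msq) (a := a) (k := k) X (y.shift μ) x') (hcol y μ) 2)
      (Real.exp_nonneg _)) hε) hsq
  refine (Finset.sum_le_sum fun μ _ => hμ μ).trans (le_of_eq ?_)
  rw [Finset.sum_const, Finset.card_univ, Fintype.card_fin, nsmul_eq_mul]

/-- **The weighted `ℓ²`-ROWS of `G_k(T,X)` read at bond heads**: `Σ_b ε^d e^{2θ|x−b₋|/L^k}κ_X(x,b₊)² ≤` the same bound.
[cite: Balaban1983Higgs3, (1.16) p.414, (2.10) p.426] -/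
theorem weighted_sq_col_row_le {X : HiggsLattice.VecField P 0}
    (h210 : (regRegionKernels hL1 C Finset.univ X msq a k K₀).Ineq210 δ₁ Cst) (hmsq : 0 < msq) (ha : 0 < a)
    (hk : 1 ≤ k) (hkK : k ≤ P.K) (hδ₁ : 0 < δ₁) (hδ₁1 : δ₁ ≤ 1) (hCst : 0 ≤ Cst) (hd3 : P.d ≤ 3) (i₀ : Ix N)
    {θ : ℝ} (hθ0 : 0 ≤ θ) (hθ : θ ≤ δ₁ / 4) (x : HiggsLattice.Site P 0) :
    ∑ b : HiggsLattice.PBond P 0, P.mesh 0 ^ P.d *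
        (Real.exp (2 * (θ / (P.L : ℝ) ^ k * (HiggsLattice.Site.tdist x b.src : ℝ))) * col C msq a k X x b.tgt ^ 2)
      ≤ (P.d : ℝ) * ((Real.exp 1 * (P.mesh 0 ^ P.d * Cst)) ^ 2 * ((nCol N : ℝ) * (4 * P.d / (δ₁ / 2 / 2)) ^ P.d) /
          ((P.L : ℝ) ^ (((4 : ℝ) - (P.d : ℝ)) / 2) - 1) ^ 2 * P.mesh k ^ ((4 : ℝ) - (P.d : ℝ))) := by
  have hc : 0 ≤ P.mesh 0 ^ P.d * Cst := mul_nonneg (pow_nonneg (P.mesh_pos 0).le _) hCst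
  have hc1 : 0 ≤ Real.exp 1 * (P.mesh 0 ^ P.d * Cst) := mul_nonneg (Real.exp_nonneg _) hc
  have hε : 0 ≤ P.mesh 0 ^ P.d := pow_nonneg (P.mesh_pos 0).le _
  set K : ℕ → HiggsLattice.Site P 0 → ℝ := fun j y =>
    (Real.exp 1 * (P.mesh 0 ^ P.d * Cst)) * P.mesh j ^ ((2 : ℝ) - (P.d : ℝ)) *
      Real.exp (-(δ₁ / 2 * (P.mesh j)⁻¹ * (P.mesh 0 * (HiggsLattice.Site.tdist y x : ℝ)))) with hKdef
  have hK0 : ∀ j y, 0 ≤ K j y := fun j y =>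
    mul_nonneg (mul_nonneg hc1 (Real.rpow_nonneg (P.mesh_pos j).le _)) (Real.exp_nonneg _)
  have hKle : ∀ j, j < k → ∀ y, |K j y| ≤ (Real.exp 1 * (P.mesh 0 ^ P.d * Cst)) * P.mesh j ^ ((2 : ℝ) - (P.d : ℝ)) *
      Real.exp (-(δ₁ / 2 * (P.mesh j)⁻¹ * (P.mesh 0 * (HiggsLattice.Site.tdist y x : ℝ)))) :=
    fun j _ y => by rw [abs_of_nonneg (hK0 j y)]
  have hsq := B3Op116ScaleChains.sq_col_weighted_le (N := N) (k := k) hL1 hd3 hc1 (half_pos hδ₁) (by linarith) hθ0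
    (by linarith) x i₀ K hKle
  have hcol : ∀ (y : HiggsLattice.Site P 0) (μ : Fin P.d), col C msq a k X x (y.shift μ) ≤ ∑ j ∈ Finset.range k, |K j y| := by
    intro y μ
    refine ((col_le h210 hmsq ha hk hkK x (y.shift μ)).trans (majorant_shift_le hδ₁ hδ₁1 hc x y μ)).trans ?_
    refine (majorant_mono (δ := δ₁) (δ' := δ₁ / 2) hc1 (by linarith) le_rfl x y).trans (le_of_eq ?_)
    refine Finset.sum_congr rfl fun j _ => ?_
    rw [abs_of_nonneg (hK0 j y), hKdef]
    simp only [B1Ineq234LevelZero.tdist_comm x y]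
  have hb : ∑ b : HiggsLattice.PBond P 0, P.mesh 0 ^ P.d *
      (Real.exp (2 * (θ / (P.L : ℝ) ^ k * (HiggsLattice.Site.tdist x b.src : ℝ))) * col C msq a k X x b.tgt ^ 2)
      = ∑ y : HiggsLattice.Site P 0, ∑ μ : Fin P.d, P.mesh 0 ^ P.d *
          (Real.exp (2 * (θ / (P.L : ℝ) ^ k * (HiggsLattice.Site.tdist y x : ℝ))) * col C msq a k X x (y.shift μ) ^ 2) := by
    rw [sum_site_dir (fun y μ => P.mesh 0 ^ P.d *
      (Real.exp (2 * (θ / (P.L : ℝ) ^ k * (HiggsLattice.Site.tdist y x : ℝ))) * col C msq a k X x (y.shift μ) ^ 2))]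
    refine Finset.sum_congr rfl fun b _ => ?_
    rw [B1Ineq234LevelZero.tdist_comm x b.src]
    rfl
  rw [hb, Finset.sum_comm]
  have hμ : ∀ μ : Fin P.d, ∑ y : HiggsLattice.Site P 0, P.mesh 0 ^ P.d *
      (Real.exp (2 * (θ / (P.L : ℝ) ^ k * (HiggsLattice.Site.tdist y x : ℝ))) * col C msq a k X x (y.shift μ) ^ 2)
      ≤ (Real.exp 1 * (P.mesh 0 ^ P.d * Cst)) ^ 2 * ((nCol N : ℝ) * (4 * P.d / (δ₁ / 2 / 2)) ^ P.d) /
          ((P.L : ℝ) ^ (((4 : ℝ) - (P.d : ℝ)) / 2) - 1) ^ 2 * P.mesh k ^ ((4 : ℝ) - (P.d : ℝ)) := by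
    intro μ
    refine le_trans (Finset.sum_le_sum fun y _ => mul_le_mul_of_nonneg_left (mul_le_mul_of_nonneg_left
      (pow_le_pow_left₀ (col_nonneg (C := C) (msq := msq) (a := a) (k := k) X x (y.shift μ)) (hcol y μ) 2)
      (Real.exp_nonneg _)) hε) hsq
  refine (Finset.sum_le_sum fun μ _ => hμ μ).trans (le_of_eq ?_)
  rw [Finset.sum_const, Finset.card_univ, Fintype.card_fin, nsmul_eq_mul]


/-- kernel of the near/far geometry: if `3|x − b₋| ≤ |x − x′|` and `3|b′₋ − x′| ≤ |x − x′|` then the four distances between the end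
points of `b` and `b′` are `≥ |x − x′|/3 − 2`. [cite: Balaban1982Higgs1, (1.3) p.604] -/
theorem sep_of_near (x x' : HiggsLattice.Site P 0) (b b' : HiggsLattice.PBond P 0)
    (hb : 3 * HiggsLattice.Site.tdist x b.src ≤ HiggsLattice.Site.tdist x x')
    (hb' : 3 * HiggsLattice.Site.tdist b'.src x' ≤ HiggsLattice.Site.tdist x x') :
    (HiggsLattice.Site.tdist x x' : ℝ) / 3 - 2 ≤ (HiggsLattice.Site.tdist b.src b'.src : ℝ) ∧
    (HiggsLattice.Site.tdist x x' : ℝ) / 3 - 2 ≤ (HiggsLattice.Site.tdist b.src b'.tgt : ℝ) ∧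
    (HiggsLattice.Site.tdist x x' : ℝ) / 3 - 2 ≤ (HiggsLattice.Site.tdist b.tgt b'.src : ℝ) ∧
    (HiggsLattice.Site.tdist x x' : ℝ) / 3 - 2 ≤ (HiggsLattice.Site.tdist b.tgt b'.tgt : ℝ) := by
  have hbR : 3 * (HiggsLattice.Site.tdist x b.src : ℝ) ≤ (HiggsLattice.Site.tdist x x' : ℝ) := by exact_mod_cast hb
  have hb'R : 3 * (HiggsLattice.Site.tdist b'.src x' : ℝ) ≤ (HiggsLattice.Site.tdist x x' : ℝ) := by exact_mod_cast hb'
  have t1 := B1Ineq234LevelZero.tdist_triangle_real x b.src x'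
  have t2 := B1Ineq234LevelZero.tdist_triangle_real b.src b'.src x'
  have hss : (HiggsLattice.Site.tdist x x' : ℝ) / 3 ≤ (HiggsLattice.Site.tdist b.src b'.src : ℝ) := by linarith
  have hs1 : (HiggsLattice.Site.tdist b.src b.tgt : ℝ) ≤ 1 := by exact_mod_cast B1Ineq234LevelZero.tdist_shift_le_one b.src b.dir
  have hs2 : (HiggsLattice.Site.tdist b'.src b'.tgt : ℝ) ≤ 1 := by
    exact_mod_cast B1Ineq234LevelZero.tdist_shift_le_one b'.src b'.dir
  have t3 := B1Ineq234LevelZero.tdist_triangle_real b.src b'.tgt b'.src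
  have t4 := B1Ineq234LevelZero.tdist_triangle_real b.src b.tgt b'.src
  have t5 := B1Ineq234LevelZero.tdist_triangle_real b.src b.tgt b'.tgt
  rw [B1Ineq234LevelZero.tdist_comm b'.tgt b'.src] at t3
  refine ⟨by linarith, by linarith, by linarith, by linarith⟩

/-- the `L²` constant of the ninth chain: `K = 4 + 2(2/√γ₀)(L^kε)ρ + (2/γ₀)(L^kε)²ρ²`, `ρ = √(d(|e|s)²)`, `γ₀ = min{2, a(1−L^{−2})/4}`
(`sqrt_bondInner_DGDt_le`). [cite: Balaban1983RegularityDecay, Cor. 2.3 (2.30) p.580] -/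
def Kbad (P : HiggsLattice.Params) {N : ℕ} (C : ChargeData N) (a s : ℝ) (k : ℕ) : ℝ :=
  4 + 2 * (2 / Real.sqrt (min 2 (a * (1 - ((P.L : ℝ) ^ 2)⁻¹) / 4)) * P.mesh k) * Real.sqrt (P.d * (|C.e| * s) ^ 2)
    + (2 / min 2 (a * (1 - ((P.L : ℝ) ^ 2)⁻¹) / 4) * P.mesh k ^ 2) * Real.sqrt (P.d * (|C.e| * s) ^ 2) ^ 2

/-- the constant of the ninth chain's pairing with separated supports at rate `θ` (`abs_bondInner_DGDt_le`).
[cite: Balaban1983RegularityDecay, Cor. 2.3 (2.30) p.580] -/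
def Kth (P : HiggsLattice.Params) {N : ℕ} (C : ChargeData N) (a s : ℝ) (k : ℕ) (θ : ℝ) : ℝ :=
  (4 + 2 * θ * Real.sqrt (8 * P.d / min 2 (a * (1 - ((P.L : ℝ) ^ 2)⁻¹) / 4))) * Real.exp θ
    + 2 * ((2 / Real.sqrt (min 2 (a * (1 - ((P.L : ℝ) ^ 2)⁻¹) / 4))
        + 4 * Real.sqrt P.d * θ / min 2 (a * (1 - ((P.L : ℝ) ^ 2)⁻¹) / 4)) * P.mesh k * Real.exp θ) *
        Real.sqrt (P.d * (|C.e| * s) ^ 2)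
    + (2 / min 2 (a * (1 - ((P.L : ℝ) ^ 2)⁻¹) / 4) * P.mesh k ^ 2) * Real.sqrt (P.d * (|C.e| * s) ^ 2) ^ 2

/-- the weighted `ℓ²`-column constant `W = d·(e·ε^dC)²·N(16d/δ₁)^d(L^{(4−d)/2}−1)^{−2}·(L^kε)^{4−d}` (`weighted_sq_col_tgt_le`).
[cite: Balaban1983Higgs3, (2.10) p.426] -/
def Wsq (P : HiggsLattice.Params) (N : ℕ) (δ₁ Cst : ℝ) (k : ℕ) : ℝ :=
  (P.d : ℝ) * ((Real.exp 1 * (P.mesh 0 ^ P.d * Cst)) ^ 2 * ((nCol N : ℝ) * (4 * P.d / (δ₁ / 2 / 2)) ^ P.d) /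
    ((P.L : ℝ) ^ (((4 : ℝ) - (P.d : ℝ)) / 2) - 1) ^ 2 * P.mesh k ^ ((4 : ℝ) - (P.d : ℝ)))

/-- `K_bad ≥ 0`. [cite: Balaban1983RegularityDecay, Cor. 2.3 (2.30) p.580] -/
theorem Kbad_nonneg (ha : 0 < a) (hL1 : 1 < P.L) (s : ℝ) (k : ℕ) : 0 ≤ Kbad P C a s k := by
  have hγ : 0 < min 2 (a * (1 - ((P.L : ℝ) ^ 2)⁻¹) / 4) := B1Ineq18RegularRegion.gammaReg_pos (P := P) ha hL1
  have := P.mesh_pos k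
  unfold Kbad; positivity

/-- `K_θ ≥ 0` for `θ ≥ 0`. [cite: Balaban1983RegularityDecay, Cor. 2.3 (2.30) p.580] -/
theorem Kth_nonneg (ha : 0 < a) (hL1 : 1 < P.L) (s : ℝ) (k : ℕ) {θ : ℝ} (hθ : 0 ≤ θ) : 0 ≤ Kth P C a s k θ := by
  have hγ : 0 < min 2 (a * (1 - ((P.L : ℝ) ^ 2)⁻¹) / 4) := B1Ineq18RegularRegion.gammaReg_pos (P := P) ha hL1
  have := P.mesh_pos k
  unfold Kth; positivity

/-- `W ≥ 0`. [cite: Balaban1983Higgs3, (2.10) p.426] -/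
theorem Wsq_nonneg (hδ₁ : 0 < δ₁) (N : ℕ) (Cst : ℝ) (k : ℕ) : 0 ≤ Wsq P N δ₁ Cst k := by
  have := P.mesh_pos k
  have h2 : 0 ≤ (4 * (P.d : ℝ) / (δ₁ / 2 / 2)) ^ P.d := pow_nonneg (by positivity) _
  unfold Wsq; positivity

/-- the square of the `L²` bound of the ninth chain applied to a bond field: `Σ_b‖(D^ε_BG′D^{ε*}_Bφ)(b)‖² ≤ ε^{−d}K²⟨φ,φ⟩`.
[cite: Balaban1983RegularityDecay, Cor. 2.3 (2.30) p.580] [cite: Balaban1983Higgs3, (1.16) p.414] -/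
theorem sum_norm_sq_DGDt_le (ha : 0 < a) (hL : 1 < P.L) (hmsq : 0 < msq) (hk1 : 1 ≤ k) (hk : k ≤ P.K)
    {δX : ℝ} (hreg : ∀ (z : HiggsLattice.Site P 0) (μ ν : Fin P.d), |(A + B) ⟨z.shift ν, μ⟩ - (A + B) ⟨z, μ⟩| ≤ δX)
    (hsmall : (P.d : ℝ) ^ 2 * (P.mesh 0 * |C.e|) * ((P.L : ℝ) ^ k) ^ 2 * δX ≤ 1 / 3)
    {s : ℝ} (hA : ∀ b : HiggsLattice.PBond P 0, |A b| ≤ s) (φ : HiggsLattice.PBond P 0 → E N) :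
    ∑ b : HiggsLattice.PBond P 0, ‖covDeriv C B (propagatorK C Finset.univ (A + B) msq a k (adjD C B φ)) b‖ ^ 2
      ≤ (P.mesh 0 ^ P.d)⁻¹ * (Kbad P C a s k ^ 2 * bondInner φ φ) := by
  set Z := covDeriv C B (propagatorK C Finset.univ (A + B) msq a k (adjD C B φ)) with hZ
  have hZZ : 0 ≤ bondInner Z Z := B1Ineq233LowerZeroFieldTorus.bondInner_self_nonneg Z
  have hφφ : 0 ≤ bondInner φ φ := B1Ineq233LowerZeroFieldTorus.bondInner_self_nonneg φ
  have hbad : Real.sqrt (bondInner Z Z) ≤ Kbad P C a s k * Real.sqrt (bondInner φ φ) :=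
    sqrt_bondInner_DGDt_le (C := C) (A := A) (B := B) ha hL hmsq hk1 hk hreg hsmall hA φ
  rw [sum_norm_sq_eq_inv_mul_bondInner]
  refine mul_le_mul_of_nonneg_left ?_ (inv_nonneg.mpr (pow_nonneg (P.mesh_pos 0).le _))
  have h1 : bondInner Z Z = Real.sqrt (bondInner Z Z) ^ 2 := (Real.sq_sqrt hZZ).symm
  rw [h1]
  refine (pow_le_pow_left₀ (Real.sqrt_nonneg _) hbad 2).trans (le_of_eq ?_)
  rw [mul_pow, Real.sq_sqrt hφφ]

/-- `⟨ψ,ψ⟩ ≤ Σ_b ε^dF(b)²` when `‖ψ(b)‖ ≤ F(b)`. [cite: Balaban1982Higgs1, (1.5) p.604] -/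
theorem bondInner_le_of_norm_le (ψ : HiggsLattice.PBond P 0 → E N) (F : HiggsLattice.PBond P 0 → ℝ) (hF : ∀ b, ‖ψ b‖ ≤ F b) :
    bondInner ψ ψ ≤ ∑ b : HiggsLattice.PBond P 0, P.mesh 0 ^ P.d * F b ^ 2 := by
  unfold bondInner
  refine Finset.sum_le_sum fun b _ => ?_
  rw [real_inner_self_eq_norm_sq]
  exact mul_le_mul_of_nonneg_left (pow_le_pow_left₀ (norm_nonneg _) (hF b) 2) (pow_nonneg (P.mesh_pos 0).le _)

/-- far bonds pay: if `3t > ρ` then `1 ≤ e^{2(θ/L^k)t}·(e^{−(θ/L^k)ρ/3})²` (`θ ≥ 0`). [folklore] -/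
private theorem one_le_weight_of_far {θ : ℝ} (hθ : 0 ≤ θ) {k ρ t : ℕ} (ht : ¬ 3 * t ≤ ρ) :
    (1 : ℝ) ≤ Real.exp (2 * (θ / (P.L : ℝ) ^ k * (t : ℝ))) * Real.exp (-(θ / (P.L : ℝ) ^ k * ((ρ : ℝ) / 3))) ^ 2 := by
  have ht' : (ρ : ℝ) < 3 * (t : ℝ) := by exact_mod_cast Nat.lt_of_not_le ht
  rw [← Real.exp_nat_mul, ← Real.exp_add]
  apply Real.one_le_exp_iff.mpr
  have h0 : 0 ≤ θ / (P.L : ℝ) ^ k := by have := P.hL; positivity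
  have : θ / (P.L : ℝ) ^ k * ((ρ : ℝ) / 3) ≤ θ / (P.L : ℝ) ^ k * (t : ℝ) := mul_le_mul_of_nonneg_left (by linarith) h0
  push_cast
  linarith

/-- kernel of the far pieces: `c ≤ ε^{−1}E²(ε(wc))` when `1 ≤ wE²`, `c ≥ 0`. [folklore] -/
private theorem le_far_weight {ε Eθ w c : ℝ} (hε : 0 < ε) (h1 : 1 ≤ w * Eθ ^ 2) (hc : 0 ≤ c) :
    c ≤ ε⁻¹ * Eθ ^ 2 * (ε * (w * c)) := by
  have hεi : ε⁻¹ * ε = 1 := inv_mul_cancel₀ hε.ne'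
  calc c = 1 * c := (one_mul c).symm
    _ ≤ (w * Eθ ^ 2) * c := mul_le_mul_of_nonneg_right h1 hc
    _ = ε⁻¹ * ε * (w * Eθ ^ 2 * c) := by rw [hεi, one_mul]
    _ = _ := by ring

variable (h210B : (regRegionKernels hL1 C Finset.univ B msq a k K₀).Ineq210 δ₁ Cst) (hmsq : 0 < msq) (ha : 0 < a)
  (hk : 1 ≤ k) (hkK : k ≤ P.K) (hδ₁ : 0 < δ₁) (hδ₁1 : δ₁ ≤ 1) (hCst : 0 ≤ Cst) (hd3 : P.d ≤ 3) (i₀ : Ix N)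
include h210B hmsq ha hk hkK hδ₁ hδ₁1 hCst hd3 i₀

/-- **The outer row in `ℓ²`**: `Σ_b κ_B(x,b₊)² ≤ ε^{−d}W`. [cite: Balaban1983Higgs3, (2.10) p.426] -/
theorem row_sq_le (x : HiggsLattice.Site P 0) :
    ∑ b : HiggsLattice.PBond P 0, col C msq a k B x b.tgt ^ 2 ≤ (P.mesh 0 ^ P.d)⁻¹ * Wsq P N δ₁ Cst k := by
  have hε : 0 < P.mesh 0 ^ P.d := pow_pos (P.mesh_pos 0) _
  have h := weighted_sq_col_row_le (X := B) h210B hmsq ha hk hkK hδ₁ hδ₁1 hCst hd3 i₀ le_rfl (by linarith) x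
  simp only [zero_div, zero_mul, mul_zero, Real.exp_zero, one_mul] at h
  calc ∑ b : HiggsLattice.PBond P 0, col C msq a k B x b.tgt ^ 2
      = (P.mesh 0 ^ P.d)⁻¹ * ∑ b : HiggsLattice.PBond P 0, P.mesh 0 ^ P.d * col C msq a k B x b.tgt ^ 2 := by
        rw [Finset.mul_sum]; exact Finset.sum_congr rfl fun b _ => by rw [← mul_assoc, inv_mul_cancel₀ hε.ne', one_mul]
    _ ≤ (P.mesh 0 ^ P.d)⁻¹ * Wsq P N δ₁ Cst k := mul_le_mul_of_nonneg_left h (inv_nonneg.mpr hε.le)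

/-- **The FAR part of the outer row in `ℓ²`** (bonds `b` with `3|x−b₋| > |x−x′|`): `Σ_{b far} κ_B(x,b₊)² ≤ ε^{−d}e^{−2(θ/L^k)|x−x′|/3}W`
(`weighted_sq_col_row_le`). [cite: Balaban1983Higgs3, (1.16) p.414, (2.10) p.426] -/
theorem far_row_sq_le {θ : ℝ} (hθ0 : 0 ≤ θ) (hθ1 : θ ≤ δ₁ / 4) (x x' : HiggsLattice.Site P 0) :
    ∑ b : HiggsLattice.PBond P 0,
        (if 3 * HiggsLattice.Site.tdist x b.src ≤ HiggsLattice.Site.tdist x x' then 0 else col C msq a k B x b.tgt) ^ 2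
      ≤ (P.mesh 0 ^ P.d)⁻¹ * Real.exp (-(θ / (P.L : ℝ) ^ k * ((HiggsLattice.Site.tdist x x' : ℝ) / 3))) ^ 2 *
          Wsq P N δ₁ Cst k := by
  have hε : 0 < P.mesh 0 ^ P.d := pow_pos (P.mesh_pos 0) _
  have h := weighted_sq_col_row_le (X := B) h210B hmsq ha hk hkK hδ₁ hδ₁1 hCst hd3 i₀ hθ0 hθ1 x
  have hpt : ∀ b : HiggsLattice.PBond P 0,
      (if 3 * HiggsLattice.Site.tdist x b.src ≤ HiggsLattice.Site.tdist x x' then 0 else col C msq a k B x b.tgt) ^ 2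
        ≤ (P.mesh 0 ^ P.d)⁻¹ * Real.exp (-(θ / (P.L : ℝ) ^ k * ((HiggsLattice.Site.tdist x x' : ℝ) / 3))) ^ 2 *
          (P.mesh 0 ^ P.d * (Real.exp (2 * (θ / (P.L : ℝ) ^ k * (HiggsLattice.Site.tdist x b.src : ℝ))) *
            col C msq a k B x b.tgt ^ 2)) := by
    intro b
    split_ifs with hnb
    · simp only [ne_eq, OfNat.ofNat_ne_zero, not_false_eq_true, zero_pow]
      have := col_nonneg (C := C) (msq := msq) (a := a) (k := k) B x b.tgt
      positivity
    · exact le_far_weight hε (one_le_weight_of_far (P := P) hθ0 hnb) (sq_nonneg _)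
  refine (Finset.sum_le_sum fun b _ => hpt b).trans ?_
  rw [← Finset.mul_sum]
  exact mul_le_mul_of_nonneg_left h (by positivity)

variable {s : ℝ} (hs : 0 ≤ s) (hA : ∀ b : HiggsLattice.PBond P 0, |A b| ≤ s)
include hs hA

/-- **The charges `g(b′) = M_{b′}w₀(b′₊)` in `L²`**: `⟨ψ,ψ⟩ ≤ (|e|s)²W` for every restriction `ψ` of `g` (`‖ψ(b′)‖ ≤ ‖g(b′)‖`).
[cite: Balaban1982Higgs1, (3.14) p.614] [cite: Balaban1983Higgs3, (2.10) p.426] -/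
theorem charge_sq_le (x' : HiggsLattice.Site P 0) (i' : Ix N) (ψ : HiggsLattice.PBond P 0 → E N)
    (hψ : ∀ b', ‖ψ b'‖ ≤ ‖gM C A B (propagatorK C Finset.univ B msq a k (cb P N 0 (x', i'))) b'‖) :
    bondInner ψ ψ ≤ (|C.e| * s) ^ 2 * Wsq P N δ₁ Cst k := by
  have hε : 0 < P.mesh 0 ^ P.d := pow_pos (P.mesh_pos 0) _
  have hes : 0 ≤ |C.e| * s := mul_nonneg (abs_nonneg _) hs
  have h := weighted_sq_col_tgt_le (X := B) h210B hmsq ha hk hkK hδ₁ hδ₁1 hCst hd3 i₀ le_rfl (by linarith) x'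
  simp only [zero_div, zero_mul, mul_zero, Real.exp_zero, one_mul] at h
  have hgb : ∀ b' : HiggsLattice.PBond P 0, ‖ψ b'‖ ≤ |C.e| * s * col C msq a k B b'.tgt x' := fun b' =>
    (hψ b').trans ((B3Op116Pieces.norm_mulM_apply_le C A B (hA b') _).trans
      (mul_le_mul_of_nonneg_left (norm_G_cb_le_col C msq a k B x' b'.tgt i') hes))
  refine (bondInner_le_of_norm_le ψ _ hgb).trans ?_
  calc ∑ b : HiggsLattice.PBond P 0, P.mesh 0 ^ P.d * (|C.e| * s * col C msq a k B b.tgt x') ^ 2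
      = (|C.e| * s) ^ 2 * ∑ b : HiggsLattice.PBond P 0, P.mesh 0 ^ P.d * col C msq a k B b.tgt x' ^ 2 := by
        rw [Finset.mul_sum]; exact Finset.sum_congr rfl fun b _ => by ring
    _ ≤ _ := mul_le_mul_of_nonneg_left h (sq_nonneg _)

/-- **The FAR charges in `L²`** (bonds `b′` with `3|b′₋−x′| > |x−x′|`): `⟨g_far,g_far⟩ ≤ (|e|s)²e^{−2(θ/L^k)|x−x′|/3}W`
(`weighted_sq_col_tgt_le`). [cite: Balaban1983Higgs3, (1.16) p.414, (2.10) p.426] -/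
theorem far_charge_sq_le {θ : ℝ} (hθ0 : 0 ≤ θ) (hθ1 : θ ≤ δ₁ / 4) (x x' : HiggsLattice.Site P 0) (i' : Ix N) :
    bondInner
        (fun b' => if 3 * HiggsLattice.Site.tdist b'.src x' ≤ HiggsLattice.Site.tdist x x' then (0 : E N)
          else gM C A B (propagatorK C Finset.univ B msq a k (cb P N 0 (x', i'))) b')
        (fun b' => if 3 * HiggsLattice.Site.tdist b'.src x' ≤ HiggsLattice.Site.tdist x x' then (0 : E N)
          else gM C A B (propagatorK C Finset.univ B msq a k (cb P N 0 (x', i'))) b')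
      ≤ (|C.e| * s) ^ 2 * (Real.exp (-(θ / (P.L : ℝ) ^ k * ((HiggsLattice.Site.tdist x x' : ℝ) / 3))) ^ 2 *
          Wsq P N δ₁ Cst k) := by
  have hε : 0 < P.mesh 0 ^ P.d := pow_pos (P.mesh_pos 0) _
  have hes : 0 ≤ |C.e| * s := mul_nonneg (abs_nonneg _) hs
  have h := weighted_sq_col_tgt_le (X := B) h210B hmsq ha hk hkK hδ₁ hδ₁1 hCst hd3 i₀ hθ0 hθ1 x'
  have hgb : ∀ b' : HiggsLattice.PBond P 0, ‖gM C A B (propagatorK C Finset.univ B msq a k (cb P N 0 (x', i'))) b'‖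
      ≤ |C.e| * s * col C msq a k B b'.tgt x' := fun b' =>
    (B3Op116Pieces.norm_mulM_apply_le C A B (hA b') _).trans
      (mul_le_mul_of_nonneg_left (norm_G_cb_le_col C msq a k B x' b'.tgt i') hes)
  refine (bondInner_le_of_norm_le _ (fun b' => if 3 * HiggsLattice.Site.tdist b'.src x' ≤ HiggsLattice.Site.tdist x x'
    then 0 else |C.e| * s * col C msq a k B b'.tgt x') (fun b' => ?_)).trans ?_
  · split_ifs
    · rw [norm_zero]
    · exact hgb b'
  · have hpt : ∀ b' : HiggsLattice.PBond P 0, P.mesh 0 ^ P.d *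
        (if 3 * HiggsLattice.Site.tdist b'.src x' ≤ HiggsLattice.Site.tdist x x' then 0
          else |C.e| * s * col C msq a k B b'.tgt x') ^ 2
        ≤ (|C.e| * s) ^ 2 * Real.exp (-(θ / (P.L : ℝ) ^ k * ((HiggsLattice.Site.tdist x x' : ℝ) / 3))) ^ 2 *
          (P.mesh 0 ^ P.d * (Real.exp (2 * (θ / (P.L : ℝ) ^ k * (HiggsLattice.Site.tdist b'.src x' : ℝ))) *
            col C msq a k B b'.tgt x' ^ 2)) := by
      intro b'
      split_ifs with hnb
      · simp only [ne_eq, OfNat.ofNat_ne_zero, not_false_eq_true, zero_pow, mul_zero]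
        have := col_nonneg (C := C) (msq := msq) (a := a) (k := k) B b'.tgt x'
        positivity
      · have h1 := one_le_weight_of_far (P := P) (k := k) hθ0 hnb
        have h3 : 0 ≤ P.mesh 0 ^ P.d * (|C.e| * s * col C msq a k B b'.tgt x') ^ 2 := by positivity
        calc P.mesh 0 ^ P.d * (|C.e| * s * col C msq a k B b'.tgt x') ^ 2
            = 1 * (P.mesh 0 ^ P.d * (|C.e| * s * col C msq a k B b'.tgt x') ^ 2) := (one_mul _).symm
          _ ≤ (Real.exp (2 * (θ / (P.L : ℝ) ^ k * (HiggsLattice.Site.tdist b'.src x' : ℝ))) *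
                Real.exp (-(θ / (P.L : ℝ) ^ k * ((HiggsLattice.Site.tdist x x' : ℝ) / 3))) ^ 2) *
              (P.mesh 0 ^ P.d * (|C.e| * s * col C msq a k B b'.tgt x') ^ 2) := mul_le_mul_of_nonneg_right h1 h3
          _ = _ := by ring
    refine (Finset.sum_le_sum fun b' _ => hpt b').trans ?_
    rw [← Finset.mul_sum, mul_assoc]
    exact mul_le_mul_of_nonneg_left (mul_le_mul_of_nonneg_left h (sq_nonneg _)) (sq_nonneg _)

omit hs in
/-- **The NEAR–NEAR piece is a pairing with separated supports**: for a bond field `φ` supported on the bonds with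
`3|b′₋ − x′| ≤ |x − x′|` and `Z_φ = D^ε_BG_k(T,A+B)D^{ε*}_Bφ`,
`Σ_{b : 3|x−b₋| ≤ |x−x′|} κ_B(x,b₊)‖Z_φ(b)‖ ≤ ε^{−d}·K_θe^{2θ}e^{−(θ/L^k)|x−x′|/3}·√W·√⟨φ,φ⟩` — linearisation with the unit-vector
field `h(b) = κ_B(x,b₊)Z_φ(b)/‖Z_φ(b)‖` (so that `Σ_bκ‖Z_φ‖ = ε^{−d}⟨h, Z_φ⟩`, `‖h(b)‖ ≤ κ_B(x,b₊)`) and `abs_bondInner_DGDt_le` at the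
separation `|x−x′|/3 − 2` (`sep_of_near`). [cite: Balaban1983Higgs3, (1.16) p.414, (2.5) p.424] [cite: Balaban1983RegularityDecay, Cor. 2.3 (2.30) p.580] -/
theorem near_pairing_le
    {δX : ℝ} (hreg : ∀ (z : HiggsLattice.Site P 0) (μ ν : Fin P.d), |(A + B) ⟨z.shift ν, μ⟩ - (A + B) ⟨z, μ⟩| ≤ δX)
    (hsmall : (P.d : ℝ) ^ 2 * (P.mesh 0 * |C.e|) * ((P.L : ℝ) ^ k) ^ 2 * δX ≤ 1 / 3)
    {θ : ℝ} (hθ0 : 0 ≤ θ) (hθγ : (4 * P.d + 4 * a) * θ ≤ min 2 (a * (1 - ((P.L : ℝ) ^ 2)⁻¹) / 4))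
    (x x' : HiggsLattice.Site P 0) (φ : HiggsLattice.PBond P 0 → E N)
    (hφ : ∀ b', φ b' ≠ 0 → 3 * HiggsLattice.Site.tdist b'.src x' ≤ HiggsLattice.Site.tdist x x') :
    ∑ b : HiggsLattice.PBond P 0,
        (if 3 * HiggsLattice.Site.tdist x b.src ≤ HiggsLattice.Site.tdist x x' then col C msq a k B x b.tgt else 0) *
          ‖covDeriv C B (propagatorK C Finset.univ (A + B) msq a k (adjD C B φ)) b‖
      ≤ (P.mesh 0 ^ P.d)⁻¹ * (Kth P C a s k θ * Real.exp (2 * θ) *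
          Real.exp (-(θ / (P.L : ℝ) ^ k * ((HiggsLattice.Site.tdist x x' : ℝ) / 3)))) *
          Real.sqrt (Wsq P N δ₁ Cst k) * Real.sqrt (bondInner φ φ) := by
  set ρ : ℕ := HiggsLattice.Site.tdist x x' with hρ
  set Z : HiggsLattice.PBond P 0 → E N := covDeriv C B (propagatorK C Finset.univ (A + B) msq a k (adjD C B φ)) with hZ
  set κ : HiggsLattice.PBond P 0 → ℝ := fun b => col C msq a k B x b.tgt with hκ
  have hε : 0 < P.mesh 0 ^ P.d := pow_pos (P.mesh_pos 0) _
  have hκ0 : ∀ b, 0 ≤ κ b := fun b => col_nonneg _ _ _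
  have hLk : (1 : ℝ) ≤ (P.L : ℝ) ^ k := one_le_pow₀ (by exact_mod_cast P.hL)
  have hKθ0 : 0 ≤ Kth P C a s k θ := Kth_nonneg (C := C) ha hL1 s k hθ0
  set hn : HiggsLattice.PBond P 0 → E N :=
    fun b => if 3 * HiggsLattice.Site.tdist x b.src ≤ ρ then (κ b * ‖Z b‖⁻¹) • Z b else 0 with hhn
  -- linearisation
  have hlin : ∑ b : HiggsLattice.PBond P 0, (if 3 * HiggsLattice.Site.tdist x b.src ≤ ρ then κ b else 0) * ‖Z b‖
      = (P.mesh 0 ^ P.d)⁻¹ * bondInner hn Z := by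
    unfold bondInner
    rw [Finset.mul_sum]
    refine Finset.sum_congr rfl fun b _ => ?_
    rw [← mul_assoc, inv_mul_cancel₀ hε.ne', one_mul]
    simp only [hhn]
    split_ifs with hnb
    · rw [real_inner_smul_left, real_inner_self_eq_norm_sq]
      by_cases hz : ‖Z b‖ = 0
      · rw [hz]; simp
      · field_simp
    · rw [inner_zero_left, zero_mul]
  have hhn_norm : ∀ b, ‖hn b‖ ≤ κ b := by
    intro b
    simp only [hhn]
    split_ifs with hnb
    · rw [norm_smul, Real.norm_eq_abs, abs_of_nonneg (mul_nonneg (hκ0 b) (inv_nonneg.mpr (norm_nonneg _)))]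
      by_cases hz : ‖Z b‖ = 0
      · rw [hz, mul_zero]; exact hκ0 b
      · rw [mul_assoc, inv_mul_cancel₀ hz, mul_one]
    · rw [norm_zero]; exact hκ0 b
  have hhh : bondInner hn hn ≤ Wsq P N δ₁ Cst k := by
    have h := weighted_sq_col_row_le (X := B) h210B hmsq ha hk hkK hδ₁ hδ₁1 hCst hd3 i₀ le_rfl (by linarith) x
    simp only [zero_div, zero_mul, mul_zero, Real.exp_zero, one_mul] at h
    exact (bondInner_le_of_norm_le hn κ hhn_norm).trans h
  -- supports
  have hsep : ∀ b b' : HiggsLattice.PBond P 0, hn b ≠ 0 → φ b' ≠ 0 →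
      (ρ : ℝ) / 3 - 2 ≤ (HiggsLattice.Site.tdist b.src b'.src : ℝ) ∧ (ρ : ℝ) / 3 - 2 ≤ (HiggsLattice.Site.tdist b.src b'.tgt : ℝ) ∧
      (ρ : ℝ) / 3 - 2 ≤ (HiggsLattice.Site.tdist b.tgt b'.src : ℝ) ∧ (ρ : ℝ) / 3 - 2 ≤ (HiggsLattice.Site.tdist b.tgt b'.tgt : ℝ) := by
    intro b b' hb hb'
    have hnb : 3 * HiggsLattice.Site.tdist x b.src ≤ ρ := by
      by_contra hc; apply hb; simp only [hhn, if_neg hc]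
    exact sep_of_near x x' b b' hnb (hφ b' hb')
  have hpair := abs_bondInner_DGDt_le (C := C) (A := A) (B := B) ha hL1 hmsq hk hkK hreg hsmall hA hθ0 hθγ hn φ
    ((ρ : ℝ) / 3 - 2) hsep
  -- the decay factor at separation ρ/3 − 2
  have hEr : Real.exp (-(θ * (((ρ : ℝ) / 3 - 2) / (P.L : ℝ) ^ k)))
      ≤ Real.exp (2 * θ) * Real.exp (-(θ / (P.L : ℝ) ^ k * ((ρ : ℝ) / 3))) := by
    rw [← Real.exp_add]
    apply Real.exp_le_exp.mpr
    have hLk0 : (0 : ℝ) < (P.L : ℝ) ^ k := by positivity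
    have h1 : θ / (P.L : ℝ) ^ k ≤ θ := div_le_self hθ0 hLk
    have e1 : -(θ * (((ρ : ℝ) / 3 - 2) / (P.L : ℝ) ^ k)) = 2 * (θ / (P.L : ℝ) ^ k) + -(θ / (P.L : ℝ) ^ k * ((ρ : ℝ) / 3)) := by
      field_simp
      ring
    rw [e1]; linarith
  rw [hlin]
  refine (mul_le_mul_of_nonneg_left ((le_abs_self _).trans hpair) (inv_nonneg.mpr hε.le)).trans ?_
  have hs1 : Real.sqrt (bondInner hn hn) ≤ Real.sqrt (Wsq P N δ₁ Cst k) := Real.sqrt_le_sqrt hhh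
  have hK : (4 + 2 * θ * Real.sqrt (8 * P.d / min 2 (a * (1 - ((P.L : ℝ) ^ 2)⁻¹) / 4))) * Real.exp θ
      + 2 * ((2 / Real.sqrt (min 2 (a * (1 - ((P.L : ℝ) ^ 2)⁻¹) / 4))
          + 4 * Real.sqrt P.d * θ / min 2 (a * (1 - ((P.L : ℝ) ^ 2)⁻¹) / 4)) * P.mesh k * Real.exp θ) *
          Real.sqrt (P.d * (|C.e| * s) ^ 2)
      + (2 / min 2 (a * (1 - ((P.L : ℝ) ^ 2)⁻¹) / 4) * P.mesh k ^ 2) * Real.sqrt (P.d * (|C.e| * s) ^ 2) ^ 2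
      = Kth P C a s k θ := rfl
  rw [hK]
  rw [mul_assoc ((P.mesh 0 ^ P.d)⁻¹), mul_assoc ((P.mesh 0 ^ P.d)⁻¹)]
  refine mul_le_mul_of_nonneg_left ?_ (inv_nonneg.mpr hε.le)
  calc Kth P C a s k θ * Real.exp (-(θ * (((ρ : ℝ) / 3 - 2) / (P.L : ℝ) ^ k))) * Real.sqrt (bondInner hn hn) *
        Real.sqrt (bondInner φ φ)
      ≤ Kth P C a s k θ * (Real.exp (2 * θ) * Real.exp (-(θ / (P.L : ℝ) ^ k * ((ρ : ℝ) / 3)))) *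
          Real.sqrt (Wsq P N δ₁ Cst k) * Real.sqrt (bondInner φ φ) := by
        refine mul_le_mul_of_nonneg_right (mul_le_mul (mul_le_mul_of_nonneg_left hEr hKθ0) hs1 (Real.sqrt_nonneg _)
          (by positivity)) (Real.sqrt_nonneg _)
    _ = _ := by ring

/-- **THE NINTH TERM OF THE OUTER ROW WITH ITS EXPONENTIAL DECAY** (VALUE clause, `n = n′ = 1`, torus, `d ≤ 3`): with
`w₀ = G_k(T,B)e_{(x′,i′)}`, `g(b′) = M_{b′}w₀(b′₊)`, `Z = D^ε_BG_k(T,A+B)D^{ε*}_Bg`, for every `0 ≤ θ ≤ δ₁/4` with `(4d+4a)θ ≤ γ₀`: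
`Σ_b κ_B(x,b₊)‖Z(b)‖ ≤ ε^{−d}·|e|s·W·(2K + K_θe^{2θ})·e^{−(θ/L^k)|x−x′|/3}` — the NEAR/FAR SPLIT: `g = g_near + g_far` around `x′`
(thirds of `|x − x′|`) and the outer column near/far around `x`; the far pieces are exponentially small in `ℓ²` (`far_row_sq_le`,
`far_charge_sq_le`) against the uniform `L²` bound `sum_norm_sq_DGDt_le` (Cauchy–Schwarz), and the near–near piece is the pairing
`near_pairing_le`. This is the «exponentially decaying» half of p. 414 for the one chain the sup-norm bookkeeping cannot do.
[cite: Balaban1983Higgs3, (1.16) p.414, (2.5) p.424] [cite: Balaban1983RegularityDecay, Cor. 2.3 (2.30) p.580] -/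
theorem ninth_term_decay_le
    {δX : ℝ} (hreg : ∀ (z : HiggsLattice.Site P 0) (μ ν : Fin P.d), |(A + B) ⟨z.shift ν, μ⟩ - (A + B) ⟨z, μ⟩| ≤ δX)
    (hsmall : (P.d : ℝ) ^ 2 * (P.mesh 0 * |C.e|) * ((P.L : ℝ) ^ k) ^ 2 * δX ≤ 1 / 3)
    {θ : ℝ} (hθ0 : 0 ≤ θ) (hθ1 : θ ≤ δ₁ / 4) (hθγ : (4 * P.d + 4 * a) * θ ≤ min 2 (a * (1 - ((P.L : ℝ) ^ 2)⁻¹) / 4))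
    (x x' : HiggsLattice.Site P 0) (i' : Ix N) :
    ∑ b : HiggsLattice.PBond P 0, col C msq a k B x b.tgt *
        ‖covDeriv C B (propagatorK C Finset.univ (A + B) msq a k
          (adjD C B (gM C A B (propagatorK C Finset.univ B msq a k (cb P N 0 (x', i')))))) b‖
      ≤ (P.mesh 0 ^ P.d)⁻¹ * (|C.e| * s) * Wsq P N δ₁ Cst k *
          (2 * Kbad P C a s k + Kth P C a s k θ * Real.exp (2 * θ)) *
          Real.exp (-(θ / (P.L : ℝ) ^ k * ((HiggsLattice.Site.tdist x x' : ℝ) / 3))) := by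
  set ρ : ℕ := HiggsLattice.Site.tdist x x' with hρ
  set w₀ := propagatorK C Finset.univ B msq a k (cb P N 0 (x', i')) with hw₀
  set g : HiggsLattice.PBond P 0 → E N := gM C A B w₀ with hg
  set G' : ScalarField P 0 N →ₗ[ℝ] ScalarField P 0 N := propagatorK C Finset.univ (A + B) msq a k with hG'
  set gn : HiggsLattice.PBond P 0 → E N := fun b' => if 3 * HiggsLattice.Site.tdist b'.src x' ≤ ρ then g b' else 0 with hgn
  set gf : HiggsLattice.PBond P 0 → E N := fun b' => if 3 * HiggsLattice.Site.tdist b'.src x' ≤ ρ then 0 else g b' with hgf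
  set Zn : HiggsLattice.PBond P 0 → E N := covDeriv C B (G' (adjD C B gn)) with hZn
  set Zf : HiggsLattice.PBond P 0 → E N := covDeriv C B (G' (adjD C B gf)) with hZf
  set κ : HiggsLattice.PBond P 0 → ℝ := fun b => col C msq a k B x b.tgt with hκ
  set κn : HiggsLattice.PBond P 0 → ℝ := fun b => if 3 * HiggsLattice.Site.tdist x b.src ≤ ρ then κ b else 0 with hκn
  set κf : HiggsLattice.PBond P 0 → ℝ := fun b => if 3 * HiggsLattice.Site.tdist x b.src ≤ ρ then 0 else κ b with hκf
  set Eθ : ℝ := Real.exp (-(θ / (P.L : ℝ) ^ k * ((ρ : ℝ) / 3))) with hEθ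
  set W : ℝ := Wsq P N δ₁ Cst k with hW
  set Kb : ℝ := Kbad P C a s k with hKb
  set Kt : ℝ := Kth P C a s k θ with hKt
  have hε : 0 < P.mesh 0 ^ P.d := pow_pos (P.mesh_pos 0) _
  have hes : 0 ≤ |C.e| * s := mul_nonneg (abs_nonneg _) hs
  have hKb0 : 0 ≤ Kb := Kbad_nonneg (C := C) ha hL1 s k
  have hKt0 : 0 ≤ Kt := Kth_nonneg (C := C) ha hL1 s k hθ0
  have hEθ0 : 0 < Eθ := Real.exp_pos _
  have hW0 : 0 ≤ W := Wsq_nonneg (P := P) hδ₁ N Cst k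
  have hκ0 : ∀ b, 0 ≤ κ b := fun b => col_nonneg _ _ _
  -- ℓ² inputs
  have hWrow0 : ∑ b : HiggsLattice.PBond P 0, κ b ^ 2 ≤ (P.mesh 0 ^ P.d)⁻¹ * W := row_sq_le h210B hmsq ha hk hkK hδ₁ hδ₁1 hCst hd3 i₀ x
  have hWrowθ : ∑ b : HiggsLattice.PBond P 0, κf b ^ 2 ≤ (P.mesh 0 ^ P.d)⁻¹ * Eθ ^ 2 * W :=
    far_row_sq_le h210B hmsq ha hk hkK hδ₁ hδ₁1 hCst hd3 i₀ hθ0 hθ1 x x'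
  have hgn_le : bondInner gn gn ≤ (|C.e| * s) ^ 2 * W := by
    refine charge_sq_le h210B hmsq ha hk hkK hδ₁ hδ₁1 hCst hd3 i₀ hs hA x' i' gn fun b' => ?_
    simp only [hgn]
    split_ifs
    · exact le_rfl
    · rw [norm_zero]; exact norm_nonneg _
  have hgf_le : bondInner gf gf ≤ (|C.e| * s) ^ 2 * (Eθ ^ 2 * W) :=
    far_charge_sq_le h210B hmsq ha hk hkK hδ₁ hδ₁1 hCst hd3 i₀ hs hA hθ0 hθ1 x x' i'
  -- Z = Zn + Zf
  have hgsplit : g = gn + gf := by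
    funext b'
    simp only [hgn, hgf, Pi.add_apply]
    split_ifs <;> simp
  have hZ : ∀ b : HiggsLattice.PBond P 0, covDeriv C B (G' (adjD C B g)) b = Zn b + Zf b := by
    intro b
    rw [hgsplit, adjD_add, map_add, hZn, hZf]
    exact B3Ineq210RegularTorus.covDeriv_add'' C B _ _ b
  -- L² bounds of Zn, Zf
  have hL2n : ∑ b : HiggsLattice.PBond P 0, ‖Zn b‖ ^ 2 ≤ (P.mesh 0 ^ P.d)⁻¹ * (Kb ^ 2 * ((|C.e| * s) ^ 2 * W)) :=
    (sum_norm_sq_DGDt_le (C := C) (A := A) (B := B) ha hL1 hmsq hk hkK hreg hsmall hA gn).trans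
      (mul_le_mul_of_nonneg_left (mul_le_mul_of_nonneg_left hgn_le (sq_nonneg _)) (inv_nonneg.mpr hε.le))
  have hL2f : ∑ b : HiggsLattice.PBond P 0, ‖Zf b‖ ^ 2 ≤ (P.mesh 0 ^ P.d)⁻¹ * (Kb ^ 2 * ((|C.e| * s) ^ 2 * (Eθ ^ 2 * W))) :=
    (sum_norm_sq_DGDt_le (C := C) (A := A) (B := B) ha hL1 hmsq hk hkK hreg hsmall hA gf).trans
      (mul_le_mul_of_nonneg_left (mul_le_mul_of_nonneg_left hgf_le (sq_nonneg _)) (inv_nonneg.mpr hε.le))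
  set R₀ : ℝ := (P.mesh 0 ^ P.d)⁻¹ * (|C.e| * s) * W * Eθ with hR₀
  have hR₀0 : 0 ≤ R₀ := by rw [hR₀]; positivity
  -- PIECE A: far charges (Cauchy–Schwarz)
  have hA' : ∑ b : HiggsLattice.PBond P 0, κ b * ‖Zf b‖ ≤ Kb * R₀ := by
    refine (Real.sum_mul_le_sqrt_mul_sqrt (Finset.univ : Finset (HiggsLattice.PBond P 0)) κ (fun b => ‖Zf b‖)).trans ?_
    refine (mul_le_mul (Real.sqrt_le_sqrt hWrow0) (Real.sqrt_le_sqrt hL2f) (Real.sqrt_nonneg _) (Real.sqrt_nonneg _)).trans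
      (le_of_eq ?_)
    have hU : 0 ≤ (P.mesh 0 ^ P.d)⁻¹ * W := by positivity
    rw [← Real.sqrt_mul hU]
    have : (P.mesh 0 ^ P.d)⁻¹ * W * ((P.mesh 0 ^ P.d)⁻¹ * (Kb ^ 2 * ((|C.e| * s) ^ 2 * (Eθ ^ 2 * W)))) = (Kb * R₀) ^ 2 := by
      rw [hR₀]; ring
    rw [this, Real.sqrt_sq (mul_nonneg hKb0 hR₀0)]
  -- PIECE B: near charges, far row (Cauchy–Schwarz)
  have hB' : ∑ b : HiggsLattice.PBond P 0, κf b * ‖Zn b‖ ≤ Kb * R₀ := by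
    refine (Real.sum_mul_le_sqrt_mul_sqrt (Finset.univ : Finset (HiggsLattice.PBond P 0)) κf (fun b => ‖Zn b‖)).trans ?_
    refine (mul_le_mul (Real.sqrt_le_sqrt hWrowθ) (Real.sqrt_le_sqrt hL2n) (Real.sqrt_nonneg _) (Real.sqrt_nonneg _)).trans
      (le_of_eq ?_)
    have hU : 0 ≤ (P.mesh 0 ^ P.d)⁻¹ * Eθ ^ 2 * W := by positivity
    rw [← Real.sqrt_mul hU]
    have : (P.mesh 0 ^ P.d)⁻¹ * Eθ ^ 2 * W * ((P.mesh 0 ^ P.d)⁻¹ * (Kb ^ 2 * ((|C.e| * s) ^ 2 * W))) = (Kb * R₀) ^ 2 := by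
      rw [hR₀]; ring
    rw [this, Real.sqrt_sq (mul_nonneg hKb0 hR₀0)]
  -- PIECE C: near charges, near row (the pairing)
  have hC' : ∑ b : HiggsLattice.PBond P 0, κn b * ‖Zn b‖ ≤ Kt * Real.exp (2 * θ) * R₀ := by
    have hφ : ∀ b', gn b' ≠ 0 → 3 * HiggsLattice.Site.tdist b'.src x' ≤ ρ := by
      intro b' hb'
      by_contra hc; apply hb'; simp only [hgn, if_neg hc]
    have h := near_pairing_le h210B hmsq ha hk hkK hδ₁ hδ₁1 hCst hd3 i₀ hA hreg hsmall hθ0 hθγ x x' gn hφ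
    refine h.trans ?_
    have hs2 : Real.sqrt (bondInner gn gn) ≤ |C.e| * s * Real.sqrt W := by
      refine (Real.sqrt_le_sqrt hgn_le).trans (le_of_eq ?_)
      rw [Real.sqrt_mul (sq_nonneg _), Real.sqrt_sq hes]
    have hWW : Real.sqrt W * Real.sqrt W = W := Real.mul_self_sqrt hW0
    calc (P.mesh 0 ^ P.d)⁻¹ * (Kt * Real.exp (2 * θ) * Eθ) * Real.sqrt W * Real.sqrt (bondInner gn gn)
        ≤ (P.mesh 0 ^ P.d)⁻¹ * (Kt * Real.exp (2 * θ) * Eθ) * Real.sqrt W * (|C.e| * s * Real.sqrt W) :=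
          mul_le_mul_of_nonneg_left hs2 (by positivity)
      _ = (P.mesh 0 ^ P.d)⁻¹ * (Kt * Real.exp (2 * θ) * Eθ) * (|C.e| * s) * (Real.sqrt W * Real.sqrt W) := by ring
      _ = Kt * Real.exp (2 * θ) * R₀ := by rw [hWW, hR₀]; ring
  -- assemble
  have hsplit : ∀ b : HiggsLattice.PBond P 0, κ b * ‖covDeriv C B (G' (adjD C B g)) b‖
      ≤ κn b * ‖Zn b‖ + κf b * ‖Zn b‖ + κ b * ‖Zf b‖ := by
    intro b
    rw [hZ b]
    have hk' : κn b + κf b = κ b := by simp only [hκn, hκf]; split_ifs <;> simp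
    calc κ b * ‖Zn b + Zf b‖ ≤ κ b * (‖Zn b‖ + ‖Zf b‖) := mul_le_mul_of_nonneg_left (norm_add_le _ _) (hκ0 b)
      _ = κn b * ‖Zn b‖ + κf b * ‖Zn b‖ + κ b * ‖Zf b‖ := by rw [← hk']; ring
  have hfinal : ∑ b : HiggsLattice.PBond P 0, κ b * ‖covDeriv C B (G' (adjD C B g)) b‖
      ≤ Kt * Real.exp (2 * θ) * R₀ + Kb * R₀ + Kb * R₀ := by
    refine (Finset.sum_le_sum fun b _ => hsplit b).trans ?_
    rw [Finset.sum_add_distrib, Finset.sum_add_distrib]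
    exact add_le_add (add_le_add hC' hB') hA'
  refine hfinal.trans (le_of_eq ?_)
  rw [hR₀]
  ring

end NinthDecay

/-! ## §6 The remaining chain shapes (T1, T2) in the common currency; TERM I and TERM II with decay -/

section ChainsWeak2

variable {C : ChargeData N} {A B : HiggsLattice.VecField P 0} {msq a : ℝ} {k K₀ : ℕ} {hL1 : 1 < P.L} {δ₁ Cst : ℝ}

variable (hδ₁ : 0 < δ₁) (hδ₁1 : δ₁ ≤ 1) (hCst : 0 ≤ Cst)
  (h210B : (regRegionKernels hL1 C Finset.univ B msq a k K₀).Ineq210 δ₁ Cst)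
  (h210AB : (regRegionKernels hL1 C Finset.univ (A + B) msq a k K₀).Ineq210 δ₁ Cst)
  (hmsq : 0 < msq) (ha : 0 < a) (hk : 1 ≤ k) (hkK : k ≤ P.K) (i₀ : Ix N) (x x' : HiggsLattice.Site P 0)
  {p cR : ℝ} (hp : 0 < p) (hcR : 0 ≤ cR) (R : HiggsLattice.PBond P 0 → ℝ) (hR0 : ∀ b, 0 ≤ R b)
  (hR : ∀ b, R b ≤ ∑ j ∈ Finset.range (k + 1), cR * P.mesh j ^ (p - (P.d : ℝ)) *
      Real.exp (-(δ₁ / 2 * (P.mesh j)⁻¹ * (P.mesh 0 * (HiggsLattice.Site.tdist x b.src : ℝ)))))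
  {s : ℝ} (hA : ∀ b : HiggsLattice.PBond P 0, |A b| ≤ s)
include hδ₁ hδ₁1 hCst h210B h210AB hmsq ha hk hkK i₀ hp hcR hR0 hR hA

/-- **Shape T2 in the common currency** — outer row ∘ `κ^D_{B,A+B}(b,b′₊)` ∘ `κ_B(b′₊,x′)` with the split `D_B = D_{A+B} − M`:
`≤ [(p,1,2)] + |e|s·[(p,2,2)]`, `p + 3 > d`. [cite: Balaban1983Higgs3, (1.16) p.414, (2.10) p.426] [cite: Balaban1982Higgs1, (3.14) p.614] -/
theorem chainT2w_le (hsum : (P.d : ℝ) < p + 1 + 2) :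
    ∑ b : HiggsLattice.PBond P 0, ∑ b' : HiggsLattice.PBond P 0,
        R b * dcol C msq a k B (A + B) b b'.tgt * col C msq a k B b'.tgt x'
      ≤ chainConst P N (δ₁ / 2) p 1 2 *
            (cR * (Real.exp 1 * (P.mesh 0 ^ P.d * Cst)) * (Real.exp 1 * (P.mesh 0 ^ P.d * Cst))) *
            P.mesh (k + 1) ^ (p + 1 + 2 - (P.d : ℝ)) *
            Real.exp (-(δ₁ / 2 / 4 * (P.mesh (k + 1))⁻¹ * (P.mesh 0 * (HiggsLattice.Site.tdist x x' : ℝ))))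
        + |C.e| * s * (chainConst P N (δ₁ / 2) p 2 2 *
            (cR * (Real.exp 1 * (Real.exp 1 * (P.mesh 0 ^ P.d * Cst))) * (Real.exp 1 * (P.mesh 0 ^ P.d * Cst))) *
            P.mesh (k + 1) ^ (p + 2 + 2 - (P.d : ℝ)) *
            Real.exp (-(δ₁ / 2 / 4 * (P.mesh (k + 1))⁻¹ * (P.mesh 0 * (HiggsLattice.Site.tdist x x' : ℝ))))) := by
  have hc : 0 ≤ P.mesh 0 ^ P.d * Cst := mul_nonneg (pow_nonneg (P.mesh_pos 0).le _) hCst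
  have hc1 : 0 ≤ Real.exp 1 * (P.mesh 0 ^ P.d * Cst) := mul_nonneg (Real.exp_nonneg _) hc
  have hes : 0 ≤ |C.e| * s := mul_nonneg (abs_nonneg _) ((abs_nonneg _).trans (hA ⟨x, ⟨0, P.hd⟩⟩))
  refine (sum2_split_le R (fun b' => col C msq a k B b'.tgt x') _ (fun b b' => dcol C msq a k (A + B) (A + B) b b'.tgt)
    (fun b b' => col C msq a k (A + B) b.tgt b'.tgt) (|C.e| * s) hR0 (fun b' => col_nonneg _ _ _)
    (fun b b' => dcol_le_add_split A B (hA b) b'.tgt)).trans ?_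
  refine add_le_add ?_ (mul_le_mul_of_nonneg_left (chainT5w_le hδ₁ hδ₁1 hCst h210B h210AB hmsq ha hk hkK i₀ x x' hp hcR R
    hR0 hR (by linarith)) hes)
  refine bond_chain3_le' (k := k + 1) hL1 (half_pos hδ₁) (by linarith) hp (by norm_num) (by norm_num) hsum hcR hc1 hc1
    i₀ x x' _ _ _ hR0 (fun b b' => dcol_nonneg _ _ _ _) (fun b' => col_nonneg _ _ _) hR (fun b b' => ?_) (fun b' => ?_)
  · exact ((dcol_le h210AB hmsq ha hk hkK b b'.tgt).trans (majorant_shift_le hδ₁ hδ₁1 hc _ b'.src b'.dir)).trans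
      (weaken hc1 hδ₁.le _ _)
  · exact ((col_le h210B hmsq ha hk hkK b'.tgt x').trans (majorant_shift_le' hδ₁ hδ₁1 hc b'.src x' b'.dir)).trans
      (weaken hc1 hδ₁.le _ _)

/-- **Shape T1 in the common currency** — outer row ∘ `κ^D_{B,A+B}(b,b′₊)` ∘ `κ^D_{B,B}(b′,x′)`: `≤ [(p,1,1)] + |e|s·[(p,2,1)]`,
`p + 2 > d`. [cite: Balaban1983Higgs3, (1.16) p.414, (2.10) p.426] [cite: Balaban1982Higgs1, (3.14) p.614] -/
theorem chainT1w_le (hsum : (P.d : ℝ) < p + 1 + 1) :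
    ∑ b : HiggsLattice.PBond P 0, ∑ b' : HiggsLattice.PBond P 0,
        R b * dcol C msq a k B (A + B) b b'.tgt * dcol C msq a k B B b' x'
      ≤ chainConst P N (δ₁ / 2) p 1 1 *
            (cR * (Real.exp 1 * (P.mesh 0 ^ P.d * Cst)) * (P.mesh 0 ^ P.d * Cst)) *
            P.mesh (k + 1) ^ (p + 1 + 1 - (P.d : ℝ)) *
            Real.exp (-(δ₁ / 2 / 4 * (P.mesh (k + 1))⁻¹ * (P.mesh 0 * (HiggsLattice.Site.tdist x x' : ℝ))))
        + |C.e| * s * (chainConst P N (δ₁ / 2) p 2 1 *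
            (cR * (Real.exp 1 * (Real.exp 1 * (P.mesh 0 ^ P.d * Cst))) * (P.mesh 0 ^ P.d * Cst)) *
            P.mesh (k + 1) ^ (p + 2 + 1 - (P.d : ℝ)) *
            Real.exp (-(δ₁ / 2 / 4 * (P.mesh (k + 1))⁻¹ * (P.mesh 0 * (HiggsLattice.Site.tdist x x' : ℝ))))) := by
  have hc : 0 ≤ P.mesh 0 ^ P.d * Cst := mul_nonneg (pow_nonneg (P.mesh_pos 0).le _) hCst
  have hc1 : 0 ≤ Real.exp 1 * (P.mesh 0 ^ P.d * Cst) := mul_nonneg (Real.exp_nonneg _) hc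
  have hes : 0 ≤ |C.e| * s := mul_nonneg (abs_nonneg _) ((abs_nonneg _).trans (hA ⟨x, ⟨0, P.hd⟩⟩))
  refine (sum2_split_le R (fun b' => dcol C msq a k B B b' x') _ (fun b b' => dcol C msq a k (A + B) (A + B) b b'.tgt)
    (fun b b' => col C msq a k (A + B) b.tgt b'.tgt) (|C.e| * s) hR0 (fun b' => dcol_nonneg _ _ _ _)
    (fun b b' => dcol_le_add_split A B (hA b) b'.tgt)).trans ?_
  refine add_le_add ?_ (mul_le_mul_of_nonneg_left (chainT3w_le hδ₁ hδ₁1 hCst h210B h210AB hmsq ha hk hkK i₀ x x' hp hcR R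
    hR0 hR (by linarith)) hes)
  refine bond_chain3_le' (k := k + 1) hL1 (half_pos hδ₁) (by linarith) hp (by norm_num) (by norm_num) hsum hcR hc1 hc
    i₀ x x' _ _ _ hR0 (fun b b' => dcol_nonneg _ _ _ _) (fun b' => dcol_nonneg _ _ _ _) hR (fun b b' => ?_) (fun b' => ?_)
  · exact ((dcol_le h210AB hmsq ha hk hkK b b'.tgt).trans (majorant_shift_le hδ₁ hδ₁1 hc _ b'.src b'.dir)).trans
      (weaken hc1 hδ₁.le _ _)
  · exact dcol_le_weak h210B hmsq ha hk hkK hδ₁.le hCst b' x'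

end ChainsWeak2

section TermsDecay

/-- the three-kernel chain bound in the common currency: `chainConst(δ₁/2)·K·(L^{k+1}ε)^{p+a₂+a₃−d}·e^{−(δ₁/8)(L^{k+1}ε)^{−1}ε|x−x′|}`
(`bond_chain3_le'` at `k+1` scales, rate `δ₁/2`). [cite: Balaban1983Higgs3, (2.10) p.426] -/
def chainW (P : HiggsLattice.Params) (N : ℕ) (δ₁ p a₂ a₃ K : ℝ) (k : ℕ) (x x' : HiggsLattice.Site P 0) : ℝ :=
  chainConst P N (δ₁ / 2) p a₂ a₃ * K * P.mesh (k + 1) ^ (p + a₂ + a₃ - (P.d : ℝ)) *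
    Real.exp (-(δ₁ / 2 / 4 * (P.mesh (k + 1))⁻¹ * (P.mesh 0 * (HiggsLattice.Site.tdist x x' : ℝ))))

/-- the block constant `K_b = e^{δ₁/2}N(8d/δ₁)^d/(L²−1)` of `block_avg_col_le`. [cite: Balaban1983Higgs3, (2.10) p.426] -/
def Kblk (P : HiggsLattice.Params) (N : ℕ) (δ₁ : ℝ) : ℝ :=
  Real.exp (δ₁ / 2) * ((nCol N : ℝ) * (4 * P.d / (δ₁ / 2)) ^ P.d) / ((P.L : ℝ) ^ (2 : ℝ) - 1)

variable {C : ChargeData N} {A B : HiggsLattice.VecField P 0} {msq a : ℝ} {k K₀ : ℕ} {hL1 : 1 < P.L} {δ₁ Cst : ℝ}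

/-- `K_b ≥ 0` (`L > 1`, `δ₁ > 0`). [cite: Balaban1983Higgs3, (2.10) p.426] -/
theorem Kblk_nonneg (hL1 : 1 < P.L) (hδ₁ : 0 < δ₁) (N : ℕ) : 0 ≤ Kblk P N δ₁ := by
  have hL1' : (1 : ℝ) < (P.L : ℝ) := by exact_mod_cast hL1
  have h1 : 0 < (P.L : ℝ) ^ (2 : ℝ) - 1 := by
    have : (1 : ℝ) < (P.L : ℝ) ^ (2 : ℝ) := Real.one_lt_rpow hL1' (by norm_num)
    linarith
  have h2 : 0 ≤ (4 * (P.d : ℝ) / (δ₁ / 2)) ^ P.d := pow_nonneg (by positivity) _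
  unfold Kblk; positivity

variable (hδ₁ : 0 < δ₁) (hδ₁1 : δ₁ ≤ 1) (hCst : 0 ≤ Cst)
  (h210B : (regRegionKernels hL1 C Finset.univ B msq a k K₀).Ineq210 δ₁ Cst)
  (h210AB : (regRegionKernels hL1 C Finset.univ (A + B) msq a k K₀).Ineq210 δ₁ Cst)
  (hmsq : 0 < msq) (ha : 0 < a) (hk : 1 ≤ k) (hkK : k ≤ P.K) (hd3 : P.d ≤ 3) (i₀ : Ix N)
  {s : ℝ} (hs : 0 ≤ s) (hA : ∀ b : HiggsLattice.PBond P 0, |A b| ≤ s)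
  (x x' : HiggsLattice.Site P 0) (i' : Ix N)
include hδ₁ hδ₁1 hCst h210B h210AB hmsq ha hk hkK hd3 i₀ hs hA

omit hd3 in
/-- **TERM II WITH DECAY — an outer row `R` of the common currency (exponent `p > 0`, `p + 3 > d`) against `‖w₁(b₊)‖`**:
`Σ_bR(b)‖w₁(b₊)‖ ≤ |e|s·T3 + |e|s·T4 + (|e|s)²·T5 + a(L^kε)^{−2}·m(2+m)·AV`, every term a chain of the common currency carrying
`e^{−(δ₁/8)(L^{k+1}ε)^{−1}ε|x−x′|}` (`value_chains_eq`, `chainT3w/T4w/T5w_le`, `avg_value_row_le`). [cite: Balaban1983Higgs3, (1.16) p.414, (2.5) p.424] -/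
theorem termII_decay_le {p cR : ℝ} (hp : 0 < p) (hpd : (P.d : ℝ) < p + 2 + 1) (hcR : 0 ≤ cR)
    (R : HiggsLattice.PBond P 0 → ℝ) (hR0 : ∀ b, 0 ≤ R b)
    (hR : ∀ b, R b ≤ ∑ j ∈ Finset.range (k + 1), cR * P.mesh j ^ (p - (P.d : ℝ)) *
      Real.exp (-(δ₁ / 2 * (P.mesh j)⁻¹ * (P.mesh 0 * (HiggsLattice.Site.tdist x b.src : ℝ))))) :
    ∑ b : HiggsLattice.PBond P 0, R b *
        ‖propagatorK C Finset.univ (A + B) msq a k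
          (B3Op116SourceForm.srcV C A B k Finset.univ a (propagatorK C Finset.univ B msq a k (cb P N 0 (x', i')))) b.tgt‖
      ≤ |C.e| * s * chainW P N δ₁ p 2 1 (cR * (Real.exp 1 * (Real.exp 1 * (P.mesh 0 ^ P.d * Cst))) * (P.mesh 0 ^ P.d * Cst)) k x x'
        + |C.e| * s * (chainW P N δ₁ p 1 2 (cR * (Real.exp 1 * (P.mesh 0 ^ P.d * Cst)) * (Real.exp 1 * (P.mesh 0 ^ P.d * Cst))) k x x'
            + |C.e| * s * chainW P N δ₁ p 2 2
                (cR * (Real.exp 1 * (Real.exp 1 * (P.mesh 0 ^ P.d * Cst))) * (Real.exp 1 * (P.mesh 0 ^ P.d * Cst))) k x x')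
        + (|C.e| * s) ^ 2 * chainW P N δ₁ p 2 2
            (cR * (Real.exp 1 * (Real.exp 1 * (P.mesh 0 ^ P.d * Cst))) * (Real.exp 1 * (P.mesh 0 ^ P.d * Cst))) k x x'
        + a * (P.mesh k)⁻¹ ^ 2 * (mK P C s k * (2 + mK P C s k) * chainW P N δ₁ p 2 2
            (cR * (Real.exp 1 * (P.mesh 0 ^ P.d * Cst)) * (Kblk P N δ₁ * (P.mesh 0 ^ P.d * Cst))) k x x') := by
  have hL1' : (1 : ℝ) < (P.L : ℝ) := by exact_mod_cast hL1
  have hes : 0 ≤ |C.e| * s := mul_nonneg (abs_nonneg _) hs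
  -- pointwise inner value row, multiplied by R b ≥ 0 and summed
  have step1 := Finset.sum_le_sum fun b (_ : b ∈ (Finset.univ : Finset (HiggsLattice.PBond P 0))) =>
    (mul_le_mul_of_nonneg_left (inner_value_row_le C A B msq a k hA hs x' b.tgt i') (hR0 b)).trans_eq (mul_add _ _ _)
  refine step1.trans ?_
  rw [Finset.sum_add_distrib, value_chains_eq C A B msq a k s R x']
  have hT3 := chainT3w_le hδ₁ hδ₁1 hCst h210B h210AB hmsq ha hk hkK i₀ x x' hp hcR R hR0 hR hpd
  have hT4 := chainT4w_le hδ₁ hδ₁1 hCst h210B h210AB hmsq ha hk hkK i₀ x x' hp hcR R hR0 hR hA (by linarith)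
  have hT5 := chainT5w_le hδ₁ hδ₁1 hCst h210B h210AB hmsq ha hk hkK i₀ x x' hp hcR R hR0 hR (by linarith)
  -- the averaging term with decay
  have hca : |B1.aSeq a P.L k| * (P.mesh k)⁻¹ ^ 2 ≤ a * (P.mesh k)⁻¹ ^ 2 := by
    rw [abs_of_pos (B1.aSeq_pos ha hL1' hk)]
    exact mul_le_mul_of_nonneg_right (B1.aSeq_le ha hL1' k hk) (by positivity)
  have hAV := avg_value_row_le hδ₁ hδ₁1 hCst h210B h210AB hmsq ha hk hkK i₀ x x' hp hcR R hR0 hR hs hA i' (by linarith)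
  have hmm : 0 ≤ mK P C s k * (2 + mK P C s k) := by have := mK_nonneg (P := P) C hs k; positivity
  have havg : ∑ b : HiggsLattice.PBond P 0, R b * (|B1.aSeq a P.L k| * (P.mesh k)⁻¹ ^ 2 *
      ‖propagatorK C Finset.univ (A + B) msq a k
        (B3Op116SourceForm.avgSrc C A B k (propagatorK C Finset.univ B msq a k (cb P N 0 (x', i')))) b.tgt‖)
      ≤ a * (P.mesh k)⁻¹ ^ 2 * (mK P C s k * (2 + mK P C s k) * chainW P N δ₁ p 2 2
            (cR * (Real.exp 1 * (P.mesh 0 ^ P.d * Cst)) * (Kblk P N δ₁ * (P.mesh 0 ^ P.d * Cst))) k x x') := by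
    have e : ∑ b : HiggsLattice.PBond P 0, R b * (|B1.aSeq a P.L k| * (P.mesh k)⁻¹ ^ 2 *
        ‖propagatorK C Finset.univ (A + B) msq a k
          (B3Op116SourceForm.avgSrc C A B k (propagatorK C Finset.univ B msq a k (cb P N 0 (x', i')))) b.tgt‖)
        = |B1.aSeq a P.L k| * (P.mesh k)⁻¹ ^ 2 * ∑ b : HiggsLattice.PBond P 0, R b *
            ‖propagatorK C Finset.univ (A + B) msq a k
              (B3Op116SourceForm.avgSrc C A B k (propagatorK C Finset.univ B msq a k (cb P N 0 (x', i')))) b.tgt‖ := by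
      rw [Finset.mul_sum]; exact Finset.sum_congr rfl fun b _ => by ring
    rw [e]
    have h0 : 0 ≤ mK P C s k * (2 + mK P C s k) * chainW P N δ₁ p 2 2
        (cR * (Real.exp 1 * (P.mesh 0 ^ P.d * Cst)) * (Kblk P N δ₁ * (P.mesh 0 ^ P.d * Cst))) k x x' :=
      le_trans (Finset.sum_nonneg fun b _ => mul_nonneg (hR0 b) (norm_nonneg _)) hAV
    exact mul_le_mul hca hAV (Finset.sum_nonneg fun b _ => mul_nonneg (hR0 b) (norm_nonneg _)) (by positivity)
  unfold chainW
  unfold chainW at havg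
  refine add_le_add (add_le_add (add_le_add (mul_le_mul_of_nonneg_left hT3 hes) ?_)
    (mul_le_mul_of_nonneg_left hT5 (sq_nonneg _))) havg
  exact mul_le_mul_of_nonneg_left hT4 hes

/-- **TERM I WITH DECAY — the outer `MD` source `Σ_bκ_B(x,b₊)‖(D^ε_Bw₁)(b)‖`**:
`≤ |e|s·T1 + (|e|s)²·T2 + NINTH(θ) + a(L^kε)^{−2}m(2+m)·AD`, the chains in the common currency, the ninth term by `ninth_term_decay_le`
(`deriv_chains_eq`, `chainT1w/T2w_le`, `avg_deriv_row_le`). [cite: Balaban1983Higgs3, (1.16) p.414, (2.5) p.424] -/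
theorem termI_decay_le {δX : ℝ} (hreg : ∀ (z : HiggsLattice.Site P 0) (μ ν : Fin P.d), |(A + B) ⟨z.shift ν, μ⟩ - (A + B) ⟨z, μ⟩| ≤ δX)
    (hsmall : (P.d : ℝ) ^ 2 * (P.mesh 0 * |C.e|) * ((P.L : ℝ) ^ k) ^ 2 * δX ≤ 1 / 3)
    {θ : ℝ} (hθ0 : 0 ≤ θ) (hθ1 : θ ≤ δ₁ / 4) (hθγ : (4 * P.d + 4 * a) * θ ≤ min 2 (a * (1 - ((P.L : ℝ) ^ 2)⁻¹) / 4)) :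
    ∑ b : HiggsLattice.PBond P 0, col C msq a k B x b.tgt *
        ‖covDeriv C B (propagatorK C Finset.univ (A + B) msq a k
          (B3Op116SourceForm.srcV C A B k Finset.univ a (propagatorK C Finset.univ B msq a k (cb P N 0 (x', i'))))) b‖
      ≤ |C.e| * s * (chainW P N δ₁ 2 1 1 ((Real.exp 1 * (P.mesh 0 ^ P.d * Cst)) * (Real.exp 1 * (P.mesh 0 ^ P.d * Cst)) *
              (P.mesh 0 ^ P.d * Cst)) k x x'
            + |C.e| * s * chainW P N δ₁ 2 2 1 ((Real.exp 1 * (P.mesh 0 ^ P.d * Cst)) *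
              (Real.exp 1 * (Real.exp 1 * (P.mesh 0 ^ P.d * Cst))) * (P.mesh 0 ^ P.d * Cst)) k x x')
        + (|C.e| * s) ^ 2 * (chainW P N δ₁ 2 1 2 ((Real.exp 1 * (P.mesh 0 ^ P.d * Cst)) *
              (Real.exp 1 * (P.mesh 0 ^ P.d * Cst)) * (Real.exp 1 * (P.mesh 0 ^ P.d * Cst))) k x x'
            + |C.e| * s * chainW P N δ₁ 2 2 2 ((Real.exp 1 * (P.mesh 0 ^ P.d * Cst)) *
              (Real.exp 1 * (Real.exp 1 * (P.mesh 0 ^ P.d * Cst))) * (Real.exp 1 * (P.mesh 0 ^ P.d * Cst))) k x x')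
        + (P.mesh 0 ^ P.d)⁻¹ * (|C.e| * s) * Wsq P N δ₁ Cst k *
            (2 * Kbad P C a s k + Kth P C a s k θ * Real.exp (2 * θ)) *
            Real.exp (-(θ / (P.L : ℝ) ^ k * ((HiggsLattice.Site.tdist x x' : ℝ) / 3)))
        + a * (P.mesh k)⁻¹ ^ 2 * (mK P C s k * (2 + mK P C s k) *
            (chainW P N δ₁ 2 1 2 ((Real.exp 1 * (P.mesh 0 ^ P.d * Cst)) * (P.mesh 0 ^ P.d * Cst) *
                (Kblk P N δ₁ * (P.mesh 0 ^ P.d * Cst))) k x x'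
              + |C.e| * s * chainW P N δ₁ 2 2 2 ((Real.exp 1 * (P.mesh 0 ^ P.d * Cst)) *
                (Real.exp 1 * (P.mesh 0 ^ P.d * Cst)) * (Kblk P N δ₁ * (P.mesh 0 ^ P.d * Cst))) k x x')) := by
  have hL1' : (1 : ℝ) < (P.L : ℝ) := by exact_mod_cast hL1
  have hes : 0 ≤ |C.e| * s := mul_nonneg (abs_nonneg _) hs
  have hd3' : (P.d : ℝ) ≤ 3 := by exact_mod_cast hd3
  have hc : 0 ≤ P.mesh 0 ^ P.d * Cst := mul_nonneg (pow_nonneg (P.mesh_pos 0).le _) hCst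
  have hc1 : 0 ≤ Real.exp 1 * (P.mesh 0 ^ P.d * Cst) := mul_nonneg (Real.exp_nonneg _) hc
  set R : HiggsLattice.PBond P 0 → ℝ := fun b => col C msq a k B x b.tgt with hRdef
  have hR0 : ∀ b, 0 ≤ R b := fun b => col_nonneg (C := C) (msq := msq) (a := a) (k := k) B x b.tgt
  have hR : ∀ b, R b ≤ ∑ j ∈ Finset.range (k + 1), (Real.exp 1 * (P.mesh 0 ^ P.d * Cst)) * P.mesh j ^ ((2 : ℝ) - (P.d : ℝ)) *
      Real.exp (-(δ₁ / 2 * (P.mesh j)⁻¹ * (P.mesh 0 * (HiggsLattice.Site.tdist x b.src : ℝ)))) :=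
    fun b => (row_col_majorant h210B hmsq ha hk hkK hδ₁ hδ₁1 hCst x b).trans (weaken hc1 hδ₁.le _ _)
  -- pointwise inner derivative row, times R b, summed and split
  have step1 := Finset.sum_le_sum fun b (_ : b ∈ (Finset.univ : Finset (HiggsLattice.PBond P 0))) =>
    (mul_le_mul_of_nonneg_left (inner_deriv_row_le C A B msq a k hA hs x' b i') (hR0 b)).trans_eq
      (by rw [mul_add, mul_add])
  refine step1.trans ?_
  rw [Finset.sum_add_distrib, Finset.sum_add_distrib, deriv_chains_eq C A B msq a k s R x']
  have hT1 := chainT1w_le hδ₁ hδ₁1 hCst h210B h210AB hmsq ha hk hkK i₀ x x' (by norm_num : (0 : ℝ) < 2) hc1 R hR0 hR hA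
    (by linarith)
  have hT2 := chainT2w_le hδ₁ hδ₁1 hCst h210B h210AB hmsq ha hk hkK i₀ x x' (by norm_num : (0 : ℝ) < 2) hc1 R hR0 hR hA
    (by linarith)
  have h9 := ninth_term_decay_le (A := A) h210B hmsq ha hk hkK hδ₁ hδ₁1 hCst hd3 i₀ hs hA hreg hsmall hθ0 hθ1 hθγ x x' i'
  -- the averaging term with decay
  have hca : |B1.aSeq a P.L k| * (P.mesh k)⁻¹ ^ 2 ≤ a * (P.mesh k)⁻¹ ^ 2 := by
    rw [abs_of_pos (B1.aSeq_pos ha hL1' hk)]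
    exact mul_le_mul_of_nonneg_right (B1.aSeq_le ha hL1' k hk) (by positivity)
  have hAD := avg_deriv_row_le hδ₁ hδ₁1 hCst h210B h210AB hmsq ha hk hkK i₀ x x' (by norm_num : (0 : ℝ) < 2) hc1 R hR0 hR
    hs hA i' (by linarith)
  have hmm : 0 ≤ mK P C s k * (2 + mK P C s k) := by have := mK_nonneg (P := P) C hs k; positivity
  have havg : ∑ b : HiggsLattice.PBond P 0, R b * (|B1.aSeq a P.L k| * (P.mesh k)⁻¹ ^ 2 *
      ‖covDeriv C B (propagatorK C Finset.univ (A + B) msq a k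
        (B3Op116SourceForm.avgSrc C A B k (propagatorK C Finset.univ B msq a k (cb P N 0 (x', i'))))) b‖)
      ≤ a * (P.mesh k)⁻¹ ^ 2 * (mK P C s k * (2 + mK P C s k) *
            (chainW P N δ₁ 2 1 2 ((Real.exp 1 * (P.mesh 0 ^ P.d * Cst)) * (P.mesh 0 ^ P.d * Cst) *
                (Kblk P N δ₁ * (P.mesh 0 ^ P.d * Cst))) k x x'
              + |C.e| * s * chainW P N δ₁ 2 2 2 ((Real.exp 1 * (P.mesh 0 ^ P.d * Cst)) *
                (Real.exp 1 * (P.mesh 0 ^ P.d * Cst)) * (Kblk P N δ₁ * (P.mesh 0 ^ P.d * Cst))) k x x')) := by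
    have e : ∑ b : HiggsLattice.PBond P 0, R b * (|B1.aSeq a P.L k| * (P.mesh k)⁻¹ ^ 2 *
        ‖covDeriv C B (propagatorK C Finset.univ (A + B) msq a k
          (B3Op116SourceForm.avgSrc C A B k (propagatorK C Finset.univ B msq a k (cb P N 0 (x', i'))))) b‖)
        = |B1.aSeq a P.L k| * (P.mesh k)⁻¹ ^ 2 * ∑ b : HiggsLattice.PBond P 0, R b *
            ‖covDeriv C B (propagatorK C Finset.univ (A + B) msq a k
              (B3Op116SourceForm.avgSrc C A B k (propagatorK C Finset.univ B msq a k (cb P N 0 (x', i'))))) b‖ := by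
      rw [Finset.mul_sum]; exact Finset.sum_congr rfl fun b _ => by ring
    rw [e]
    unfold chainW
    have h0 := le_trans (Finset.sum_nonneg fun b (_ : b ∈ (Finset.univ : Finset (HiggsLattice.PBond P 0))) =>
      mul_nonneg (hR0 b) (norm_nonneg _)) hAD
    exact mul_le_mul hca hAD (Finset.sum_nonneg fun b _ => mul_nonneg (hR0 b) (norm_nonneg _)) (by positivity)
  unfold chainW
  unfold chainW at havg
  exact add_le_add (add_le_add (add_le_add (mul_le_mul_of_nonneg_left hT1 hes) (mul_le_mul_of_nonneg_left hT2 (sq_nonneg _))) h9)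
    havg

end TermsDecay

/-! ## §7 TERM IV with decay (the outer averaging source) and the assembled DECAYING bound of the kernel of (1.16) -/

section Assembly

/-- TERM II's decaying bound as a named quantity (outer row of exponent `p`, constant `cR`). [cite: Balaban1983Higgs3, (1.16) p.414] -/
def termIId (P : HiggsLattice.Params) (N : ℕ) (C : ChargeData N) (a δ₁ Cst s : ℝ) (k : ℕ) (p cR : ℝ)
    (x x' : HiggsLattice.Site P 0) : ℝ :=
  |C.e| * s * chainW P N δ₁ p 2 1 (cR * (Real.exp 1 * (Real.exp 1 * (P.mesh 0 ^ P.d * Cst))) * (P.mesh 0 ^ P.d * Cst)) k x x'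
    + |C.e| * s * (chainW P N δ₁ p 1 2 (cR * (Real.exp 1 * (P.mesh 0 ^ P.d * Cst)) * (Real.exp 1 * (P.mesh 0 ^ P.d * Cst))) k x x'
        + |C.e| * s * chainW P N δ₁ p 2 2
            (cR * (Real.exp 1 * (Real.exp 1 * (P.mesh 0 ^ P.d * Cst))) * (Real.exp 1 * (P.mesh 0 ^ P.d * Cst))) k x x')
    + (|C.e| * s) ^ 2 * chainW P N δ₁ p 2 2
        (cR * (Real.exp 1 * (Real.exp 1 * (P.mesh 0 ^ P.d * Cst))) * (Real.exp 1 * (P.mesh 0 ^ P.d * Cst))) k x x'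
    + a * (P.mesh k)⁻¹ ^ 2 * (mK P C s k * (2 + mK P C s k) * chainW P N δ₁ p 2 2
        (cR * (Real.exp 1 * (P.mesh 0 ^ P.d * Cst)) * (Kblk P N δ₁ * (P.mesh 0 ^ P.d * Cst))) k x x')

/-- TERM I's decaying bound as a named quantity (ninth term at rate `θ`). [cite: Balaban1983Higgs3, (1.16) p.414] -/
def termId (P : HiggsLattice.Params) (N : ℕ) (C : ChargeData N) (a δ₁ Cst s : ℝ) (k : ℕ) (θ : ℝ)
    (x x' : HiggsLattice.Site P 0) : ℝ :=
  |C.e| * s * (chainW P N δ₁ 2 1 1 ((Real.exp 1 * (P.mesh 0 ^ P.d * Cst)) * (Real.exp 1 * (P.mesh 0 ^ P.d * Cst)) *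
          (P.mesh 0 ^ P.d * Cst)) k x x'
        + |C.e| * s * chainW P N δ₁ 2 2 1 ((Real.exp 1 * (P.mesh 0 ^ P.d * Cst)) *
          (Real.exp 1 * (Real.exp 1 * (P.mesh 0 ^ P.d * Cst))) * (P.mesh 0 ^ P.d * Cst)) k x x')
    + (|C.e| * s) ^ 2 * (chainW P N δ₁ 2 1 2 ((Real.exp 1 * (P.mesh 0 ^ P.d * Cst)) *
          (Real.exp 1 * (P.mesh 0 ^ P.d * Cst)) * (Real.exp 1 * (P.mesh 0 ^ P.d * Cst))) k x x'
        + |C.e| * s * chainW P N δ₁ 2 2 2 ((Real.exp 1 * (P.mesh 0 ^ P.d * Cst)) *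
          (Real.exp 1 * (Real.exp 1 * (P.mesh 0 ^ P.d * Cst))) * (Real.exp 1 * (P.mesh 0 ^ P.d * Cst))) k x x')
    + (P.mesh 0 ^ P.d)⁻¹ * (|C.e| * s) * Wsq P N δ₁ Cst k *
        (2 * Kbad P C a s k + Kth P C a s k θ * Real.exp (2 * θ)) *
        Real.exp (-(θ / (P.L : ℝ) ^ k * ((HiggsLattice.Site.tdist x x' : ℝ) / 3)))
    + a * (P.mesh k)⁻¹ ^ 2 * (mK P C s k * (2 + mK P C s k) *
        (chainW P N δ₁ 2 1 2 ((Real.exp 1 * (P.mesh 0 ^ P.d * Cst)) * (P.mesh 0 ^ P.d * Cst) *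
            (Kblk P N δ₁ * (P.mesh 0 ^ P.d * Cst))) k x x'
          + |C.e| * s * chainW P N δ₁ 2 2 2 ((Real.exp 1 * (P.mesh 0 ^ P.d * Cst)) *
            (Real.exp 1 * (P.mesh 0 ^ P.d * Cst)) * (Kblk P N δ₁ * (P.mesh 0 ^ P.d * Cst))) k x x'))

variable {C : ChargeData N} {A B : HiggsLattice.VecField P 0} {msq a : ℝ} {k K₀ : ℕ} {hL1 : 1 < P.L} {δ₁ Cst : ℝ}

/-- A site sum of a nonnegative function is below the bond sum read at the heads (`Σ_bF(b₊) = d·Σ_yF(y)`, `d ≥ 1`).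
[cite: Balaban1982Higgs1, (1.4) p.604] -/
theorem sum_site_le_sum_bond_tgt (f : HiggsLattice.Site P 0 → ℝ) (hf : ∀ y, 0 ≤ f y) :
    ∑ y : HiggsLattice.Site P 0, f y ≤ ∑ b : HiggsLattice.PBond P 0, f b.tgt := by
  rw [sum_bond_tgt_eq f]
  have h1 : (1 : ℝ) ≤ (P.d : ℝ) := by exact_mod_cast P.hd
  have h0 : 0 ≤ ∑ y : HiggsLattice.Site P 0, f y := Finset.sum_nonneg fun y _ => hf y
  nlinarith

variable (hδ₁ : 0 < δ₁) (hδ₁1 : δ₁ ≤ 1) (hCst : 0 ≤ Cst)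
  (h210B : (regRegionKernels hL1 C Finset.univ B msq a k K₀).Ineq210 δ₁ Cst)
  (h210AB : (regRegionKernels hL1 C Finset.univ (A + B) msq a k K₀).Ineq210 δ₁ Cst)
  (hmsq : 0 < msq) (ha : 0 < a) (hk : 1 ≤ k) (hkK : k ≤ P.K) (hd3 : P.d ≤ 3) (i₀ : Ix N)
  {s : ℝ} (hs : 0 ≤ s) (hA : ∀ b : HiggsLattice.PBond P 0, |A b| ≤ s)
  (x x' : HiggsLattice.Site P 0) (i' : Ix N)
include hδ₁ hδ₁1 hCst h210B h210AB hmsq ha hk hkK hd3 i₀ hs hA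

/-- **TERM IV WITH DECAY — the outer averaging source**: `‖(G_k(T,B)avgSrc w₁)(x)‖ ≤ m(2+m)·TERM II(R̃)`, where after the block-sum
exchange (`sum_mul_sum_blockK_comm`) the smeared row `R̃(u) = L^{−kd}Σ_{y∈B^k(ū)}κ_B(x,y)` is a top bump of the common currency
(`block_row_majorant`, exponent `2`, constant `e·K_b·ε^dC`) and TERM II applies to it (`termII_decay_le`).
[cite: Balaban1982Higgs1, (3.15)–(3.16) pp.614–615] [cite: Balaban1983Higgs3, (1.16) p.414, (2.5) p.424] -/
theorem termIV_decay_le :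
    ‖propagatorK C Finset.univ B msq a k (B3Op116SourceForm.avgSrc C A B k
        (propagatorK C Finset.univ (A + B) msq a k
          (B3Op116SourceForm.srcV C A B k Finset.univ a (propagatorK C Finset.univ B msq a k (cb P N 0 (x', i')))))) x‖
      ≤ mK P C s k * (2 + mK P C s k) *
          termIId P N C a δ₁ Cst s k 2 (Real.exp 1 * (Kblk P N δ₁ * (P.mesh 0 ^ P.d * Cst))) x x' := by
  have hL1' : (1 : ℝ) < (P.L : ℝ) := by exact_mod_cast hL1
  have hes : 0 ≤ |C.e| * s := mul_nonneg (abs_nonneg _) hs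
  have hc : 0 ≤ P.mesh 0 ^ P.d * Cst := mul_nonneg (pow_nonneg (P.mesh_pos 0).le _) hCst
  set w₁ := propagatorK C Finset.univ (A + B) msq a k
    (B3Op116SourceForm.srcV C A B k Finset.univ a (propagatorK C Finset.univ B msq a k (cb P N 0 (x', i')))) with hw₁
  set G : ScalarField P 0 N →ₗ[ℝ] ScalarField P 0 N := propagatorK C Finset.univ B msq a k with hG
  have hmm : 0 ≤ mK P C s k * (2 + mK P C s k) := by have := mK_nonneg (P := P) C hs k; positivity
  set Linv : ℝ := ((P.L : ℝ) ^ (k * P.d))⁻¹ with hLinv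
  set T : ScalarField P 0 N →ₗ[ℝ] E N := (LinearMap.proj x : ScalarField P 0 N →ₗ[ℝ] E N) ∘ₗ G with hT
  have hT' : ∀ φ : ScalarField P 0 N, T φ = (G φ) x := fun φ => rfl
  have h := norm_mapE_avgSrc_le_block (C := C) (A := A) (B := B) (k := k) T hkK hs hA w₁
  rw [hT', mK_eq] at h
  refine h.trans ?_
  have hcol : ∀ z, ∑ i : Ix N, ‖T (cb P N 0 (z, i))‖ = col C msq a k B x z := fun z => by simp only [hT', hG]; rfl
  simp only [hcol]
  -- the smeared row
  set Rt : HiggsLattice.Site P 0 → ℝ := fun u => Linv * ∑ z ∈ HiggsAveraging.blockK k (blockIter k u), col C msq a k B x z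
    with hRt
  have hRt0 : ∀ u, 0 ≤ Rt u := fun u => mul_nonneg (inv_nonneg.mpr (pow_nonneg (Nat.cast_nonneg _) _))
    (Finset.sum_nonneg fun _ _ => col_nonneg _ _ _)
  -- exchange
  have e1 : ∑ z : HiggsLattice.Site P 0, mK P C s k * (2 + mK P C s k) *
      (((P.L : ℝ) ^ (k * P.d))⁻¹ * ∑ u ∈ HiggsAveraging.blockK k (blockIter k z), ‖w₁ u‖) * col C msq a k B x z
      = mK P C s k * (2 + mK P C s k) * ∑ u : HiggsLattice.Site P 0, Rt u * ‖w₁ u‖ := by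
    have h2 := sum_mul_sum_blockK_comm (k := k) (fun z => col C msq a k B x z) (fun u => ‖w₁ u‖)
    calc ∑ z : HiggsLattice.Site P 0, mK P C s k * (2 + mK P C s k) *
          (((P.L : ℝ) ^ (k * P.d))⁻¹ * ∑ u ∈ HiggsAveraging.blockK k (blockIter k z), ‖w₁ u‖) * col C msq a k B x z
        = mK P C s k * (2 + mK P C s k) * Linv * ∑ z : HiggsLattice.Site P 0,
            col C msq a k B x z * ∑ u ∈ HiggsAveraging.blockK k (blockIter k z), ‖w₁ u‖ := by
          rw [Finset.mul_sum]; exact Finset.sum_congr rfl fun z _ => by rw [hLinv]; ring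
      _ = mK P C s k * (2 + mK P C s k) * Linv * ∑ u : HiggsLattice.Site P 0,
            ‖w₁ u‖ * ∑ z ∈ HiggsAveraging.blockK k (blockIter k u), col C msq a k B x z := by rw [h2]
      _ = _ := by
          have e3 : ∑ u : HiggsLattice.Site P 0, Rt u * ‖w₁ u‖
              = Linv * ∑ u : HiggsLattice.Site P 0, ‖w₁ u‖ * ∑ z ∈ HiggsAveraging.blockK k (blockIter k u), col C msq a k B x z := by
            rw [Finset.mul_sum]
            exact Finset.sum_congr rfl fun u _ => by simp only [hRt]; ring
          rw [e3]; ring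
  rw [e1]
  refine mul_le_mul_of_nonneg_left ?_ hmm
  -- sites → bonds (heads), then TERM II with the smeared row
  refine (sum_site_le_sum_bond_tgt (fun u => Rt u * ‖w₁ u‖) (fun u => mul_nonneg (hRt0 u) (norm_nonneg _))).trans ?_
  have hKb0 := Kblk_nonneg (P := P) hL1 hδ₁ N
  have hcR : 0 ≤ Real.exp 1 * (Kblk P N δ₁ * (P.mesh 0 ^ P.d * Cst)) := by positivity
  have hR : ∀ b : HiggsLattice.PBond P 0, Rt b.tgt ≤ ∑ j ∈ Finset.range (k + 1),
      (Real.exp 1 * (Kblk P N δ₁ * (P.mesh 0 ^ P.d * Cst))) * P.mesh j ^ ((2 : ℝ) - (P.d : ℝ)) *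
        Real.exp (-(δ₁ / 2 * (P.mesh j)⁻¹ * (P.mesh 0 * (HiggsLattice.Site.tdist x b.src : ℝ)))) :=
    fun b => block_row_majorant h210B hmsq ha hk hkK hδ₁ hδ₁1 hCst i₀ x b
  have h3 : (P.d : ℝ) < 2 + 2 + 1 := by
    have hd3' : (P.d : ℝ) ≤ 3 := by exact_mod_cast hd3
    linarith
  exact termII_decay_le hδ₁ hδ₁1 hCst h210B h210AB hmsq ha hk hkK i₀ hs hA x x' i' (by norm_num) h3 hcR
    (fun b => Rt b.tgt) (fun b => hRt0 b.tgt) hR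

/-- **THE KERNEL OF (1.16) AT `n = n′ = 1` ON THE TORUS: EXPLICIT BOUND WITH DECAY IN EVERY TERM** (`d ≤ 3`, `m² > 0`, `a > 0`,
`1 ≤ k ≤ K`, the (2.10) bounds of `G_k(T,B)` and `G_k(T,A+B)` with constants `(δ₁,C)`, `A + B` (I.2.23)-regular with
`d²ε|e|L^{2k}δ_{A+B} ≤ 1/3`, `sup|A| ≤ s`, any ninth-term rate `0 ≤ θ ≤ δ₁/4` with `(4d+4a)θ ≤ γ₀`):
`‖(G_k(T,B)V_kG_k(T,A+B)V_kG_k(T,B)e_{(x′,i′)})(x)‖ ≤ |e|s·I(θ) + |e|s·II(1, ε^dC) + (|e|s)²·II(2, e·ε^dC) + a(L^kε)^{−2}m(2+m)·II(2, eK_bε^dC)`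
— the sixteen source pairings, every term carrying `e^{−(δ₁/8)(L^{k+1}ε)^{−1}ε|x−x′|}` or `e^{−(θ/3)|x−x′|/L^k}` (`termI_decay_le`,
`termII_decay_le`, `termIV_decay_le`, `outer_row_le`). [cite: Balaban1983Higgs3, (1.16) p.414, (2.5) p.424, (2.10) p.426] [cite: Balaban1983RegularityDecay, Cor. 2.3 p.580] -/
theorem kernel116_one_one_decay_explicit
    {δX : ℝ} (hreg : ∀ (z : HiggsLattice.Site P 0) (μ ν : Fin P.d), |(A + B) ⟨z.shift ν, μ⟩ - (A + B) ⟨z, μ⟩| ≤ δX)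
    (hsmall : (P.d : ℝ) ^ 2 * (P.mesh 0 * |C.e|) * ((P.L : ℝ) ^ k) ^ 2 * δX ≤ 1 / 3)
    {θ : ℝ} (hθ0 : 0 ≤ θ) (hθ1 : θ ≤ δ₁ / 4) (hθγ : (4 * P.d + 4 * a) * θ ≤ min 2 (a * (1 - ((P.L : ℝ) ^ 2)⁻¹) / 4)) :
    ‖B3Eq116TwoSidedExpansion.op116 C Finset.univ A B msq a k 1 1 (cb P N 0 (x', i')) x‖
      ≤ |C.e| * s * termId P N C a δ₁ Cst s k θ x x'
        + |C.e| * s * termIId P N C a δ₁ Cst s k 1 (P.mesh 0 ^ P.d * Cst) x x'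
        + (|C.e| * s) ^ 2 * termIId P N C a δ₁ Cst s k 2 (Real.exp 1 * (P.mesh 0 ^ P.d * Cst)) x x'
        + a * (P.mesh k)⁻¹ ^ 2 * (mK P C s k * (2 + mK P C s k) *
            termIId P N C a δ₁ Cst s k 2 (Real.exp 1 * (Kblk P N δ₁ * (P.mesh 0 ^ P.d * Cst))) x x') := by
  have hL1' : (1 : ℝ) < (P.L : ℝ) := by exact_mod_cast hL1
  have hes : 0 ≤ |C.e| * s := mul_nonneg (abs_nonneg _) hs
  have hc : 0 ≤ P.mesh 0 ^ P.d * Cst := mul_nonneg (pow_nonneg (P.mesh_pos 0).le _) hCst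
  have hc1 : 0 ≤ Real.exp 1 * (P.mesh 0 ^ P.d * Cst) := mul_nonneg (Real.exp_nonneg _) hc
  have hd3' : (P.d : ℝ) ≤ 3 := by exact_mod_cast hd3
  rw [B3Op116SourceForm.op116_one_one_apply C Finset.univ A B msq a k]
  set w₁ := propagatorK C Finset.univ (A + B) msq a k
    (B3Op116SourceForm.srcV C A B k Finset.univ a (propagatorK C Finset.univ B msq a k (cb P N 0 (x', i')))) with hw₁
  refine (outer_row_le C A B msq a k hA w₁ x).trans ?_
  simp only [Finset.sum_add_distrib]
  have hI := termI_decay_le hδ₁ hδ₁1 hCst h210B h210AB hmsq ha hk hkK hd3 i₀ hs hA x x' i' hreg hsmall hθ0 hθ1 hθγ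
  have hR1 : ∀ b : HiggsLattice.PBond P 0, col C msq a k B x b.tgt ≤ ∑ j ∈ Finset.range (k + 1),
      (Real.exp 1 * (P.mesh 0 ^ P.d * Cst)) * P.mesh j ^ ((2 : ℝ) - (P.d : ℝ)) *
        Real.exp (-(δ₁ / 2 * (P.mesh j)⁻¹ * (P.mesh 0 * (HiggsLattice.Site.tdist x b.src : ℝ)))) :=
    fun b => (row_col_majorant h210B hmsq ha hk hkK hδ₁ hδ₁1 hCst x b).trans (weaken hc1 hδ₁.le _ _)
  have hR2 : ∀ b : HiggsLattice.PBond P 0, dcol C msq a k B B b x ≤ ∑ j ∈ Finset.range (k + 1),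
      (P.mesh 0 ^ P.d * Cst) * P.mesh j ^ ((1 : ℝ) - (P.d : ℝ)) *
        Real.exp (-(δ₁ / 2 * (P.mesh j)⁻¹ * (P.mesh 0 * (HiggsLattice.Site.tdist x b.src : ℝ)))) :=
    fun b => (row_dcol_majorant h210B hmsq ha hk hkK x b).trans (weaken hc hδ₁.le _ _)
  have hII2 := termII_decay_le hδ₁ hδ₁1 hCst h210B h210AB hmsq ha hk hkK i₀ hs hA x x' i' (by norm_num : (0 : ℝ) < 1)
    (by linarith) hc (fun b => dcol C msq a k B B b x) (fun b => dcol_nonneg (C := C) (msq := msq) (a := a) (k := k) B B b x) hR2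
  have hII1 := termII_decay_le hδ₁ hδ₁1 hCst h210B h210AB hmsq ha hk hkK i₀ hs hA x x' i' (by norm_num : (0 : ℝ) < 2)
    (by linarith) hc1 (fun b => col C msq a k B x b.tgt)
    (fun b => col_nonneg (C := C) (msq := msq) (a := a) (k := k) B x b.tgt) hR1
  have hIV := termIV_decay_le hδ₁ hδ₁1 hCst h210B h210AB hmsq ha hk hkK hd3 i₀ hs hA x x' i'
  have hca : |B1.aSeq a P.L k| * (P.mesh k)⁻¹ ^ 2 ≤ a * (P.mesh k)⁻¹ ^ 2 := by
    rw [abs_of_pos (B1.aSeq_pos ha hL1' hk)]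
    exact mul_le_mul_of_nonneg_right (B1.aSeq_le ha hL1' k hk) (by positivity)
  have hIV0 : 0 ≤ mK P C s k * (2 + mK P C s k) *
      termIId P N C a δ₁ Cst s k 2 (Real.exp 1 * (Kblk P N δ₁ * (P.mesh 0 ^ P.d * Cst))) x x' := le_trans (norm_nonneg _) hIV
  refine add_le_add (add_le_add (add_le_add ?_ ?_) ?_) (mul_le_mul hca hIV (norm_nonneg _) (by positivity))
  · have e : ∑ b : HiggsLattice.PBond P 0, |C.e| * s * ‖covDeriv C B w₁ b‖ * col C msq a k B x b.tgt
        = |C.e| * s * ∑ b : HiggsLattice.PBond P 0, col C msq a k B x b.tgt * ‖covDeriv C B w₁ b‖ := by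
      rw [Finset.mul_sum]; exact Finset.sum_congr rfl fun b _ => by ring
    rw [e]
    exact mul_le_mul_of_nonneg_left hI hes
  · have e : ∑ b : HiggsLattice.PBond P 0, |C.e| * s * ‖w₁ b.tgt‖ * dcol C msq a k B B b x
        = |C.e| * s * ∑ b : HiggsLattice.PBond P 0, dcol C msq a k B B b x * ‖w₁ b.tgt‖ := by
      rw [Finset.mul_sum]; exact Finset.sum_congr rfl fun b _ => by ring
    rw [e]
    exact mul_le_mul_of_nonneg_left hII2 hes
  · have e : ∑ b : HiggsLattice.PBond P 0, (|C.e| * s) ^ 2 * ‖w₁ b.tgt‖ * col C msq a k B x b.tgt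
        = (|C.e| * s) ^ 2 * ∑ b : HiggsLattice.PBond P 0, col C msq a k B x b.tgt * ‖w₁ b.tgt‖ := by
      rw [Finset.mul_sum]; exact Finset.sum_congr rfl fun b _ => by ring
    rw [e]
    exact mul_le_mul_of_nonneg_left hII1 (sq_nonneg _)

end Assembly

/-! ## §8 The collapse to the consumer's shape: `(ε^d)⁻¹Σ_{i′}‖kernel‖ ≤ C_V·t²·(L^kε)²((L^kε)^d)⁻¹·e^{−δ′|x−x′|/L^k}`, `t = L^kε|e|s ≤ 1` -/

section Collapse

/-- the decay rate of the assembled bound: `δ′ = min{δ₁/(8L), γ₀/(12d+12a)}`, `γ₀ = min{2, a(1−L^{−2})/4}` (every chain carries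
`e^{−(δ₁/8)|x−x′|/L^{k+1}}`, the ninth term `e^{−(θ/3)|x−x′|/L^k}` with `θ = 3δ′ ≤ γ₀/(4d+4a)`). [cite: Balaban1983Higgs3, (1.16) p.414, (2.5) p.424] -/
def rate116 (P : HiggsLattice.Params) (a δ₁ : ℝ) : ℝ :=
  min (δ₁ / (8 * (P.L : ℝ))) (min 2 (a * (1 - ((P.L : ℝ) ^ 2)⁻¹) / 4) / (12 * (P.d : ℝ) + 12 * a))

/-- the `ε`-free part of the chain constant: `chainConst = cc0·(ε^{−d})²`. [cite: Balaban1983Higgs3, (2.10) p.426] -/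
def cc0 (P : HiggsLattice.Params) (N : ℕ) (δ p a₂ a₃ : ℝ) : ℝ :=
  (P.d : ℝ) ^ 2 * ((((nCol N : ℝ) * (8 * P.d / δ) ^ P.d) * ((nCol N : ℝ) * (16 * P.d / δ) ^ P.d)) *
    ((1 / ((P.L : ℝ) ^ (p * (1 - (P.d : ℝ) / (p + a₂ + a₃))) - 1)) *
      (1 / ((P.L : ℝ) ^ (a₂ * (1 - (P.d : ℝ) / (p + a₂ + a₃))) - 1)) *
      (1 / ((P.L : ℝ) ^ (a₃ * (1 - (P.d : ℝ) / (p + a₂ + a₃))) - 1))))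

variable {C : ChargeData N} {A B : HiggsLattice.VecField P 0} {msq a : ℝ} {k K₀ : ℕ} {hL1 : 1 < P.L} {δ₁ Cst : ℝ}

/-- `chainConst = cc0·((ε^d)⁻¹)²`. [cite: Balaban1983Higgs3, (2.10) p.426] -/
theorem chainConst_eq_cc0 (δ p a₂ a₃ : ℝ) :
    chainConst P N δ p a₂ a₃ = cc0 P N δ p a₂ a₃ * ((P.mesh 0 ^ P.d)⁻¹) ^ 2 := by
  unfold chainConst cc0; ring

/-- `cc0 ≥ 0` when the exponents are positive with sum `> d` (`L > 1`, `δ > 0`). [cite: Balaban1983Higgs3, (2.10) p.426] -/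
theorem cc0_nonneg (hL1 : 1 < P.L) {δ p a₂ a₃ : ℝ} (hδ : 0 < δ) (hp : 0 < p) (ha₂ : 0 < a₂) (ha₃ : 0 < a₃)
    (hsum : (P.d : ℝ) < p + a₂ + a₃) : 0 ≤ cc0 P N δ p a₂ a₃ := by
  have hL1' : (1 : ℝ) < (P.L : ℝ) := by exact_mod_cast hL1
  have hS : 0 < p + a₂ + a₃ := by have := P.hd; have : (0:ℝ) ≤ P.d := Nat.cast_nonneg _; linarith
  have hfrac : 0 < 1 - (P.d : ℝ) / (p + a₂ + a₃) := by
    rw [sub_pos, div_lt_one hS]; exact hsum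
  have hfac : ∀ {b : ℝ}, 0 < b → 0 ≤ 1 / ((P.L : ℝ) ^ (b * (1 - (P.d : ℝ) / (p + a₂ + a₃))) - 1) := by
    intro b hb
    have : (1 : ℝ) < (P.L : ℝ) ^ (b * (1 - (P.d : ℝ) / (p + a₂ + a₃))) := Real.one_lt_rpow hL1' (mul_pos hb hfrac)
    have : 0 < (P.L : ℝ) ^ (b * (1 - (P.d : ℝ) / (p + a₂ + a₃))) - 1 := by linarith
    positivity
  have h1 := hfac hp
  have h2 := hfac ha₂
  have h3 := hfac ha₃
  have h8 : 0 ≤ (8 * (P.d : ℝ) / δ) ^ P.d := pow_nonneg (by positivity) _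
  have h16 : 0 ≤ (16 * (P.d : ℝ) / δ) ^ P.d := pow_nonneg (by positivity) _
  unfold cc0
  positivity

/-- `δ′ > 0`. [cite: Balaban1983Higgs3, (2.5) p.424] -/
theorem rate116_pos (hL1 : 1 < P.L) (ha : 0 < a) (hδ₁ : 0 < δ₁) : 0 < rate116 P a δ₁ := by
  have hγ := gammaReg_pos (P := P) ha hL1
  have hL0 : (0 : ℝ) < (P.L : ℝ) := by have := P.hL; positivity
  have hd : (0 : ℝ) ≤ (P.d : ℝ) := Nat.cast_nonneg _
  unfold rate116
  exact lt_min (by positivity) (by positivity)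

/-- `3δ′ ≤ δ₁/4` (`L ≥ 2`) and `(4d+4a)·3δ′ ≤ γ₀` — the two hypotheses of `ninth_term_decay_le` at `θ = 3δ′`. [cite: Balaban1983Higgs3, (2.5) p.424] -/
theorem three_rate116_le (hL1 : 1 < P.L) (ha : 0 < a) (hδ₁ : 0 < δ₁) :
    3 * rate116 P a δ₁ ≤ δ₁ / 4 ∧
    (4 * (P.d : ℝ) + 4 * a) * (3 * rate116 P a δ₁) ≤ min 2 (a * (1 - ((P.L : ℝ) ^ 2)⁻¹) / 4) := by
  have hL2 : (2 : ℝ) ≤ (P.L : ℝ) := by exact_mod_cast hL1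
  have hL0 : (0 : ℝ) < (P.L : ℝ) := by linarith
  have hγ := gammaReg_pos (P := P) ha hL1
  have hd : (0 : ℝ) ≤ (P.d : ℝ) := Nat.cast_nonneg _
  have hda : 0 < 12 * (P.d : ℝ) + 12 * a := by positivity
  constructor
  · have h1 : rate116 P a δ₁ ≤ δ₁ / (8 * (P.L : ℝ)) := min_le_left _ _
    have h2 : δ₁ / (8 * (P.L : ℝ)) ≤ δ₁ / 12 := by
      apply div_le_div_of_nonneg_left hδ₁.le (by norm_num) (by linarith)
    linarith
  · have h1 : rate116 P a δ₁ ≤ min 2 (a * (1 - ((P.L : ℝ) ^ 2)⁻¹) / 4) / (12 * (P.d : ℝ) + 12 * a) := min_le_right _ _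
    rw [le_div_iff₀ hda] at h1
    linarith

/-- kernel: `(L^{j}ε)^{−1}·(ε t) = t/L^j`. [folklore] -/
private theorem scale_inv_mul (j : ℕ) (t : ℝ) : (P.mesh j)⁻¹ * (P.mesh 0 * t) = t / (P.L : ℝ) ^ j := by
  rw [show P.mesh j = (P.L : ℝ) ^ j * P.mesh 0 by simp [HiggsLattice.Params.mesh], mul_inv, mul_assoc,
    ← mul_assoc (P.mesh 0)⁻¹, inv_mul_cancel₀ (P.mesh_pos 0).ne', one_mul, div_eq_inv_mul]

/-- kernel: `L^{k+1}ε = L·(L^kε)`. [folklore] -/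
private theorem mesh_succ' (k : ℕ) : P.mesh (k + 1) = (P.L : ℝ) * P.mesh k := by
  simp [HiggsLattice.Params.mesh, pow_succ]; ring

/-- **The chains' decay factor is below the assembled one**: `e^{−(δ₁/8)(L^{k+1}ε)^{−1}ε|x−x′|} ≤ e^{−δ′|x−x′|/L^k}` (`δ′ ≤ δ₁/(8L)`).
[cite: Balaban1983Higgs3, (2.5) p.424] -/
theorem expW_le_dec (x x' : HiggsLattice.Site P 0) :
    Real.exp (-(δ₁ / 2 / 4 * (P.mesh (k + 1))⁻¹ * (P.mesh 0 * (HiggsLattice.Site.tdist x x' : ℝ))))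
      ≤ Real.exp (-(rate116 P a δ₁ * ((HiggsLattice.Site.tdist x x' : ℝ) / (P.L : ℝ) ^ k))) := by
  have hL0 : (0 : ℝ) < (P.L : ℝ) := by have := P.hL; positivity
  have hLk : (0 : ℝ) < (P.L : ℝ) ^ k := pow_pos hL0 _
  rw [mul_assoc, scale_inv_mul]
  apply Real.exp_le_exp.mpr
  have h1 : rate116 P a δ₁ ≤ δ₁ / (8 * (P.L : ℝ)) := min_le_left _ _
  have ht : 0 ≤ (HiggsLattice.Site.tdist x x' : ℝ) / (P.L : ℝ) ^ k := by positivity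
  have e : δ₁ / 2 / 4 * ((HiggsLattice.Site.tdist x x' : ℝ) / (P.L : ℝ) ^ (k + 1))
      = δ₁ / (8 * (P.L : ℝ)) * ((HiggsLattice.Site.tdist x x' : ℝ) / (P.L : ℝ) ^ k) := by
    rw [pow_succ]; field_simp; ring
  rw [e]
  have := mul_le_mul_of_nonneg_right h1 ht
  linarith

/-- the ninth term's decay factor at `θ = 3δ′` IS the assembled one. [cite: Balaban1983Higgs3, (2.5) p.424] -/
theorem exp9_eq (x x' : HiggsLattice.Site P 0) :
    Real.exp (-(3 * rate116 P a δ₁ / (P.L : ℝ) ^ k * ((HiggsLattice.Site.tdist x x' : ℝ) / 3)))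
      = Real.exp (-(rate116 P a δ₁ * ((HiggsLattice.Site.tdist x x' : ℝ) / (P.L : ℝ) ^ k))) := by
  congr 1
  have hLk : (P.L : ℝ) ^ k ≠ 0 := by have := P.hL; positivity
  field_simp

/-- **Scale algebra of the common currency**: `(L^{k+1}ε)^{σ−d} = L^{n−d}·(L^kε)^n·((L^kε)^d)^{−1}` for `σ = n`.
[cite: Balaban1983Higgs3, (2.10) p.426] -/
theorem mesh_succ_rpow {σ : ℝ} {n : ℕ} (hσ : σ = (n : ℝ)) :
    P.mesh (k + 1) ^ (σ - (P.d : ℝ)) = (P.L : ℝ) ^ ((n : ℝ) - (P.d : ℝ)) * (P.mesh k ^ n * (P.mesh k ^ P.d)⁻¹) := by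
  have hL0 : (0 : ℝ) ≤ (P.L : ℝ) := Nat.cast_nonneg _
  have hm : 0 < P.mesh k := P.mesh_pos k
  rw [hσ, mesh_succ', Real.mul_rpow hL0 hm.le, Real.rpow_sub hm, Real.rpow_natCast, Real.rpow_natCast, div_eq_mul_inv]

/-- **The monomial collapse**: a chain term of the common currency with constant `q·(ε^dC)³`, exponents summing to `n`, multiplied by a
prefactor `pre` of scaling `pre·(L^kε)^n ≤ Q·(t^e·(L^kε)²)` with `e ≥ 2`, is below
`cc0·q·C³·L^{n−d}·Q · ε^d·t²·(L^kε)²((L^kε)^d)^{−1}·e^{−δ′|x−x′|/L^k}` for `t = L^kε|e|s ≤ 1` — the bookkeeping behind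
«uniformly bounded … and exponentially decaying». [cite: Balaban1983Higgs3, (1.16) p.414, (2.5) p.424, (2.10) p.426] -/
theorem mono_collapse (hL1 : 1 < P.L) (hδ₁ : 0 < δ₁) (hCst : 0 ≤ Cst) {p a₂ a₃ q : ℝ} {n e : ℕ}
    (hp : 0 < p) (ha₂ : 0 < a₂) (ha₃ : 0 < a₃) (hsum : (P.d : ℝ) < p + a₂ + a₃) (hσ : p + a₂ + a₃ = (n : ℝ)) (hq : 0 ≤ q)
    (he : 2 ≤ e) {τ : ℝ} (hτ : 0 ≤ τ) (ht : P.mesh k * τ ≤ 1)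
    (pre Q : ℝ) (hQ : 0 ≤ Q) (hpre : pre * P.mesh k ^ n ≤ Q * ((P.mesh k * τ) ^ e * P.mesh k ^ 2))
    (x x' : HiggsLattice.Site P 0) :
    pre * chainW P N δ₁ p a₂ a₃ (q * (P.mesh 0 ^ P.d * Cst) ^ 3) k x x'
      ≤ (cc0 P N (δ₁ / 2) p a₂ a₃ * q * Cst ^ 3 * (P.L : ℝ) ^ ((n : ℝ) - (P.d : ℝ)) * Q) *
          (P.mesh 0 ^ P.d * ((P.mesh k * τ) ^ 2 * (P.mesh k ^ 2 * (P.mesh k ^ P.d)⁻¹)) *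
            Real.exp (-(rate116 P a δ₁ * ((HiggsLattice.Site.tdist x x' : ℝ) / (P.L : ℝ) ^ k)))) := by
  have hε : 0 < P.mesh 0 ^ P.d := pow_pos (P.mesh_pos 0) _
  have hm : 0 < P.mesh k := P.mesh_pos k
  have hL0 : (0 : ℝ) < (P.L : ℝ) := by have := P.hL; positivity
  have hcc := cc0_nonneg (P := P) (N := N) hL1 (half_pos hδ₁) hp ha₂ ha₃ hsum
  have ht0 : 0 ≤ P.mesh k * τ := mul_nonneg hm.le hτ
  have hte : (P.mesh k * τ) ^ e ≤ (P.mesh k * τ) ^ 2 := pow_le_pow_of_le_one ht0 ht he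
  have hE := expW_le_dec (P := P) (k := k) (a := a) (δ₁ := δ₁) x x'
  set Ed := Real.exp (-(rate116 P a δ₁ * ((HiggsLattice.Site.tdist x x' : ℝ) / (P.L : ℝ) ^ k))) with hEd
  set E₂ := Real.exp (-(δ₁ / 2 / 4 * (P.mesh (k + 1))⁻¹ * (P.mesh 0 * (HiggsLattice.Site.tdist x x' : ℝ)))) with hE₂
  unfold chainW
  rw [chainConst_eq_cc0, mesh_succ_rpow hσ]
  -- regroup: the chain term = [cc0 q C³ L^{n-d}] · ε^d · (ℓ^n (ℓ^d)⁻¹) · E₂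
  have e1 : pre * (cc0 P N (δ₁ / 2) p a₂ a₃ * (P.mesh 0 ^ P.d)⁻¹ ^ 2 * (q * (P.mesh 0 ^ P.d * Cst) ^ 3) *
        ((P.L : ℝ) ^ ((n : ℝ) - (P.d : ℝ)) * (P.mesh k ^ n * (P.mesh k ^ P.d)⁻¹)) * E₂)
      = (cc0 P N (δ₁ / 2) p a₂ a₃ * q * Cst ^ 3 * (P.L : ℝ) ^ ((n : ℝ) - (P.d : ℝ))) *
          (P.mesh 0 ^ P.d * ((pre * P.mesh k ^ n) * (P.mesh k ^ P.d)⁻¹) * E₂) := by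
    field_simp
  rw [e1]
  have hK0 : 0 ≤ cc0 P N (δ₁ / 2) p a₂ a₃ * q * Cst ^ 3 * (P.L : ℝ) ^ ((n : ℝ) - (P.d : ℝ)) := by positivity
  have hstep : P.mesh 0 ^ P.d * ((pre * P.mesh k ^ n) * (P.mesh k ^ P.d)⁻¹) * E₂
      ≤ P.mesh 0 ^ P.d * ((Q * ((P.mesh k * τ) ^ 2 * P.mesh k ^ 2)) * (P.mesh k ^ P.d)⁻¹) * Ed := by
    refine mul_le_mul (mul_le_mul_of_nonneg_left (mul_le_mul_of_nonneg_right (hpre.trans ?_)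
      (inv_nonneg.mpr (pow_nonneg hm.le _))) hε.le) hE (Real.exp_nonneg _) (by positivity)
    exact mul_le_mul_of_nonneg_left (mul_le_mul_of_nonneg_right hte (pow_nonneg hm.le _)) hQ
  refine (mul_le_mul_of_nonneg_left hstep hK0).trans (le_of_eq ?_)
  ring

variable (C)

/-- **The averaging prefactor is one power of `t` at the scale `L^kε`**: `a(L^kε)^{−2}·m(2+m)·(L^kε)² ≤ a·d(2+d)·t` for
`m = |e|sεd(L^k − 1) ≤ d·t`, `t = L^kε|e|s ≤ 1`. [cite: Balaban1982Higgs1, (3.15) p.614] [cite: Balaban1983Higgs3, (1.16) p.414] -/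
theorem alpha_mul_sq_le (ha : 0 < a) {s : ℝ} (hs : 0 ≤ s) (ht : P.mesh k * (|C.e| * s) ≤ 1) :
    a * (P.mesh k)⁻¹ ^ 2 * (mK P C s k * (2 + mK P C s k)) * P.mesh k ^ 2
      ≤ (a * P.d * (2 + P.d)) * (P.mesh k * (|C.e| * s)) := by
  have hm : 0 < P.mesh k := P.mesh_pos k
  have hes : 0 ≤ |C.e| * s := mul_nonneg (abs_nonneg _) hs
  have hmK0 : 0 ≤ mK P C s k := mK_nonneg (P := P) C hs k
  -- m ≤ d·t
  have hmK : mK P C s k ≤ (P.d : ℝ) * (P.mesh k * (|C.e| * s)) := by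
    unfold mK
    have h1 : P.mesh 0 * ((P.L : ℝ) ^ k - 1) ≤ P.mesh k := by
      rw [show P.mesh k = (P.L : ℝ) ^ k * P.mesh 0 by simp [HiggsLattice.Params.mesh]]
      have := P.mesh_pos 0; nlinarith
    have hd : (0 : ℝ) ≤ P.d := Nat.cast_nonneg _
    calc |C.e| * s * P.mesh 0 * (P.d * ((P.L : ℝ) ^ k - 1)) = P.d * (|C.e| * s) * (P.mesh 0 * ((P.L : ℝ) ^ k - 1)) := by ring
      _ ≤ P.d * (|C.e| * s) * P.mesh k := mul_le_mul_of_nonneg_left h1 (by positivity)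
      _ = _ := by ring
  have hmK1 : mK P C s k ≤ (P.d : ℝ) := hmK.trans (by
    have hd : (0 : ℝ) ≤ P.d := Nat.cast_nonneg _
    nlinarith)
  have e1 : a * (P.mesh k)⁻¹ ^ 2 * (mK P C s k * (2 + mK P C s k)) * P.mesh k ^ 2 = a * (mK P C s k * (2 + mK P C s k)) := by
    field_simp
  rw [e1]
  have h2 : mK P C s k * (2 + mK P C s k) ≤ (P.d : ℝ) * (P.mesh k * (|C.e| * s)) * (2 + P.d) :=
    mul_le_mul hmK (by linarith) (by positivity) (by positivity)
  calc a * (mK P C s k * (2 + mK P C s k)) ≤ a * ((P.d : ℝ) * (P.mesh k * (|C.e| * s)) * (2 + P.d)) :=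
        mul_le_mul_of_nonneg_left h2 ha.le
    _ = _ := by ring

variable {C}

/-- prefactor scaling, no averaging factor: `τ^M·(L^kε)^{M+2} = t^M·(L^kε)²`. [folklore] -/
private theorem pre0_eq (τ : ℝ) (M n : ℕ) (hn : n = M + 2) : τ ^ M * P.mesh k ^ n = 1 * ((P.mesh k * τ) ^ M * P.mesh k ^ 2) := by
  subst hn; ring

/-- prefactor scaling, one averaging factor: `τ^M·α·(L^kε)^{M+4} ≤ A₀·t^{M+1}(L^kε)²` when `α(L^kε)² ≤ A₀t`. [folklore] -/
private theorem pre1_le {τ α A₀ : ℝ} (hτ : 0 ≤ τ) (hαℓ : α * P.mesh k ^ 2 ≤ A₀ * (P.mesh k * τ)) (M n e : ℕ)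
    (hn : n = M + 4) (he : e = M + 1) :
    τ ^ M * α * P.mesh k ^ n ≤ A₀ * ((P.mesh k * τ) ^ e * P.mesh k ^ 2) := by
  subst hn he
  have hm : 0 ≤ P.mesh k := (P.mesh_pos k).le
  calc τ ^ M * α * P.mesh k ^ (M + 4) = (τ ^ M * P.mesh k ^ (M + 2)) * (α * P.mesh k ^ 2) := by ring
    _ ≤ (τ ^ M * P.mesh k ^ (M + 2)) * (A₀ * (P.mesh k * τ)) := mul_le_mul_of_nonneg_left hαℓ (by positivity)
    _ = _ := by ring

/-- prefactor scaling, two averaging factors: `α²(L^kε)^6 ≤ A₀²·t²(L^kε)²`. [folklore] -/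
private theorem pre2_le {τ α A₀ : ℝ} (hα : 0 ≤ α) (hαℓ : α * P.mesh k ^ 2 ≤ A₀ * (P.mesh k * τ)) :
    α * α * P.mesh k ^ 6 ≤ A₀ ^ 2 * ((P.mesh k * τ) ^ 2 * P.mesh k ^ 2) := by
  have hm : 0 ≤ P.mesh k := (P.mesh_pos k).le
  have h0 : 0 ≤ α * P.mesh k ^ 2 := by positivity
  have h := mul_le_mul hαℓ hαℓ h0 (h0.trans hαℓ)
  calc α * α * P.mesh k ^ 6 = (α * P.mesh k ^ 2) * (α * P.mesh k ^ 2) * P.mesh k ^ 2 := by ring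
    _ ≤ (A₀ * (P.mesh k * τ)) * (A₀ * (P.mesh k * τ)) * P.mesh k ^ 2 := mul_le_mul_of_nonneg_right h (by positivity)
    _ = _ := by ring

end Collapse

section Collapse2

variable {C : ChargeData N} {A B : HiggsLattice.VecField P 0} {msq a : ℝ} {k K₀ : ℕ} {hL1 : 1 < P.L} {δ₁ Cst : ℝ}

/-- `t`-free majorant of `K_bad` (`t ≤ 1`): `4 + (4/√γ₀)√d + (2/γ₀)d`. [cite: Balaban1983RegularityDecay, Cor. 2.3 (2.30) p.580] -/
def Kbadp (P : HiggsLattice.Params) (a : ℝ) : ℝ :=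
  4 + 2 * (2 / Real.sqrt (min 2 (a * (1 - ((P.L : ℝ) ^ 2)⁻¹) / 4))) * Real.sqrt P.d
    + 2 / min 2 (a * (1 - ((P.L : ℝ) ^ 2)⁻¹) / 4) * P.d

/-- `t`-free majorant of `K_θ` (`t ≤ 1`). [cite: Balaban1983RegularityDecay, Cor. 2.3 (2.30) p.580] -/
def Kthp (P : HiggsLattice.Params) (a θ : ℝ) : ℝ :=
  (4 + 2 * θ * Real.sqrt (8 * P.d / min 2 (a * (1 - ((P.L : ℝ) ^ 2)⁻¹) / 4))) * Real.exp θ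
    + 2 * ((2 / Real.sqrt (min 2 (a * (1 - ((P.L : ℝ) ^ 2)⁻¹) / 4))
        + 4 * Real.sqrt P.d * θ / min 2 (a * (1 - ((P.L : ℝ) ^ 2)⁻¹) / 4)) * Real.exp θ) * Real.sqrt P.d
    + 2 / min 2 (a * (1 - ((P.L : ℝ) ^ 2)⁻¹) / 4) * P.d

/-- `√(d·τ²) = √d·τ` for `τ ≥ 0`. [folklore] -/
private theorem sqrt_d_sq {τ : ℝ} (hτ : 0 ≤ τ) : Real.sqrt (P.d * τ ^ 2) = Real.sqrt P.d * τ := by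
  rw [Real.sqrt_mul (Nat.cast_nonneg _), Real.sqrt_sq hτ]

/-- `K_bad ≤ K_bad⁺` when `t = L^kε|e|s ≤ 1`. [cite: Balaban1983RegularityDecay, Cor. 2.3 (2.30) p.580] -/
theorem Kbad_le (ha : 0 < a) (hL1 : 1 < P.L) {s : ℝ} (hs : 0 ≤ s) (ht : P.mesh k * (|C.e| * s) ≤ 1) :
    Kbad P C a s k ≤ Kbadp P a := by
  have hγ := gammaReg_pos (P := P) ha hL1
  have hm : 0 < P.mesh k := P.mesh_pos k
  have hes : 0 ≤ |C.e| * s := mul_nonneg (abs_nonneg _) hs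
  have ht0 : 0 ≤ P.mesh k * (|C.e| * s) := mul_nonneg hm.le hes
  have hsq : Real.sqrt (P.d * (|C.e| * s) ^ 2) = Real.sqrt P.d * (|C.e| * s) := sqrt_d_sq hes
  have h1 : P.mesh k * Real.sqrt (P.d * (|C.e| * s) ^ 2) ≤ Real.sqrt P.d := by
    rw [hsq]
    calc P.mesh k * (Real.sqrt P.d * (|C.e| * s)) = Real.sqrt P.d * (P.mesh k * (|C.e| * s)) := by ring
      _ ≤ Real.sqrt P.d * 1 := mul_le_mul_of_nonneg_left ht (Real.sqrt_nonneg _)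
      _ = _ := mul_one _
  have h2 : P.mesh k ^ 2 * Real.sqrt (P.d * (|C.e| * s) ^ 2) ^ 2 ≤ (P.d : ℝ) := by
    rw [hsq, mul_pow, Real.sq_sqrt (Nat.cast_nonneg _)]
    have hp : (P.mesh k * (|C.e| * s)) ^ 2 ≤ 1 := pow_le_one₀ (mul_nonneg hm.le hes) ht
    calc P.mesh k ^ 2 * ((P.d : ℝ) * (|C.e| * s) ^ 2) = (P.d : ℝ) * (P.mesh k * (|C.e| * s)) ^ 2 := by ring
      _ ≤ (P.d : ℝ) * 1 := mul_le_mul_of_nonneg_left hp (Nat.cast_nonneg _)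
      _ = _ := mul_one _
  unfold Kbad Kbadp
  have e1 : 2 * (2 / Real.sqrt (min 2 (a * (1 - ((P.L : ℝ) ^ 2)⁻¹) / 4)) * P.mesh k) * Real.sqrt (P.d * (|C.e| * s) ^ 2)
      = 2 * (2 / Real.sqrt (min 2 (a * (1 - ((P.L : ℝ) ^ 2)⁻¹) / 4))) * (P.mesh k * Real.sqrt (P.d * (|C.e| * s) ^ 2)) := by ring
  have e2 : 2 / min 2 (a * (1 - ((P.L : ℝ) ^ 2)⁻¹) / 4) * P.mesh k ^ 2 * Real.sqrt (P.d * (|C.e| * s) ^ 2) ^ 2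
      = 2 / min 2 (a * (1 - ((P.L : ℝ) ^ 2)⁻¹) / 4) * (P.mesh k ^ 2 * Real.sqrt (P.d * (|C.e| * s) ^ 2) ^ 2) := by ring
  rw [e1, e2]
  have hc1 : 0 ≤ 2 * (2 / Real.sqrt (min 2 (a * (1 - ((P.L : ℝ) ^ 2)⁻¹) / 4))) := by positivity
  have hc2 : 0 ≤ 2 / min 2 (a * (1 - ((P.L : ℝ) ^ 2)⁻¹) / 4) := by positivity
  exact add_le_add (add_le_add le_rfl (mul_le_mul_of_nonneg_left h1 hc1)) (mul_le_mul_of_nonneg_left h2 hc2)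

/-- `K_θ ≤ K_θ⁺` when `t ≤ 1`, `θ ≥ 0`. [cite: Balaban1983RegularityDecay, Cor. 2.3 (2.30) p.580] -/
theorem Kth_le (ha : 0 < a) (hL1 : 1 < P.L) {s : ℝ} (hs : 0 ≤ s) (ht : P.mesh k * (|C.e| * s) ≤ 1) {θ : ℝ} (hθ : 0 ≤ θ) :
    Kth P C a s k θ ≤ Kthp P a θ := by
  have hγ := gammaReg_pos (P := P) ha hL1
  have hm : 0 < P.mesh k := P.mesh_pos k
  have hes : 0 ≤ |C.e| * s := mul_nonneg (abs_nonneg _) hs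
  have hsq : Real.sqrt (P.d * (|C.e| * s) ^ 2) = Real.sqrt P.d * (|C.e| * s) := sqrt_d_sq hes
  have h1 : P.mesh k * Real.sqrt (P.d * (|C.e| * s) ^ 2) ≤ Real.sqrt P.d := by
    rw [hsq]
    calc P.mesh k * (Real.sqrt P.d * (|C.e| * s)) = Real.sqrt P.d * (P.mesh k * (|C.e| * s)) := by ring
      _ ≤ Real.sqrt P.d * 1 := mul_le_mul_of_nonneg_left ht (Real.sqrt_nonneg _)
      _ = _ := mul_one _
  have h2 : P.mesh k ^ 2 * Real.sqrt (P.d * (|C.e| * s) ^ 2) ^ 2 ≤ (P.d : ℝ) := by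
    rw [hsq, mul_pow, Real.sq_sqrt (Nat.cast_nonneg _)]
    have hp : (P.mesh k * (|C.e| * s)) ^ 2 ≤ 1 := pow_le_one₀ (mul_nonneg hm.le hes) ht
    calc P.mesh k ^ 2 * ((P.d : ℝ) * (|C.e| * s) ^ 2) = (P.d : ℝ) * (P.mesh k * (|C.e| * s)) ^ 2 := by ring
      _ ≤ (P.d : ℝ) * 1 := mul_le_mul_of_nonneg_left hp (Nat.cast_nonneg _)
      _ = _ := mul_one _
  unfold Kth Kthp
  set γ₀ := min 2 (a * (1 - ((P.L : ℝ) ^ 2)⁻¹) / 4) with hγ₀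
  have e1 : 2 * ((2 / Real.sqrt γ₀ + 4 * Real.sqrt P.d * θ / γ₀) * P.mesh k * Real.exp θ) * Real.sqrt (P.d * (|C.e| * s) ^ 2)
      = 2 * ((2 / Real.sqrt γ₀ + 4 * Real.sqrt P.d * θ / γ₀) * Real.exp θ) * (P.mesh k * Real.sqrt (P.d * (|C.e| * s) ^ 2)) := by
    ring
  have e2 : 2 / γ₀ * P.mesh k ^ 2 * Real.sqrt (P.d * (|C.e| * s) ^ 2) ^ 2
      = 2 / γ₀ * (P.mesh k ^ 2 * Real.sqrt (P.d * (|C.e| * s) ^ 2) ^ 2) := by ring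
  rw [e1, e2]
  have hc1 : 0 ≤ 2 * ((2 / Real.sqrt γ₀ + 4 * Real.sqrt P.d * θ / γ₀) * Real.exp θ) := by positivity
  have hc2 : 0 ≤ 2 / γ₀ := by positivity
  exact add_le_add (add_le_add le_rfl (mul_le_mul_of_nonneg_left h1 hc1)) (mul_le_mul_of_nonneg_left h2 hc2)

/-- the coefficient of the ninth term after the collapse. [cite: Balaban1983Higgs3, (1.16) p.414] -/
def coef9 (P : HiggsLattice.Params) (N : ℕ) (a δ₁ Cst : ℝ) : ℝ :=
  (P.d : ℝ) * ((Real.exp 1 * Cst) ^ 2 * (((nCol N : ℝ) * (4 * P.d / (δ₁ / 2 / 2)) ^ P.d) /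
    ((P.L : ℝ) ^ (((4 : ℝ) - (P.d : ℝ)) / 2) - 1) ^ 2)) *
    (2 * Kbadp P a + Kthp P a (3 * rate116 P a δ₁) * Real.exp (2 * (3 * rate116 P a δ₁)))

/-- **The ninth term collapses**: with `θ = 3δ′`, `|e|s·NINTH ≤ coef9·ε^d·t²(L^kε)²((L^kε)^d)^{−1}e^{−δ′|x−x′|/L^k}` (`t ≤ 1`).
[cite: Balaban1983Higgs3, (1.16) p.414, (2.5) p.424] [cite: Balaban1983RegularityDecay, Cor. 2.3 (2.30) p.580] -/
theorem ninth_collapse (ha : 0 < a) (hL1 : 1 < P.L) (hδ₁ : 0 < δ₁) {s : ℝ} (hs : 0 ≤ s)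
    (ht : P.mesh k * (|C.e| * s) ≤ 1) (x x' : HiggsLattice.Site P 0) :
    |C.e| * s * ((P.mesh 0 ^ P.d)⁻¹ * (|C.e| * s) * Wsq P N δ₁ Cst k *
        (2 * Kbad P C a s k + Kth P C a s k (3 * rate116 P a δ₁) * Real.exp (2 * (3 * rate116 P a δ₁))) *
        Real.exp (-(3 * rate116 P a δ₁ / (P.L : ℝ) ^ k * ((HiggsLattice.Site.tdist x x' : ℝ) / 3))))
      ≤ coef9 P N a δ₁ Cst *
          (P.mesh 0 ^ P.d * ((P.mesh k * (|C.e| * s)) ^ 2 * (P.mesh k ^ 2 * (P.mesh k ^ P.d)⁻¹)) *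
            Real.exp (-(rate116 P a δ₁ * ((HiggsLattice.Site.tdist x x' : ℝ) / (P.L : ℝ) ^ k)))) := by
  have hε : 0 < P.mesh 0 ^ P.d := pow_pos (P.mesh_pos 0) _
  have hm : 0 < P.mesh k := P.mesh_pos k
  have hes : 0 ≤ |C.e| * s := mul_nonneg (abs_nonneg _) hs
  have hr0 : 0 ≤ 3 * rate116 P a δ₁ := by have := rate116_pos (P := P) hL1 ha hδ₁; positivity
  have hK9 : 2 * Kbad P C a s k + Kth P C a s k (3 * rate116 P a δ₁) * Real.exp (2 * (3 * rate116 P a δ₁))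
      ≤ 2 * Kbadp P a + Kthp P a (3 * rate116 P a δ₁) * Real.exp (2 * (3 * rate116 P a δ₁)) :=
    add_le_add (mul_le_mul_of_nonneg_left (Kbad_le (C := C) ha hL1 hs ht) (by norm_num))
      (mul_le_mul_of_nonneg_right (Kth_le (C := C) ha hL1 hs ht hr0) (Real.exp_nonneg _))
  have hW0 : 0 ≤ Wsq P N δ₁ Cst k := Wsq_nonneg (P := P) hδ₁ N Cst k
  rw [exp9_eq]
  set Ed := Real.exp (-(rate116 P a δ₁ * ((HiggsLattice.Site.tdist x x' : ℝ) / (P.L : ℝ) ^ k))) with hEd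
  have hℓ4 : P.mesh k ^ ((4 : ℝ) - (P.d : ℝ)) = P.mesh k ^ 4 * (P.mesh k ^ P.d)⁻¹ := by
    rw [Real.rpow_sub hm, show (4 : ℝ) = ((4 : ℕ) : ℝ) by norm_num, Real.rpow_natCast, Real.rpow_natCast, div_eq_mul_inv]
  calc |C.e| * s * ((P.mesh 0 ^ P.d)⁻¹ * (|C.e| * s) * Wsq P N δ₁ Cst k *
        (2 * Kbad P C a s k + Kth P C a s k (3 * rate116 P a δ₁) * Real.exp (2 * (3 * rate116 P a δ₁))) * Ed)
      = (|C.e| * s * (P.mesh 0 ^ P.d)⁻¹ * (|C.e| * s) * Wsq P N δ₁ Cst k * Ed) *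
          (2 * Kbad P C a s k + Kth P C a s k (3 * rate116 P a δ₁) * Real.exp (2 * (3 * rate116 P a δ₁))) := by ring
    _ ≤ (|C.e| * s * (P.mesh 0 ^ P.d)⁻¹ * (|C.e| * s) * Wsq P N δ₁ Cst k * Ed) *
          (2 * Kbadp P a + Kthp P a (3 * rate116 P a δ₁) * Real.exp (2 * (3 * rate116 P a δ₁))) :=
        mul_le_mul_of_nonneg_left hK9 (by positivity)
    _ = _ := by
        have hWε : (P.mesh 0 ^ P.d)⁻¹ * Wsq P N δ₁ Cst k
            = P.mesh 0 ^ P.d * ((P.d : ℝ) * ((Real.exp 1 * Cst) ^ 2 * (((nCol N : ℝ) * (4 * P.d / (δ₁ / 2 / 2)) ^ P.d) /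
                ((P.L : ℝ) ^ (((4 : ℝ) - (P.d : ℝ)) / 2) - 1) ^ 2) * (P.mesh k ^ 4 * (P.mesh k ^ P.d)⁻¹))) := by
          unfold Wsq
          rw [hℓ4, inv_mul_eq_div, div_eq_iff hε.ne']
          ring
        unfold coef9
        calc |C.e| * s * (P.mesh 0 ^ P.d)⁻¹ * (|C.e| * s) * Wsq P N δ₁ Cst k * Ed *
              (2 * Kbadp P a + Kthp P a (3 * rate116 P a δ₁) * Real.exp (2 * (3 * rate116 P a δ₁)))
            = ((P.mesh 0 ^ P.d)⁻¹ * Wsq P N δ₁ Cst k) * ((|C.e| * s) * (|C.e| * s) * Ed) *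
              (2 * Kbadp P a + Kthp P a (3 * rate116 P a δ₁) * Real.exp (2 * (3 * rate116 P a δ₁))) := by ring
          _ = _ := by rw [hWε]; ring

/-- the averaging scaling constant `A₀ = a·d·(2+d)`. [cite: Balaban1982Higgs1, (3.15) p.614] -/
def A0 (P : HiggsLattice.Params) (a : ℝ) : ℝ := a * P.d * (2 + P.d)

end Collapse2

section Collapse3

variable {C : ChargeData N} {A B : HiggsLattice.VecField P 0} {msq a : ℝ} {k K₀ : ℕ} {δ₁ Cst : ℝ}

/-- coefficient of `|e|s·TERM I` after the collapse. [cite: Balaban1983Higgs3, (1.16) p.414] -/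
def coefI (P : HiggsLattice.Params) (N : ℕ) (a δ₁ Cst : ℝ) : ℝ :=
  cc0 P N (δ₁ / 2) 2 1 1 * Real.exp 1 ^ 2 * Cst ^ 3 * (P.L : ℝ) ^ (((4 : ℕ) : ℝ) - (P.d : ℝ)) * 1
    + cc0 P N (δ₁ / 2) 2 2 1 * Real.exp 1 ^ 3 * Cst ^ 3 * (P.L : ℝ) ^ (((5 : ℕ) : ℝ) - (P.d : ℝ)) * 1
    + cc0 P N (δ₁ / 2) 2 1 2 * Real.exp 1 ^ 3 * Cst ^ 3 * (P.L : ℝ) ^ (((5 : ℕ) : ℝ) - (P.d : ℝ)) * 1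
    + cc0 P N (δ₁ / 2) 2 2 2 * Real.exp 1 ^ 4 * Cst ^ 3 * (P.L : ℝ) ^ (((6 : ℕ) : ℝ) - (P.d : ℝ)) * 1
    + coef9 P N a δ₁ Cst
    + cc0 P N (δ₁ / 2) 2 1 2 * (Real.exp 1 * Kblk P N δ₁) * Cst ^ 3 * (P.L : ℝ) ^ (((5 : ℕ) : ℝ) - (P.d : ℝ)) * A0 P a
    + cc0 P N (δ₁ / 2) 2 2 2 * (Real.exp 1 ^ 2 * Kblk P N δ₁) * Cst ^ 3 * (P.L : ℝ) ^ (((6 : ℕ) : ℝ) - (P.d : ℝ)) * A0 P a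

/-- coefficient of `|e|s·TERM II(1, ε^dC)` after the collapse. [cite: Balaban1983Higgs3, (1.16) p.414] -/
def coefII1 (P : HiggsLattice.Params) (N : ℕ) (a δ₁ Cst : ℝ) : ℝ :=
  cc0 P N (δ₁ / 2) 1 2 1 * Real.exp 1 ^ 2 * Cst ^ 3 * (P.L : ℝ) ^ (((4 : ℕ) : ℝ) - (P.d : ℝ)) * 1
    + cc0 P N (δ₁ / 2) 1 1 2 * Real.exp 1 ^ 2 * Cst ^ 3 * (P.L : ℝ) ^ (((4 : ℕ) : ℝ) - (P.d : ℝ)) * 1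
    + cc0 P N (δ₁ / 2) 1 2 2 * Real.exp 1 ^ 3 * Cst ^ 3 * (P.L : ℝ) ^ (((5 : ℕ) : ℝ) - (P.d : ℝ)) * 1
    + cc0 P N (δ₁ / 2) 1 2 2 * Real.exp 1 ^ 3 * Cst ^ 3 * (P.L : ℝ) ^ (((5 : ℕ) : ℝ) - (P.d : ℝ)) * 1
    + cc0 P N (δ₁ / 2) 1 2 2 * (Real.exp 1 * Kblk P N δ₁) * Cst ^ 3 * (P.L : ℝ) ^ (((5 : ℕ) : ℝ) - (P.d : ℝ)) * A0 P a

/-- coefficient of `(|e|s)²·TERM II(2, e·ε^dC)` after the collapse. [cite: Balaban1983Higgs3, (1.16) p.414] -/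
def coefII2 (P : HiggsLattice.Params) (N : ℕ) (a δ₁ Cst : ℝ) : ℝ :=
  cc0 P N (δ₁ / 2) 2 2 1 * Real.exp 1 ^ 3 * Cst ^ 3 * (P.L : ℝ) ^ (((5 : ℕ) : ℝ) - (P.d : ℝ)) * 1
    + cc0 P N (δ₁ / 2) 2 1 2 * Real.exp 1 ^ 3 * Cst ^ 3 * (P.L : ℝ) ^ (((5 : ℕ) : ℝ) - (P.d : ℝ)) * 1
    + cc0 P N (δ₁ / 2) 2 2 2 * Real.exp 1 ^ 4 * Cst ^ 3 * (P.L : ℝ) ^ (((6 : ℕ) : ℝ) - (P.d : ℝ)) * 1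
    + cc0 P N (δ₁ / 2) 2 2 2 * Real.exp 1 ^ 4 * Cst ^ 3 * (P.L : ℝ) ^ (((6 : ℕ) : ℝ) - (P.d : ℝ)) * 1
    + cc0 P N (δ₁ / 2) 2 2 2 * (Real.exp 1 ^ 2 * Kblk P N δ₁) * Cst ^ 3 * (P.L : ℝ) ^ (((6 : ℕ) : ℝ) - (P.d : ℝ)) * A0 P a

/-- coefficient of `a(L^kε)^{−2}m(2+m)·TERM II(2, eK_bε^dC)` after the collapse. [cite: Balaban1983Higgs3, (1.16) p.414] -/
def coefII4 (P : HiggsLattice.Params) (N : ℕ) (a δ₁ Cst : ℝ) : ℝ :=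
  cc0 P N (δ₁ / 2) 2 2 1 * (Real.exp 1 ^ 3 * Kblk P N δ₁) * Cst ^ 3 * (P.L : ℝ) ^ (((5 : ℕ) : ℝ) - (P.d : ℝ)) * A0 P a
    + cc0 P N (δ₁ / 2) 2 1 2 * (Real.exp 1 ^ 3 * Kblk P N δ₁) * Cst ^ 3 * (P.L : ℝ) ^ (((5 : ℕ) : ℝ) - (P.d : ℝ)) * A0 P a
    + cc0 P N (δ₁ / 2) 2 2 2 * (Real.exp 1 ^ 4 * Kblk P N δ₁) * Cst ^ 3 * (P.L : ℝ) ^ (((6 : ℕ) : ℝ) - (P.d : ℝ)) * A0 P a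
    + cc0 P N (δ₁ / 2) 2 2 2 * (Real.exp 1 ^ 4 * Kblk P N δ₁) * Cst ^ 3 * (P.L : ℝ) ^ (((6 : ℕ) : ℝ) - (P.d : ℝ)) * A0 P a
    + cc0 P N (δ₁ / 2) 2 2 2 * (Real.exp 1 ^ 2 * Kblk P N δ₁ ^ 2) * Cst ^ 3 * (P.L : ℝ) ^ (((6 : ℕ) : ℝ) - (P.d : ℝ)) *
        A0 P a ^ 2

/-- **THE CONSTANT `C_V` of the collapsed bound** (free of `k`, of the volume and of `ε`; a polynomial in the displayed constants).
[cite: Balaban1983Higgs3, (1.16) p.414, (2.5) p.424] -/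
def cv116 (P : HiggsLattice.Params) (N : ℕ) (a δ₁ Cst : ℝ) : ℝ :=
  (nCol N : ℝ) * (coefI P N a δ₁ Cst + coefII1 P N a δ₁ Cst + coefII2 P N a δ₁ Cst + coefII4 P N a δ₁ Cst)

variable (hL1 : 1 < P.L) (hδ₁ : 0 < δ₁) (hCst : 0 ≤ Cst) (ha : 0 < a) (hd3 : P.d ≤ 3) {s : ℝ} (hs : 0 ≤ s)
  (ht : P.mesh k * (|C.e| * s) ≤ 1) (x x' : HiggsLattice.Site P 0)
include hL1 hδ₁ hCst ha hd3 hs ht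

/-- collapse of `|e|s·TERM II(1, ε^dC)`. [cite: Balaban1983Higgs3, (1.16) p.414, (2.5) p.424] -/
theorem termIId_one_collapse :
    |C.e| * s * termIId P N C a δ₁ Cst s k 1 (P.mesh 0 ^ P.d * Cst) x x'
      ≤ coefII1 P N a δ₁ Cst *
          (P.mesh 0 ^ P.d * ((P.mesh k * (|C.e| * s)) ^ 2 * (P.mesh k ^ 2 * (P.mesh k ^ P.d)⁻¹)) *
            Real.exp (-(rate116 P a δ₁ * ((HiggsLattice.Site.tdist x x' : ℝ) / (P.L : ℝ) ^ k)))) := by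
  have hd3' : (P.d : ℝ) ≤ 3 := by exact_mod_cast hd3
  have hes : 0 ≤ |C.e| * s := mul_nonneg (abs_nonneg _) hs
  have hKb := Kblk_nonneg (P := P) hL1 hδ₁ N
  have hA0 : 0 ≤ A0 P a := by unfold A0; positivity
  have hαℓ : a * (P.mesh k)⁻¹ ^ 2 * (mK P C s k * (2 + mK P C s k)) * P.mesh k ^ 2 ≤ A0 P a * (P.mesh k * (|C.e| * s)) :=
    alpha_mul_sq_le C ha hs ht
  unfold termIId
  set c := P.mesh 0 ^ P.d * Cst with hc
  set τ := |C.e| * s with hτ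
  set mm := mK P C s k * (2 + mK P C s k) with hmm
  have hK1 : c * (Real.exp 1 * (Real.exp 1 * c)) * c = Real.exp 1 ^ 2 * c ^ 3 := by ring
  have hK2 : c * (Real.exp 1 * c) * (Real.exp 1 * c) = Real.exp 1 ^ 2 * c ^ 3 := by ring
  have hK3 : c * (Real.exp 1 * (Real.exp 1 * c)) * (Real.exp 1 * c) = Real.exp 1 ^ 3 * c ^ 3 := by ring
  have hK4 : c * (Real.exp 1 * c) * (Kblk P N δ₁ * c) = (Real.exp 1 * Kblk P N δ₁) * c ^ 3 := by ring
  rw [hK1, hK2, hK3, hK4]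
  set W₁ := chainW P N δ₁ 1 2 1 (Real.exp 1 ^ 2 * c ^ 3) k x x' with hW₁
  set W₂ := chainW P N δ₁ 1 1 2 (Real.exp 1 ^ 2 * c ^ 3) k x x' with hW₂
  set W₃ := chainW P N δ₁ 1 2 2 (Real.exp 1 ^ 3 * c ^ 3) k x x' with hW₃
  set W₄ := chainW P N δ₁ 1 2 2 ((Real.exp 1 * Kblk P N δ₁) * c ^ 3) k x x' with hW₄
  have m1 := mono_collapse (P := P) (N := N) (k := k) (a := a) (δ₁ := δ₁) (Cst := Cst) hL1 hδ₁ hCst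
    (p := 1) (a₂ := 2) (a₃ := 1) (q := Real.exp 1 ^ 2) (n := 4) (e := 2) (by norm_num) (by norm_num) (by norm_num)
    (by linarith) (by norm_num) (by positivity) le_rfl hes ht (τ ^ 2) 1 zero_le_one (le_of_eq (pre0_eq τ 2 4 rfl)) x x'
  have m2 := mono_collapse (P := P) (N := N) (k := k) (a := a) (δ₁ := δ₁) (Cst := Cst) hL1 hδ₁ hCst
    (p := 1) (a₂ := 1) (a₃ := 2) (q := Real.exp 1 ^ 2) (n := 4) (e := 2) (by norm_num) (by norm_num) (by norm_num)
    (by linarith) (by norm_num) (by positivity) le_rfl hes ht (τ ^ 2) 1 zero_le_one (le_of_eq (pre0_eq τ 2 4 rfl)) x x'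
  have m3 := mono_collapse (P := P) (N := N) (k := k) (a := a) (δ₁ := δ₁) (Cst := Cst) hL1 hδ₁ hCst
    (p := 1) (a₂ := 2) (a₃ := 2) (q := Real.exp 1 ^ 3) (n := 5) (e := 3) (by norm_num) (by norm_num) (by norm_num)
    (by linarith) (by norm_num) (by positivity) (by norm_num) hes ht (τ ^ 3) 1 zero_le_one (le_of_eq (pre0_eq τ 3 5 rfl)) x x'
  have m5 := mono_collapse (P := P) (N := N) (k := k) (a := a) (δ₁ := δ₁) (Cst := Cst) hL1 hδ₁ hCst
    (p := 1) (a₂ := 2) (a₃ := 2) (q := Real.exp 1 * Kblk P N δ₁) (n := 5) (e := 2) (by norm_num) (by norm_num) (by norm_num)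
    (by linarith) (by norm_num) (by positivity) le_rfl hes ht (τ ^ 1 * (a * (P.mesh k)⁻¹ ^ 2 * mm)) (A0 P a) hA0
    (pre1_le (P := P) (k := k) hes hαℓ 1 5 2 rfl rfl) x x'
  calc τ * (τ * W₁ + τ * (W₂ + τ * W₃) + τ ^ 2 * W₃ + a * (P.mesh k)⁻¹ ^ 2 * (mm * W₄))
      = τ ^ 2 * W₁ + τ ^ 2 * W₂ + τ ^ 3 * W₃ + τ ^ 3 * W₃ + τ ^ 1 * (a * (P.mesh k)⁻¹ ^ 2 * mm) * W₄ := by ring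
    _ ≤ _ := by
        have h := add_le_add (add_le_add (add_le_add (add_le_add m1 m2) m3) m3) m5
        refine h.trans (le_of_eq ?_)
        unfold coefII1
        ring

/-- collapse of `(|e|s)²·TERM II(2, e·ε^dC)`. [cite: Balaban1983Higgs3, (1.16) p.414, (2.5) p.424] -/
theorem termIId_two_collapse :
    (|C.e| * s) ^ 2 * termIId P N C a δ₁ Cst s k 2 (Real.exp 1 * (P.mesh 0 ^ P.d * Cst)) x x'
      ≤ coefII2 P N a δ₁ Cst *
          (P.mesh 0 ^ P.d * ((P.mesh k * (|C.e| * s)) ^ 2 * (P.mesh k ^ 2 * (P.mesh k ^ P.d)⁻¹)) *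
            Real.exp (-(rate116 P a δ₁ * ((HiggsLattice.Site.tdist x x' : ℝ) / (P.L : ℝ) ^ k)))) := by
  have hd3' : (P.d : ℝ) ≤ 3 := by exact_mod_cast hd3
  have hes : 0 ≤ |C.e| * s := mul_nonneg (abs_nonneg _) hs
  have hKb := Kblk_nonneg (P := P) hL1 hδ₁ N
  have hA0 : 0 ≤ A0 P a := by unfold A0; positivity
  have hαℓ : a * (P.mesh k)⁻¹ ^ 2 * (mK P C s k * (2 + mK P C s k)) * P.mesh k ^ 2 ≤ A0 P a * (P.mesh k * (|C.e| * s)) :=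
    alpha_mul_sq_le C ha hs ht
  unfold termIId
  set c := P.mesh 0 ^ P.d * Cst with hc
  set τ := |C.e| * s with hτ
  set mm := mK P C s k * (2 + mK P C s k) with hmm
  have hK1 : Real.exp 1 * c * (Real.exp 1 * (Real.exp 1 * c)) * c = Real.exp 1 ^ 3 * c ^ 3 := by ring
  have hK2 : Real.exp 1 * c * (Real.exp 1 * c) * (Real.exp 1 * c) = Real.exp 1 ^ 3 * c ^ 3 := by ring
  have hK3 : Real.exp 1 * c * (Real.exp 1 * (Real.exp 1 * c)) * (Real.exp 1 * c) = Real.exp 1 ^ 4 * c ^ 3 := by ring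
  have hK4 : Real.exp 1 * c * (Real.exp 1 * c) * (Kblk P N δ₁ * c) = (Real.exp 1 ^ 2 * Kblk P N δ₁) * c ^ 3 := by ring
  rw [hK1, hK2, hK3, hK4]
  set W₁ := chainW P N δ₁ 2 2 1 (Real.exp 1 ^ 3 * c ^ 3) k x x' with hW₁
  set W₂ := chainW P N δ₁ 2 1 2 (Real.exp 1 ^ 3 * c ^ 3) k x x' with hW₂
  set W₃ := chainW P N δ₁ 2 2 2 (Real.exp 1 ^ 4 * c ^ 3) k x x' with hW₃
  set W₄ := chainW P N δ₁ 2 2 2 ((Real.exp 1 ^ 2 * Kblk P N δ₁) * c ^ 3) k x x' with hW₄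
  have m1 := mono_collapse (P := P) (N := N) (k := k) (a := a) (δ₁ := δ₁) (Cst := Cst) hL1 hδ₁ hCst
    (p := 2) (a₂ := 2) (a₃ := 1) (q := Real.exp 1 ^ 3) (n := 5) (e := 3) (by norm_num) (by norm_num) (by norm_num)
    (by linarith) (by norm_num) (by positivity) (by norm_num) hes ht (τ ^ 3) 1 zero_le_one (le_of_eq (pre0_eq τ 3 5 rfl)) x x'
  have m2 := mono_collapse (P := P) (N := N) (k := k) (a := a) (δ₁ := δ₁) (Cst := Cst) hL1 hδ₁ hCst
    (p := 2) (a₂ := 1) (a₃ := 2) (q := Real.exp 1 ^ 3) (n := 5) (e := 3) (by norm_num) (by norm_num) (by norm_num)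
    (by linarith) (by norm_num) (by positivity) (by norm_num) hes ht (τ ^ 3) 1 zero_le_one (le_of_eq (pre0_eq τ 3 5 rfl)) x x'
  have m3 := mono_collapse (P := P) (N := N) (k := k) (a := a) (δ₁ := δ₁) (Cst := Cst) hL1 hδ₁ hCst
    (p := 2) (a₂ := 2) (a₃ := 2) (q := Real.exp 1 ^ 4) (n := 6) (e := 4) (by norm_num) (by norm_num) (by norm_num)
    (by linarith) (by norm_num) (by positivity) (by norm_num) hes ht (τ ^ 4) 1 zero_le_one (le_of_eq (pre0_eq τ 4 6 rfl)) x x'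
  have m5 := mono_collapse (P := P) (N := N) (k := k) (a := a) (δ₁ := δ₁) (Cst := Cst) hL1 hδ₁ hCst
    (p := 2) (a₂ := 2) (a₃ := 2) (q := Real.exp 1 ^ 2 * Kblk P N δ₁) (n := 6) (e := 3) (by norm_num) (by norm_num) (by norm_num)
    (by linarith) (by norm_num) (by positivity) (by norm_num) hes ht (τ ^ 2 * (a * (P.mesh k)⁻¹ ^ 2 * mm)) (A0 P a) hA0
    (pre1_le (P := P) (k := k) hes hαℓ 2 6 3 rfl rfl) x x'
  calc τ ^ 2 * (τ * W₁ + τ * (W₂ + τ * W₃) + τ ^ 2 * W₃ + a * (P.mesh k)⁻¹ ^ 2 * (mm * W₄))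
      = τ ^ 3 * W₁ + τ ^ 3 * W₂ + τ ^ 4 * W₃ + τ ^ 4 * W₃ + τ ^ 2 * (a * (P.mesh k)⁻¹ ^ 2 * mm) * W₄ := by ring
    _ ≤ _ := by
        have h := add_le_add (add_le_add (add_le_add (add_le_add m1 m2) m3) m3) m5
        refine h.trans (le_of_eq ?_)
        unfold coefII2
        ring

/-- collapse of `a(L^kε)^{−2}m(2+m)·TERM II(2, eK_bε^dC)`. [cite: Balaban1983Higgs3, (1.16) p.414, (2.5) p.424] -/
theorem termIId_avg_collapse :
    a * (P.mesh k)⁻¹ ^ 2 * (mK P C s k * (2 + mK P C s k) *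
        termIId P N C a δ₁ Cst s k 2 (Real.exp 1 * (Kblk P N δ₁ * (P.mesh 0 ^ P.d * Cst))) x x')
      ≤ coefII4 P N a δ₁ Cst *
          (P.mesh 0 ^ P.d * ((P.mesh k * (|C.e| * s)) ^ 2 * (P.mesh k ^ 2 * (P.mesh k ^ P.d)⁻¹)) *
            Real.exp (-(rate116 P a δ₁ * ((HiggsLattice.Site.tdist x x' : ℝ) / (P.L : ℝ) ^ k)))) := by
  have hd3' : (P.d : ℝ) ≤ 3 := by exact_mod_cast hd3
  have hes : 0 ≤ |C.e| * s := mul_nonneg (abs_nonneg _) hs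
  have hKb := Kblk_nonneg (P := P) hL1 hδ₁ N
  have hA0 : 0 ≤ A0 P a := by unfold A0; positivity
  have hαℓ : a * (P.mesh k)⁻¹ ^ 2 * (mK P C s k * (2 + mK P C s k)) * P.mesh k ^ 2 ≤ A0 P a * (P.mesh k * (|C.e| * s)) :=
    alpha_mul_sq_le C ha hs ht
  have hmK := mK_nonneg (P := P) C hs k
  have hα0 : 0 ≤ a * (P.mesh k)⁻¹ ^ 2 * (mK P C s k * (2 + mK P C s k)) := by positivity
  unfold termIId
  set c := P.mesh 0 ^ P.d * Cst with hc
  set τ := |C.e| * s with hτ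
  set mm := mK P C s k * (2 + mK P C s k) with hmm
  have hK1 : Real.exp 1 * (Kblk P N δ₁ * c) * (Real.exp 1 * (Real.exp 1 * c)) * c = (Real.exp 1 ^ 3 * Kblk P N δ₁) * c ^ 3 := by ring
  have hK2 : Real.exp 1 * (Kblk P N δ₁ * c) * (Real.exp 1 * c) * (Real.exp 1 * c) = (Real.exp 1 ^ 3 * Kblk P N δ₁) * c ^ 3 := by
    ring
  have hK3 : Real.exp 1 * (Kblk P N δ₁ * c) * (Real.exp 1 * (Real.exp 1 * c)) * (Real.exp 1 * c)
      = (Real.exp 1 ^ 4 * Kblk P N δ₁) * c ^ 3 := by ring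
  have hK4 : Real.exp 1 * (Kblk P N δ₁ * c) * (Real.exp 1 * c) * (Kblk P N δ₁ * c) = (Real.exp 1 ^ 2 * Kblk P N δ₁ ^ 2) * c ^ 3 := by
    ring
  rw [hK1, hK2, hK3, hK4]
  set W₁ := chainW P N δ₁ 2 2 1 ((Real.exp 1 ^ 3 * Kblk P N δ₁) * c ^ 3) k x x' with hW₁
  set W₂ := chainW P N δ₁ 2 1 2 ((Real.exp 1 ^ 3 * Kblk P N δ₁) * c ^ 3) k x x' with hW₂
  set W₃ := chainW P N δ₁ 2 2 2 ((Real.exp 1 ^ 4 * Kblk P N δ₁) * c ^ 3) k x x' with hW₃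
  set W₄ := chainW P N δ₁ 2 2 2 ((Real.exp 1 ^ 2 * Kblk P N δ₁ ^ 2) * c ^ 3) k x x' with hW₄
  set α := a * (P.mesh k)⁻¹ ^ 2 * mm with hα
  have m1 := mono_collapse (P := P) (N := N) (k := k) (a := a) (δ₁ := δ₁) (Cst := Cst) hL1 hδ₁ hCst
    (p := 2) (a₂ := 2) (a₃ := 1) (q := Real.exp 1 ^ 3 * Kblk P N δ₁) (n := 5) (e := 2) (by norm_num) (by norm_num) (by norm_num)
    (by linarith) (by norm_num) (by positivity) le_rfl hes ht (τ ^ 1 * α) (A0 P a) hA0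
    (pre1_le (P := P) (k := k) hes hαℓ 1 5 2 rfl rfl) x x'
  have m2 := mono_collapse (P := P) (N := N) (k := k) (a := a) (δ₁ := δ₁) (Cst := Cst) hL1 hδ₁ hCst
    (p := 2) (a₂ := 1) (a₃ := 2) (q := Real.exp 1 ^ 3 * Kblk P N δ₁) (n := 5) (e := 2) (by norm_num) (by norm_num) (by norm_num)
    (by linarith) (by norm_num) (by positivity) le_rfl hes ht (τ ^ 1 * α) (A0 P a) hA0
    (pre1_le (P := P) (k := k) hes hαℓ 1 5 2 rfl rfl) x x'
  have m3 := mono_collapse (P := P) (N := N) (k := k) (a := a) (δ₁ := δ₁) (Cst := Cst) hL1 hδ₁ hCst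
    (p := 2) (a₂ := 2) (a₃ := 2) (q := Real.exp 1 ^ 4 * Kblk P N δ₁) (n := 6) (e := 3) (by norm_num) (by norm_num) (by norm_num)
    (by linarith) (by norm_num) (by positivity) (by norm_num) hes ht (τ ^ 2 * α) (A0 P a) hA0
    (pre1_le (P := P) (k := k) hes hαℓ 2 6 3 rfl rfl) x x'
  have m5 := mono_collapse (P := P) (N := N) (k := k) (a := a) (δ₁ := δ₁) (Cst := Cst) hL1 hδ₁ hCst
    (p := 2) (a₂ := 2) (a₃ := 2) (q := Real.exp 1 ^ 2 * Kblk P N δ₁ ^ 2) (n := 6) (e := 2) (by norm_num) (by norm_num)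
    (by norm_num) (by linarith) (by norm_num) (by positivity) le_rfl hes ht (α * α) (A0 P a ^ 2) (by positivity)
    (pre2_le (P := P) (k := k) hα0 hαℓ) x x'
  calc a * (P.mesh k)⁻¹ ^ 2 * (mm * (τ * W₁ + τ * (W₂ + τ * W₃) + τ ^ 2 * W₃ + a * (P.mesh k)⁻¹ ^ 2 * (mm * W₄)))
      = τ ^ 1 * α * W₁ + τ ^ 1 * α * W₂ + τ ^ 2 * α * W₃ + τ ^ 2 * α * W₃ + α * α * W₄ := by rw [hα]; ring
    _ ≤ _ := by
        have h := add_le_add (add_le_add (add_le_add (add_le_add m1 m2) m3) m3) m5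
        refine h.trans (le_of_eq ?_)
        unfold coefII4
        ring

/-- collapse of `|e|s·TERM I` (with the ninth term at `θ = 3δ′`). [cite: Balaban1983Higgs3, (1.16) p.414, (2.5) p.424] -/
theorem termId_collapse :
    |C.e| * s * termId P N C a δ₁ Cst s k (3 * rate116 P a δ₁) x x'
      ≤ coefI P N a δ₁ Cst *
          (P.mesh 0 ^ P.d * ((P.mesh k * (|C.e| * s)) ^ 2 * (P.mesh k ^ 2 * (P.mesh k ^ P.d)⁻¹)) *
            Real.exp (-(rate116 P a δ₁ * ((HiggsLattice.Site.tdist x x' : ℝ) / (P.L : ℝ) ^ k)))) := by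
  have hd3' : (P.d : ℝ) ≤ 3 := by exact_mod_cast hd3
  have hes : 0 ≤ |C.e| * s := mul_nonneg (abs_nonneg _) hs
  have hKb := Kblk_nonneg (P := P) hL1 hδ₁ N
  have hA0 : 0 ≤ A0 P a := by unfold A0; positivity
  have hαℓ : a * (P.mesh k)⁻¹ ^ 2 * (mK P C s k * (2 + mK P C s k)) * P.mesh k ^ 2 ≤ A0 P a * (P.mesh k * (|C.e| * s)) :=
    alpha_mul_sq_le C ha hs ht
  have h9 := ninth_collapse (P := P) (N := N) (C := C) (k := k) (δ₁ := δ₁) (Cst := Cst) ha hL1 hδ₁ hs ht x x'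
  unfold termId
  set c := P.mesh 0 ^ P.d * Cst with hc
  set τ := |C.e| * s with hτ
  set mm := mK P C s k * (2 + mK P C s k) with hmm
  have hK1 : Real.exp 1 * c * (Real.exp 1 * c) * c = Real.exp 1 ^ 2 * c ^ 3 := by ring
  have hK2 : Real.exp 1 * c * (Real.exp 1 * (Real.exp 1 * c)) * c = Real.exp 1 ^ 3 * c ^ 3 := by ring
  have hK3 : Real.exp 1 * c * (Real.exp 1 * c) * (Real.exp 1 * c) = Real.exp 1 ^ 3 * c ^ 3 := by ring
  have hK4 : Real.exp 1 * c * (Real.exp 1 * (Real.exp 1 * c)) * (Real.exp 1 * c) = Real.exp 1 ^ 4 * c ^ 3 := by ring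
  have hK5 : Real.exp 1 * c * c * (Kblk P N δ₁ * c) = (Real.exp 1 * Kblk P N δ₁) * c ^ 3 := by ring
  have hK6 : Real.exp 1 * c * (Real.exp 1 * c) * (Kblk P N δ₁ * c) = (Real.exp 1 ^ 2 * Kblk P N δ₁) * c ^ 3 := by ring
  rw [hK1, hK2, hK3, hK4, hK5, hK6]
  set W₁ := chainW P N δ₁ 2 1 1 (Real.exp 1 ^ 2 * c ^ 3) k x x' with hW₁
  set W₂ := chainW P N δ₁ 2 2 1 (Real.exp 1 ^ 3 * c ^ 3) k x x' with hW₂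
  set W₃ := chainW P N δ₁ 2 1 2 (Real.exp 1 ^ 3 * c ^ 3) k x x' with hW₃
  set W₄ := chainW P N δ₁ 2 2 2 (Real.exp 1 ^ 4 * c ^ 3) k x x' with hW₄
  set W₅ := chainW P N δ₁ 2 1 2 ((Real.exp 1 * Kblk P N δ₁) * c ^ 3) k x x' with hW₅
  set W₆ := chainW P N δ₁ 2 2 2 ((Real.exp 1 ^ 2 * Kblk P N δ₁) * c ^ 3) k x x' with hW₆
  set N9 := (P.mesh 0 ^ P.d)⁻¹ * τ * Wsq P N δ₁ Cst k *
      (2 * Kbad P C a s k + Kth P C a s k (3 * rate116 P a δ₁) * Real.exp (2 * (3 * rate116 P a δ₁))) *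
      Real.exp (-(3 * rate116 P a δ₁ / (P.L : ℝ) ^ k * ((HiggsLattice.Site.tdist x x' : ℝ) / 3))) with hN9
  set α := a * (P.mesh k)⁻¹ ^ 2 * mm with hα
  have m1 := mono_collapse (P := P) (N := N) (k := k) (a := a) (δ₁ := δ₁) (Cst := Cst) hL1 hδ₁ hCst
    (p := 2) (a₂ := 1) (a₃ := 1) (q := Real.exp 1 ^ 2) (n := 4) (e := 2) (by norm_num) (by norm_num) (by norm_num)
    (by linarith) (by norm_num) (by positivity) le_rfl hes ht (τ ^ 2) 1 zero_le_one (le_of_eq (pre0_eq τ 2 4 rfl)) x x'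
  have m2 := mono_collapse (P := P) (N := N) (k := k) (a := a) (δ₁ := δ₁) (Cst := Cst) hL1 hδ₁ hCst
    (p := 2) (a₂ := 2) (a₃ := 1) (q := Real.exp 1 ^ 3) (n := 5) (e := 3) (by norm_num) (by norm_num) (by norm_num)
    (by linarith) (by norm_num) (by positivity) (by norm_num) hes ht (τ ^ 3) 1 zero_le_one (le_of_eq (pre0_eq τ 3 5 rfl)) x x'
  have m3 := mono_collapse (P := P) (N := N) (k := k) (a := a) (δ₁ := δ₁) (Cst := Cst) hL1 hδ₁ hCst
    (p := 2) (a₂ := 1) (a₃ := 2) (q := Real.exp 1 ^ 3) (n := 5) (e := 3) (by norm_num) (by norm_num) (by norm_num)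
    (by linarith) (by norm_num) (by positivity) (by norm_num) hes ht (τ ^ 3) 1 zero_le_one (le_of_eq (pre0_eq τ 3 5 rfl)) x x'
  have m4 := mono_collapse (P := P) (N := N) (k := k) (a := a) (δ₁ := δ₁) (Cst := Cst) hL1 hδ₁ hCst
    (p := 2) (a₂ := 2) (a₃ := 2) (q := Real.exp 1 ^ 4) (n := 6) (e := 4) (by norm_num) (by norm_num) (by norm_num)
    (by linarith) (by norm_num) (by positivity) (by norm_num) hes ht (τ ^ 4) 1 zero_le_one (le_of_eq (pre0_eq τ 4 6 rfl)) x x'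
  have m5 := mono_collapse (P := P) (N := N) (k := k) (a := a) (δ₁ := δ₁) (Cst := Cst) hL1 hδ₁ hCst
    (p := 2) (a₂ := 1) (a₃ := 2) (q := Real.exp 1 * Kblk P N δ₁) (n := 5) (e := 2) (by norm_num) (by norm_num) (by norm_num)
    (by linarith) (by norm_num) (by positivity) le_rfl hes ht (τ ^ 1 * α) (A0 P a) hA0
    (pre1_le (P := P) (k := k) hes hαℓ 1 5 2 rfl rfl) x x'
  have m6 := mono_collapse (P := P) (N := N) (k := k) (a := a) (δ₁ := δ₁) (Cst := Cst) hL1 hδ₁ hCst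
    (p := 2) (a₂ := 2) (a₃ := 2) (q := Real.exp 1 ^ 2 * Kblk P N δ₁) (n := 6) (e := 3) (by norm_num) (by norm_num) (by norm_num)
    (by linarith) (by norm_num) (by positivity) (by norm_num) hes ht (τ ^ 2 * α) (A0 P a) hA0
    (pre1_le (P := P) (k := k) hes hαℓ 2 6 3 rfl rfl) x x'
  calc τ * (τ * (W₁ + τ * W₂) + τ ^ 2 * (W₃ + τ * W₄) + N9 + a * (P.mesh k)⁻¹ ^ 2 * (mm * (W₅ + τ * W₆)))
      = τ ^ 2 * W₁ + τ ^ 3 * W₂ + τ ^ 3 * W₃ + τ ^ 4 * W₄ + τ * N9 + τ ^ 1 * α * W₅ + τ ^ 2 * α * W₆ := by rw [hα]; ring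
    _ ≤ _ := by
        have h := add_le_add (add_le_add (add_le_add (add_le_add (add_le_add (add_le_add m1 m2) m3) m4) h9) m5) m6
        refine h.trans (le_of_eq ?_)
        unfold coefI
        ring

variable (hδ₁1 : δ₁ ≤ 1)
  (h210B : (regRegionKernels hL1 C Finset.univ B msq a k K₀).Ineq210 δ₁ Cst)
  (h210AB : (regRegionKernels hL1 C Finset.univ (A + B) msq a k K₀).Ineq210 δ₁ Cst)
  (hmsq : 0 < msq) (hk : 1 ≤ k) (hkK : k ≤ P.K) (i₀ : Ix N)
  (hA : ∀ b : HiggsLattice.PBond P 0, |A b| ≤ s)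
include hδ₁1 h210B h210AB hmsq hk hkK i₀ hA

/-- **THE KERNEL OF (1.16) AT `n = n′ = 1` ON THE TORUS IS UNIFORMLY BOUNDED AND EXPONENTIALLY DECAYING** — [B3] p. 414 *"the
Hölder norms … of this kernel … are exponentially decaying with the distance of the arguments and are uniformly bounded"* for the VALUE
of the kernel, first case `n = n′ = 1`, `Ω = T_ε`, `d ≤ 3`, in the shape of the consumer's binder (p40's
`B3Ineq25Op116Smooth.ineq25At_op116_smooth_torus_of_bounds`, `hV`): for `m² > 0`, `a > 0`, `1 ≤ k ≤ K`, the (2.10) bounds of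
`G_k(T_ε,B)` and `G_k(T_ε,A+B)` with constants `(δ₁, C)` (`0 < δ₁ ≤ 1`; e.g. `ineq210_regularRegion_univ_small`), `A + B`
(I.2.23)-regular with `d²ε|e|L^{2k}δ_{A+B} ≤ 1/3`, `sup_b|A_b| ≤ s` and `t := L^kε·|e|s ≤ 1`:
`(ε^d)^{−1}Σ_{i′}‖(G_k(T,B)V_kG_k(T,A+B)V_kG_k(T,B)e_{(x′,i′)})(x)‖ ≤ C_V·t²·(L^kε)²((L^kε)^d)^{−1}·e^{−δ′|x−x′|/L^k}` with
`δ′ = min{δ₁/(8L), γ₀/(12d+12a)} > 0` (`rate116_pos`) and `C_V = cv116 P N a δ₁ C` explicit, free of `k`, of the volume and of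
`ε`.  The printed RATE `O(1)(e(L^kε)^{1−α})^{n+n′}` for large `n, n′` is NOT claimed; `t²` is print's `(e(L^kε)p(L^kε))^{n+n′}` at
`n + n′ = 2`. [cite: Balaban1983Higgs3, (1.16) p.414, (2.5) p.424, (2.10) p.426] [cite: Balaban1983RegularityDecay, Cor. 2.3 p.580] [cite: Balaban1982Higgs1, Prop. 2.1 (2.23)–(2.25) pp.610–611] -/
theorem kernel116_one_one_decay_le
    {δX : ℝ} (hreg : ∀ (z : HiggsLattice.Site P 0) (μ ν : Fin P.d), |(A + B) ⟨z.shift ν, μ⟩ - (A + B) ⟨z, μ⟩| ≤ δX)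
    (hsmall : (P.d : ℝ) ^ 2 * (P.mesh 0 * |C.e|) * ((P.L : ℝ) ^ k) ^ 2 * δX ≤ 1 / 3) :
    (P.mesh 0 ^ P.d)⁻¹ * ∑ i' : Ix N, ‖B3Eq116TwoSidedExpansion.op116 C Finset.univ A B msq a k 1 1 (cb P N 0 (x', i')) x‖
      ≤ cv116 P N a δ₁ Cst * (P.mesh k * (|C.e| * s)) ^ 2 * (P.mesh k ^ 2 * (P.mesh k ^ P.d)⁻¹) *
          Real.exp (-(rate116 P a δ₁ * ((HiggsLattice.Site.tdist x x' : ℝ) / (P.L : ℝ) ^ k))) := by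
  have hε : 0 < P.mesh 0 ^ P.d := pow_pos (P.mesh_pos 0) _
  obtain ⟨hθ1, hθγ⟩ := three_rate116_le (P := P) hL1 ha hδ₁
  have hθ0 : 0 ≤ 3 * rate116 P a δ₁ := by have := rate116_pos (P := P) hL1 ha hδ₁; positivity
  have h1 := termId_collapse (P := P) (N := N) (C := C) (k := k) hL1 hδ₁ hCst ha hd3 hs ht x x'
  have h2 := termIId_one_collapse (P := P) (N := N) (C := C) (k := k) hL1 hδ₁ hCst ha hd3 hs ht x x'
  have h3 := termIId_two_collapse (P := P) (N := N) (C := C) (k := k) hL1 hδ₁ hCst ha hd3 hs ht x x'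
  have h4 := termIId_avg_collapse (P := P) (N := N) (C := C) (k := k) hL1 hδ₁ hCst ha hd3 hs ht x x'
  set Φ := P.mesh 0 ^ P.d * ((P.mesh k * (|C.e| * s)) ^ 2 * (P.mesh k ^ 2 * (P.mesh k ^ P.d)⁻¹)) *
    Real.exp (-(rate116 P a δ₁ * ((HiggsLattice.Site.tdist x x' : ℝ) / (P.L : ℝ) ^ k))) with hΦ
  have hpt : ∀ i' : Ix N, ‖B3Eq116TwoSidedExpansion.op116 C Finset.univ A B msq a k 1 1 (cb P N 0 (x', i')) x‖
      ≤ (coefI P N a δ₁ Cst + coefII1 P N a δ₁ Cst + coefII2 P N a δ₁ Cst + coefII4 P N a δ₁ Cst) * Φ := by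
    intro i'
    have h := kernel116_one_one_decay_explicit hδ₁ hδ₁1 hCst h210B h210AB hmsq ha hk hkK hd3 i₀ hs hA x x' i' hreg hsmall
      hθ0 hθ1 hθγ
    refine h.trans ((add_le_add (add_le_add (add_le_add h1 h2) h3) h4).trans (le_of_eq ?_))
    ring
  have hε1 : (P.mesh 0 ^ P.d)⁻¹ * P.mesh 0 ^ P.d = 1 := inv_mul_cancel₀ hε.ne'
  calc (P.mesh 0 ^ P.d)⁻¹ * ∑ i' : Ix N, ‖B3Eq116TwoSidedExpansion.op116 C Finset.univ A B msq a k 1 1 (cb P N 0 (x', i')) x‖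
      ≤ (P.mesh 0 ^ P.d)⁻¹ * ∑ _i' : Ix N,
          (coefI P N a δ₁ Cst + coefII1 P N a δ₁ Cst + coefII2 P N a δ₁ Cst + coefII4 P N a δ₁ Cst) * Φ :=
        mul_le_mul_of_nonneg_left (Finset.sum_le_sum fun i' _ => hpt i') (inv_nonneg.mpr hε.le)
    _ = (P.mesh 0 ^ P.d)⁻¹ * ((nCol N : ℝ) *
          ((coefI P N a δ₁ Cst + coefII1 P N a δ₁ Cst + coefII2 P N a δ₁ Cst + coefII4 P N a δ₁ Cst) * Φ)) := by
        rw [Finset.sum_const, Finset.card_univ, Fintype.card_fin, nsmul_eq_mul]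
    _ = _ := by
        rw [hΦ]
        unfold cv116
        linear_combination ((nCol N : ℝ) *
          (coefI P N a δ₁ Cst + coefII1 P N a δ₁ Cst + coefII2 P N a δ₁ Cst + coefII4 P N a δ₁ Cst) *
            ((P.mesh k * (|C.e| * s)) ^ 2 * (P.mesh k ^ 2 * (P.mesh k ^ P.d)⁻¹)) *
            Real.exp (-(rate116 P a δ₁ * ((HiggsLattice.Site.tdist x x' : ℝ) / (P.L : ℝ) ^ k)))) * hε1

end Collapse3

/-! ## §9 (v1.2) The torus form with the (2.10) inputs DISCHARGED (`ineq210_regularRegion_univ_small`): `∃K₀min ∀K₀ ∃(t₀, δ′, C_V) ∀` volume -/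

section TorusPackaged

open B3Ineq210RegularRegion (ineq210_regularRegion_univ_small regularRegion_hypotheses_nonvacuous scaleR_eq)
open B1TorusCubeCover (half)

variable {C : ChargeData N} {msq a : ℝ} {k K₀ : ℕ} {hL1 : 1 < P.L} {δ₁ Cst : ℝ}

/-- kernel: `e^{−ρus} ≤ e^{−ρ′us}` for `ρ′ ≤ ρ`, `u, s ≥ 0`. [folklore] -/
private theorem exp_rate_mono3 {ρ ρ' u s : ℝ} (h : ρ' ≤ ρ) (hu : 0 ≤ u) (hs : 0 ≤ s) :
    Real.exp (-(ρ * u * s)) ≤ Real.exp (-(ρ' * u * s)) := by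
  apply Real.exp_le_exp.mpr
  have := mul_le_mul_of_nonneg_right (mul_le_mul_of_nonneg_right h hu) hs
  linarith

/-- **(2.10) is monotone in the rate** on r15's carrier: the bound with a smaller `δ₁′ ≤ δ₁` is weaker (`C ≥ 0`, `dist ≥ 0`).
[cite: Balaban1983Higgs3, (2.10) p.426] -/
theorem ineq210_rate_mono {Ω : Finset (HiggsLattice.Site P 0)} {X : HiggsLattice.VecField P 0} {δ₁ δ₁' Cst : ℝ} (hCst : 0 ≤ Cst)
    (hle : δ₁' ≤ δ₁) (h : (regRegionKernels hL1 C Ω X msq a k K₀).Ineq210 δ₁ Cst) :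
    (regRegionKernels hL1 C Ω X msq a k K₀).Ineq210 δ₁' Cst := by
  intro j x x'
  obtain ⟨h1, h2⟩ := h j x x'
  have hs : 0 < (regRegionKernels hL1 C Ω X msq a k K₀).scale j := by rw [scaleR_eq]; exact P.mesh_pos j
  have hdist : 0 ≤ (regRegionKernels hL1 C Ω X msq a k K₀).dist x x' := by
    show 0 ≤ P.mesh 0 * (HiggsLattice.Site.tdist x.1 x'.1 : ℝ)
    have := P.mesh_pos 0
    positivity
  have hexp := exp_rate_mono3 hle (inv_nonneg.mpr hs.le) hdist
  exact ⟨h1.trans (mul_le_mul_of_nonneg_left hexp (mul_nonneg hCst (Real.rpow_nonneg hs.le _))),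
    fun μ => (h2 μ).trans (mul_le_mul_of_nonneg_left hexp (mul_nonneg hCst (Real.rpow_nonneg hs.le _)))⟩

/-- `δ′` depends on the lattice parameters only through `d` and `L`. [cite: Balaban1983Higgs3, (2.5) p.424] -/
theorem rate116_congr {P P' : HiggsLattice.Params} (hd : P.d = P'.d) (hL : P.L = P'.L) (a δ₁ : ℝ) :
    rate116 P a δ₁ = rate116 P' a δ₁ := by
  unfold rate116
  rw [hd, hL]

/-- `C_V` depends on the lattice parameters only through `d` and `L` (free of the volume `M, K, L′_μ` and of `ε`).
[cite: Balaban1983Higgs3, (1.16) p.414, (2.5) p.424] -/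
theorem cv116_congr {P P' : HiggsLattice.Params} (hd : P.d = P'.d) (hL : P.L = P'.L) (N : ℕ) (a δ₁ Cst : ℝ) :
    cv116 P N a δ₁ Cst = cv116 P' N a δ₁ Cst := by
  unfold cv116 coefI coefII1 coefII2 coefII4 coef9 cc0 Kblk Kbadp Kthp rate116 A0
  rw [hd, hL]

/-- `C_V ≥ 0` (`L ≥ 2`, `a > 0`, `δ₁ > 0`, `C ≥ 0`, `d ≤ 3`). [cite: Balaban1983Higgs3, (1.16) p.414, (2.5) p.424] -/
theorem cv116_nonneg (hL1 : 1 < P.L) (ha : 0 < a) (hδ₁ : 0 < δ₁) (hCst : 0 ≤ Cst) (hd3 : P.d ≤ 3) (N : ℕ) :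
    0 ≤ cv116 P N a δ₁ Cst := by
  have hd3' : (P.d : ℝ) ≤ 3 := by exact_mod_cast hd3
  have hL0 : (0 : ℝ) < (P.L : ℝ) := by have := P.hL; positivity
  have hKb := Kblk_nonneg (P := P) hL1 hδ₁ N
  have hA0 : 0 ≤ A0 P a := by unfold A0; positivity
  have hγ := gammaReg_pos (P := P) ha hL1
  have hr := rate116_pos (P := P) hL1 ha hδ₁
  have hcc : ∀ {p a₂ a₃ : ℝ}, 0 < p → 0 < a₂ → 0 < a₃ → (P.d : ℝ) < p + a₂ + a₃ → 0 ≤ cc0 P N (δ₁ / 2) p a₂ a₃ :=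
    fun hp h2 h3 hs => cc0_nonneg (P := P) (N := N) hL1 (half_pos hδ₁) hp h2 h3 hs
  have c211 := hcc (p := 2) (a₂ := 1) (a₃ := 1) (by norm_num) (by norm_num) (by norm_num) (by linarith)
  have c121 := hcc (p := 1) (a₂ := 2) (a₃ := 1) (by norm_num) (by norm_num) (by norm_num) (by linarith)
  have c112 := hcc (p := 1) (a₂ := 1) (a₃ := 2) (by norm_num) (by norm_num) (by norm_num) (by linarith)
  have c122 := hcc (p := 1) (a₂ := 2) (a₃ := 2) (by norm_num) (by norm_num) (by norm_num) (by linarith)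
  have c221 := hcc (p := 2) (a₂ := 2) (a₃ := 1) (by norm_num) (by norm_num) (by norm_num) (by linarith)
  have c212 := hcc (p := 2) (a₂ := 1) (a₃ := 2) (by norm_num) (by norm_num) (by norm_num) (by linarith)
  have c222 := hcc (p := 2) (a₂ := 2) (a₃ := 2) (by norm_num) (by norm_num) (by norm_num) (by linarith)
  have hKbad : 0 ≤ Kbadp P a := by unfold Kbadp; positivity
  have hKth : 0 ≤ Kthp P a (3 * rate116 P a δ₁) := by unfold Kthp; positivity
  have h9 : 0 ≤ coef9 P N a δ₁ Cst := by
    have h4 : 0 ≤ (4 * (P.d : ℝ) / (δ₁ / 2 / 2)) ^ P.d := pow_nonneg (by positivity) _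
    unfold coef9; positivity
  have hLr : ∀ r : ℝ, 0 ≤ (P.L : ℝ) ^ r := fun r => Real.rpow_nonneg hL0.le r
  have h4 := hLr (((4 : ℕ) : ℝ) - (P.d : ℝ))
  have h5 := hLr (((5 : ℕ) : ℝ) - (P.d : ℝ))
  have h6 := hLr (((6 : ℕ) : ℝ) - (P.d : ℝ))
  have hI : 0 ≤ coefI P N a δ₁ Cst := by unfold coefI; positivity
  have hII1 : 0 ≤ coefII1 P N a δ₁ Cst := by unfold coefII1; positivity
  have hII2 : 0 ≤ coefII2 P N a δ₁ Cst := by unfold coefII2; positivity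
  have hII4 : 0 ≤ coefII4 P N a δ₁ Cst := by unfold coefII4; positivity
  unfold cv116; positivity

/-- **THE KERNEL OF (1.16) AT `n = n′ = 1` ON THE TORUS, (2.10) DISCHARGED** — the print's sentence p. 414 («exponentially decaying with
the distance of the arguments and … uniformly bounded», «This estimate follows easily from the properties of the propagators G_k(Ω, A)
proved in the next paper») for the VALUE of the kernel at `n = n′ = 1`, `Ω = T_ε`, in the `∃K₀min ∀K₀ ∃(t₀, δ′, C_V)` shape of r15/p33's
`ineq210_regularRegion_univ_small` (which supplies (2.10) for `G_k(T,B)` and `G_k(T,A+B)`): for `1 ≤ d ≤ 3`, `L ≥ 2`, `a > 0`,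
`m² > 0`, a charge with a component index, there are a cube-size threshold `K₀min` and, for every `K₀ ≥ K₀min`, constants `t₀, δ′ > 0`,
`C_V ≥ 0` — free of the volume, of `k` and of `ε` — such that on every torus of parameters `(d, L)` with `K₀ ∣ M`, every
`1 ≤ k ≤ K` with `3·half ≤ sites` and `L^kε ≤ 1`, all fields with `B` and `A + B` (I.2.23)-regular, `L^kδ_B|e| ≤ t₀`,
`L^kδ_{A+B}|e| ≤ t₀`, `sup_b|A_b| ≤ s`, `t = L^kε|e|s ≤ 1`:
`(ε^d)^{−1}Σ_{i′}‖(G_k(T,B)V_kG_k(T,A+B)V_kG_k(T,B)e_{(x′,i′)})(x)‖ ≤ C_V·t²·(L^kε)²((L^kε)^d)^{−1}·e^{−δ′|x−x′|/L^k}`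
(`kernel116_one_one_decay_le` + `ineq210_rate_mono` at `min δ₁ 1` + `cv116_congr`/`rate116_congr`).  Printed rate for large `n, n′`
NOT claimed. [cite: Balaban1983Higgs3, (1.16) p.414, (2.5) p.424, (2.10) p.426] [cite: Balaban1983RegularityDecay, Cor. 2.3 p.580] [cite: Balaban1982Higgs1, Prop. 2.1 (2.23)–(2.25) pp.610–611] -/
theorem kernel116_one_one_decay_torus (d L : ℕ) (hd : 1 ≤ d) (hd3 : d ≤ 3) (hL : 2 ≤ L) {a : ℝ} (ha : 0 < a) {msq : ℝ}
    (hmsq : 0 < msq) (N : ℕ) (C : ChargeData N) (i₀ : Ix N) :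
    ∃ K₀min : ℕ, ∀ K₀ : ℕ, K₀min ≤ K₀ → ∃ t₀ δ' CV : ℝ, 0 < t₀ ∧ 0 < δ' ∧ 0 ≤ CV ∧
      ∀ (P : HiggsLattice.Params), P.d = d → P.L = L → K₀ ∣ P.M →
      ∀ {k : ℕ}, 1 ≤ k → k ≤ P.K → (∀ μ, 3 * half P k K₀ ≤ P.sitesPerDir 0 μ) → P.mesh k ≤ 1 →
      ∀ (A B : HiggsLattice.VecField P 0) {δB δAB s : ℝ}, 0 ≤ δB → 0 ≤ δAB → 0 ≤ s →
        (∀ (z : HiggsLattice.Site P 0) (μ ν : Fin P.d), |B ⟨z.shift ν, μ⟩ - B ⟨z, μ⟩| ≤ δB) →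
        (∀ (z : HiggsLattice.Site P 0) (μ ν : Fin P.d), |(A + B) ⟨z.shift ν, μ⟩ - (A + B) ⟨z, μ⟩| ≤ δAB) →
        (P.L : ℝ) ^ k * δB * |C.e| ≤ t₀ → (P.L : ℝ) ^ k * δAB * |C.e| ≤ t₀ →
        (∀ b : HiggsLattice.PBond P 0, |A b| ≤ s) → P.mesh k * (|C.e| * s) ≤ 1 →
        ∀ x x' : HiggsLattice.Site P 0,
          (P.mesh 0 ^ P.d)⁻¹ * ∑ i' : Ix N, ‖B3Eq116TwoSidedExpansion.op116 C Finset.univ A B msq a k 1 1 (cb P N 0 (x', i')) x‖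
            ≤ CV * (P.mesh k * (|C.e| * s)) ^ 2 * (P.mesh k ^ 2 * (P.mesh k ^ P.d)⁻¹) *
                Real.exp (-(δ' * ((HiggsLattice.Site.tdist x x' : ℝ) / (P.L : ℝ) ^ k))) := by
  obtain ⟨K₀min, hK⟩ := ineq210_regularRegion_univ_small d L hd hL ha hmsq N C
  obtain ⟨_, _, P₀, hP₀1, hP₀d, hP₀L, _⟩ := regularRegion_hypotheses_nonvacuous d L hd hL 0
  have hP₀3 : P₀.d ≤ 3 := by rw [hP₀d]; exact hd3
  have hd0 : (0 : ℝ) < (d : ℝ) := by exact_mod_cast hd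
  refine ⟨K₀min, fun K₀ hK₀ => ?_⟩
  obtain ⟨t, δ₁, Cst, ht, hδ₁, hCst, h⟩ := hK K₀ hK₀
  have hδm : 0 < min δ₁ 1 := lt_min hδ₁ one_pos
  refine ⟨min t (1 / (3 * (d : ℝ) ^ 2)), rate116 P₀ a (min δ₁ 1), cv116 P₀ N a (min δ₁ 1) Cst, lt_min ht (by positivity),
    rate116_pos (P := P₀) hP₀1 ha hδm, cv116_nonneg (P := P₀) hP₀1 ha hδm hCst.le hP₀3 N, ?_⟩
  intro P hPd hPL hK₀M k hk1 hkK h3 hmesh A B δB δAB s hδB hδAB hs hregB hregAB htB htAB hA hts x x'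
  have hP1 : 1 < P.L := by rw [hPL]; omega
  have hPd3 : P.d ≤ 3 := by rw [hPd]; exact hd3
  have h210B := ineq210_rate_mono (P := P) hCst.le (min_le_left δ₁ 1)
    (h P hP1 hPd hPL hK₀M hk1 hkK h3 hmesh B hδB hregB (htB.trans (min_le_left _ _)))
  have h210AB := ineq210_rate_mono (P := P) hCst.le (min_le_left δ₁ 1)
    (h P hP1 hPd hPL hK₀M hk1 hkK h3 hmesh (A + B) hδAB hregAB (htAB.trans (min_le_left _ _)))
  -- `d²ε|e|L^{2k}δ_{A+B} = d²·(L^kε)·(L^kδ_{A+B}|e|) ≤ d²·1·(1/(3d²)) = 1/3`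
  have hsmall : (P.d : ℝ) ^ 2 * (P.mesh 0 * |C.e|) * ((P.L : ℝ) ^ k) ^ 2 * δAB ≤ 1 / 3 := by
    have hmk : P.mesh k = (P.L : ℝ) ^ k * P.mesh 0 := B3Ineq210RegularTorus.mesh_eq_pow_mul P k
    have key : (P.d : ℝ) ^ 2 * (P.mesh 0 * |C.e|) * ((P.L : ℝ) ^ k) ^ 2 * δAB
        = (P.d : ℝ) ^ 2 * P.mesh k * ((P.L : ℝ) ^ k * δAB * |C.e|) := by rw [hmk]; ring
    rw [key, hPd]
    have h1 : (P.L : ℝ) ^ k * δAB * |C.e| ≤ 1 / (3 * (d : ℝ) ^ 2) := htAB.trans (min_le_right _ _)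
    have h2 : (d : ℝ) ^ 2 * P.mesh k ≤ (d : ℝ) ^ 2 * 1 := mul_le_mul_of_nonneg_left hmesh (by positivity)
    calc (d : ℝ) ^ 2 * P.mesh k * ((P.L : ℝ) ^ k * δAB * |C.e|) ≤ (d : ℝ) ^ 2 * 1 * (1 / (3 * (d : ℝ) ^ 2)) :=
          mul_le_mul h2 h1 (by positivity) (by positivity)
      _ = 1 / 3 := by field_simp
  have hmain := kernel116_one_one_decay_le (hL1 := hP1) (hδ₁ := hδm) (hCst := hCst.le) (ha := ha) (hd3 := hPd3) (hs := hs)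
    (ht := hts) (x := x) (x' := x') (hδ₁1 := min_le_right δ₁ 1) (h210B := h210B) (h210AB := h210AB) (hmsq := hmsq) (hk := hk1)
    (hkK := hkK) (i₀ := i₀) (hA := hA) (hreg := hregAB) (hsmall := hsmall)
  have hdd : P.d = P₀.d := hPd.trans hP₀d.symm
  have hLL : P.L = P₀.L := hPL.trans hP₀L.symm
  rw [cv116_congr hdd hLL, rate116_congr hdd hLL] at hmain
  exact hmain

end TorusPackaged

end Literature.MathematicalPhysics.QuantumFieldTheory.Balaban1983to89.B3Op116KernelRegularTorusDecay

end
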